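import Literature.Barriers.Parity.FriedlanderGranvilleUniformityMatrix
import Literature.NumberTheory.LFunctions.PageUniformPNTConductor
import Mathlib.NumberTheory.Primorial
import HarnessLib

/-!
# Lemmas for the proof of the Friedlander–Granville uniformity theorem

Topic `Literature/Barriers/Parity` (support file 5/6 for the discharge of
`Literature.Barriers.Parity.FriedlanderGranvilleUniformityBarrier`, Friedlander–Granville,
*Limitations to the equi-distribution of primes III*, Compositio Math. 81 (1992), Theorem p. 20;
the discharge itself is `FriedlanderGranvilleUniformityProofs.lean`). Everything here is PROVED;
there are no definitions. Grouping namespace `Literature.Barriers.Parity.FriedlanderGranville`.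

Contents (see the module docstring of `FriedlanderGranvilleUniformityProofs.lean` for the plan of
the proof and the changes of parameters relative to the source):

* the exceptional conductor and the bad columns: `exceptional_split` (Proposition 2 of the source,
  for (1.5)) and `exceptional_nobad` (the Remark after it, for (1.6));
* the window of sieving primes (`window_facts`: Mertens), the good live columns from below
  (`card_good_live_ge`), the prime number theorem for the good columns (`pnt_good_columns`);
* elementary asymptotics in `L = log Q` and the conditions on `L` used by the wrappers
  (`facts_*`), small real-variable and bookkeeping lemmas (`hs1_of`, …, `ht6_of`);
* the deterministic cores `core15_at` and `core16_at`: the two-sided Maier-matrix count of §5 of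
  the source with ALL analytic inputs (sieve bounds, prime number theorem, Brun–Titchmarsh,
  smallness of the error terms) as explicit hypotheses.

## References

* J. Friedlander, A. Granville, Compositio Math. 81 (1992), 19–32: Theorem p. 20, §§4–5
  (`FriedlanderGranville1992`).
* K. Soundararajan, *The distribution of prime numbers* (2007), Lecture 3 (`Soundararajan2007Distribution`).
* H. L. Montgomery, R. C. Vaughan, *Multiplicative Number Theory I* (2007), §11 (`MontgomeryVaughan2007`).
-/

noncomputable section

open Finset Filter Real
open scoped ArithmeticFunction.omega

namespace Literature.Barriers.Parity.FriedlanderGranville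

open Literature.NumberTheory.Sieve Literature.NumberTheory.Sieve.MaierMatrix
open Literature.NumberTheory.Sieve.ShiftedWindowSieve

/-! ## The exceptional conductor and the bad columns (Proposition 2 of the source) -/

/-- A squarefree number all of whose prime factors are `≤ m` is at most `4^m`. [folklore] -/
theorem le_four_pow_of_primeFactors_le {g m : ℕ} (hg : Squarefree g) (h : ∀ p ∈ g.primeFactors, p ≤ m) :
    g ≤ 4 ^ m := by
  have h1 : g = ∏ p ∈ g.primeFactors, p := (Nat.prod_primeFactors_of_squarefree hg).symm
  have hsub : g.primeFactors ⊆ Nat.primesLE m := fun p hp ↦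
    Nat.mem_primesLE.2 ⟨h p hp, Nat.prime_of_mem_primeFactors hp⟩
  calc g = ∏ p ∈ g.primeFactors, p := h1
    _ ≤ ∏ p ∈ Nat.primesLE m, p :=
        prod_le_prod_of_subset_of_one_le' hsub fun p hp _ ↦ (Nat.prime_of_mem_primesLE hp).one_le
    _ = primorial m := (primorial_eq_prod_primesLE m).symm
    _ ≤ 4 ^ m := primorial_le_four_pow m

/-- **The bad columns** (the device of Proposition 2 of the source, with the exceptional conductor
`d` of Page's theorem): let `U, S₀` be finite sets of primes, every element of `U` being `≤ K₁`,
and let `d` be either `0` or larger than `K₀ · 4^{⌊K₁⌋}`. Then there are `K` and `S ⊆ S₀` with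
`#S₀ ≤ #S + 1` such that: `K = 0`, or `K ≥ K₀`, or `K` is a prime `> K₁` of `S₀` not in `S`; and
every `r ≥ 1` with `K ∤ r` has `d ∤ r · ∏_{p ∈ U ∪ S} p` (the column modulus `rP` is good).
(Case `d/(d,P₀) ≥ K₀`: `K = d/(d,P₀)`, `S = S₀`; otherwise `(d, P₀) > 4^{⌊K₁⌋}` has a prime factor
`p₁ > K₁`, necessarily in `S₀`, and `K = p₁`, `S = S₀ ∖ {p₁}`.)
[cite: FriedlanderGranville1992, §4 Proposition 2 and its proof] -/
theorem exceptional_split (U S₀ : Finset ℕ) (hU : ∀ p ∈ U, p.Prime) (hS₀ : ∀ p ∈ S₀, p.Prime)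
    {K₁ : ℝ} (hUK : ∀ p ∈ U, (p : ℝ) ≤ K₁) (K₀ d : ℕ)
    (hd : d = 0 ∨ (K₀ : ℝ) * 4 ^ ⌊K₁⌋₊ < d) :
    ∃ K : ℕ, ∃ S : Finset ℕ, S ⊆ S₀ ∧ #S₀ ≤ #S + 1 ∧
      (K = 0 ∨ K₀ ≤ K ∨ (K.Prime ∧ K₁ < K ∧ K ∈ S₀ ∧ K ∉ S)) ∧
      ∀ r : ℕ, 1 ≤ r → ¬ K ∣ r → ¬ d ∣ r * ∏ p ∈ U ∪ S, p := by
  classical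
  have squarefree_prod_primes : ∀ {s : Finset ℕ}, (∀ p ∈ s, p.Prime) → Squarefree (∏ p ∈ s, p) := by
    intro s hs
    refine (squarefree_primorial (s.sup id)).squarefree_of_dvd ?_
    rw [primorial_eq_prod_primesLE]
    exact prod_dvd_prod_of_subset _ _ _ fun p hp ↦ Nat.mem_primesLE.2 ⟨le_sup (f := id) hp, hs p hp⟩
  rcases hd with rfl | hd
  · refine ⟨0, S₀, subset_rfl, by omega, Or.inl rfl, fun r hr _ h0 ↦ ?_⟩
    rw [zero_dvd_iff] at h0
    have : 0 < r * ∏ p ∈ U ∪ S₀, p :=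
      Nat.mul_pos hr (prod_pos fun p hp ↦ ((mem_union.1 hp).elim (hU p) (hS₀ p)).pos)
    omega
  have hd0 : d ≠ 0 := by
    rintro rfl
    have : (0 : ℝ) ≤ (K₀ : ℝ) * 4 ^ ⌊K₁⌋₊ := by positivity
    simp at hd; linarith
  set P₀ : ℕ := ∏ p ∈ U ∪ S₀, p with hP₀
  have hUS₀ : ∀ p ∈ U ∪ S₀, p.Prime := fun p hp ↦ (mem_union.1 hp).elim (hU p) (hS₀ p)
  have hP₀pos : 0 < P₀ := prod_pos fun p hp ↦ (hUS₀ p hp).pos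
  have hP₀sq : Squarefree P₀ := squarefree_prod_primes hUS₀
  set g : ℕ := Nat.gcd d P₀ with hg
  have hg0 : 0 < g := Nat.gcd_pos_of_pos_left _ (Nat.pos_of_ne_zero hd0)
  set k₁ : ℕ := d / g with hk₁
  have hdk : d = g * k₁ := (Nat.mul_div_cancel' (Nat.gcd_dvd_left d P₀)).symm
  by_cases hcase : K₀ ≤ k₁
  · -- `K = k₁`
    refine ⟨k₁, S₀, subset_rfl, by omega, Or.inr (Or.inl hcase), fun r hr hKr hdvd ↦ hKr ?_⟩
    have hcop : Nat.Coprime k₁ (P₀ / g) := by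
      rw [hk₁, hg]; exact Nat.coprime_div_gcd_div_gcd hg0
    have hP₀g : P₀ = g * (P₀ / g) := (Nat.mul_div_cancel' (Nat.gcd_dvd_right d P₀)).symm
    rw [hdk] at hdvd
    have h1 : g * k₁ ∣ g * (r * (P₀ / g)) := by
      have : r * P₀ = g * (r * (P₀ / g)) := by rw [hP₀g]; ring_nf; rw [← hP₀g]
      rwa [this] at hdvd
    have h2 : k₁ ∣ r * (P₀ / g) := Nat.dvd_of_mul_dvd_mul_left hg0 h1
    exact hcop.dvd_of_dvd_mul_right h2
  · -- `k₁ < K₀`: a large prime factor of `g`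
    push Not at hcase
    have hgbig : (4 : ℝ) ^ ⌊K₁⌋₊ < g := by
      have h1 : (d : ℝ) = g * k₁ := by exact_mod_cast hdk
      have h2 : (k₁ : ℝ) < K₀ := by exact_mod_cast hcase
      have hg0' : (0 : ℝ) < g := by exact_mod_cast hg0
      by_contra hcon
      push Not at hcon
      have : (d : ℝ) < (K₀ : ℝ) * 4 ^ ⌊K₁⌋₊ := by
        rw [h1]
        calc (g : ℝ) * k₁ ≤ 4 ^ ⌊K₁⌋₊ * k₁ := mul_le_mul_of_nonneg_right hcon (Nat.cast_nonneg _)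
          _ < 4 ^ ⌊K₁⌋₊ * K₀ := mul_lt_mul_of_pos_left h2 (by positivity)
          _ = (K₀ : ℝ) * 4 ^ ⌊K₁⌋₊ := by ring
      linarith
    have hgsq : Squarefree g := hP₀sq.squarefree_of_dvd (Nat.gcd_dvd_right d P₀)
    -- some prime factor of `g` exceeds `K₁`
    obtain ⟨p₁, hp₁g, hp₁K⟩ : ∃ p₁ ∈ g.primeFactors, K₁ < p₁ := by
      by_contra hcon
      push Not at hcon
      have h1 : ∀ p ∈ g.primeFactors, p ≤ ⌊K₁⌋₊ := fun p hp ↦ Nat.le_floor (hcon p hp)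
      have h2 := le_four_pow_of_primeFactors_le hgsq h1
      have : (g : ℝ) ≤ 4 ^ ⌊K₁⌋₊ := by exact_mod_cast h2
      linarith
    have hp₁ : p₁.Prime := Nat.prime_of_mem_primeFactors hp₁g
    have hp₁d : p₁ ∣ d := (Nat.dvd_of_mem_primeFactors hp₁g).trans (Nat.gcd_dvd_left d P₀)
    have hp₁P₀ : p₁ ∣ P₀ := (Nat.dvd_of_mem_primeFactors hp₁g).trans (Nat.gcd_dvd_right d P₀)
    -- `p₁ ∈ S₀`
    have hp₁mem : p₁ ∈ U ∪ S₀ := by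
      rw [hP₀, (Nat.prime_iff.1 hp₁).dvd_finsetProd_iff] at hp₁P₀
      obtain ⟨q, hq, hpq⟩ := hp₁P₀
      have : p₁ = q := (Nat.prime_dvd_prime_iff_eq hp₁ (hUS₀ q hq)).1 hpq
      rwa [this]
    have hp₁U : p₁ ∉ U := fun h ↦ by have := hUK p₁ h; linarith
    have hp₁S₀ : p₁ ∈ S₀ := (mem_union.1 hp₁mem).resolve_left hp₁U
    refine ⟨p₁, S₀.erase p₁, erase_subset _ _, ?_, Or.inr (Or.inr ⟨hp₁, hp₁K, hp₁S₀,
      notMem_erase p₁ S₀⟩), fun r hr hKr hdvd ↦ hKr ?_⟩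
    · rw [card_erase_of_mem hp₁S₀]; omega
    · have h1 : p₁ ∣ r * ∏ p ∈ U ∪ S₀.erase p₁, p := hp₁d.trans hdvd
      rcases (Nat.Prime.dvd_mul hp₁).1 h1 with h | h
      · exact h
      · exfalso
        rw [(Nat.prime_iff.1 hp₁).dvd_finsetProd_iff] at h
        obtain ⟨q, hq, hpq⟩ := h
        have hqp : q.Prime := (mem_union.1 hq).elim (hU q) (fun h ↦ hS₀ q (mem_of_mem_erase h))
        have : p₁ = q := (Nat.prime_dvd_prime_iff_eq hp₁ hqp).1 hpq
        subst this
        rcases mem_union.1 hq with h | h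
        · exact hp₁U h
        · exact (notMem_erase p₁ S₀) h

/-! ## The window of sieving primes -/

/-- **No bad columns** (the Remark after Proposition 2 of the source, with the exceptional
conductor `d` of Page's theorem): let `U, S₀` be finite sets of primes, every element of `U`
being `≤ K₁`, every element of `S₀` being `≥ w > 1` and `≤ B`, and suppose `d = 0` or
`d > y² 4^{⌊K₁⌋}` (Siegel), and `y B < w^{R+1}`. Then after removing at most `R` primes from `S₀`
(obtaining `S`), NO column modulus `r ∏_{U ∪ S} p` with `1 ≤ r ≤ y` is divisible by `d`.
(With `g = (d, P₀)`, `k₁ = d/g`: if `k₁ > y` nothing is removed, since `d ∣ rP₀` forces `k₁ ∣ r`;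
otherwise `g ≥ d/y > y 4^{⌊K₁⌋}`, the part `g'` of `g` made of primes `> K₁` exceeds `y`, and the
least divisor `k > y` of `g'` has `k ≤ yB`, hence at most `R` prime factors, all in `S₀`; these are
removed, and `d ∣ rP` would force `k ∣ r ≤ y < k`.)
[cite: FriedlanderGranville1992, §4, Remark after the proof of Proposition 2] -/
theorem exceptional_nobad (U S₀ : Finset ℕ) (hU : ∀ p ∈ U, p.Prime) (hS₀ : ∀ p ∈ S₀, p.Prime)
    {K₁ w B : ℝ} (hUK : ∀ p ∈ U, (p : ℝ) ≤ K₁) (hw : 1 < w) (hS₀w : ∀ p ∈ S₀, w ≤ p)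
    (hS₀B : ∀ p ∈ S₀, (p : ℝ) ≤ B) {y R : ℕ} (hy : 1 ≤ y) (hR : (y : ℝ) * B < w ^ (R + 1)) (d : ℕ)
    (hd : d = 0 ∨ (y : ℝ) ^ 2 * 4 ^ ⌊K₁⌋₊ < d) :
    ∃ S : Finset ℕ, S ⊆ S₀ ∧ #S₀ ≤ #S + R ∧
      ∀ r : ℕ, 1 ≤ r → r ≤ y → ¬ d ∣ r * ∏ p ∈ U ∪ S, p := by
  classical
  have squarefree_prod_primes : ∀ {s : Finset ℕ}, (∀ p ∈ s, p.Prime) → Squarefree (∏ p ∈ s, p) := by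
    intro s hs
    refine (squarefree_primorial (s.sup id)).squarefree_of_dvd ?_
    rw [primorial_eq_prod_primesLE]
    exact prod_dvd_prod_of_subset _ _ _ fun p hp ↦ Nat.mem_primesLE.2 ⟨le_sup (f := id) hp, hs p hp⟩
  have hUS₀ : ∀ p ∈ U ∪ S₀, p.Prime := fun p hp ↦ (mem_union.1 hp).elim (hU p) (hS₀ p)
  rcases hd with rfl | hd
  · refine ⟨S₀, subset_rfl, by omega, fun r hr _ h0 ↦ ?_⟩
    rw [zero_dvd_iff] at h0
    have : 0 < r * ∏ p ∈ U ∪ S₀, p := Nat.mul_pos hr (prod_pos fun p hp ↦ (hUS₀ p hp).pos)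
    omega
  have hd0 : d ≠ 0 := by
    rintro rfl
    have : (0 : ℝ) ≤ (y : ℝ) ^ 2 * 4 ^ ⌊K₁⌋₊ := by positivity
    simp at hd; linarith
  set P₀ : ℕ := ∏ p ∈ U ∪ S₀, p with hP₀
  have hP₀pos : 0 < P₀ := prod_pos fun p hp ↦ (hUS₀ p hp).pos
  have hP₀sq : Squarefree P₀ := squarefree_prod_primes hUS₀
  set g : ℕ := Nat.gcd d P₀ with hg
  have hg0 : 0 < g := Nat.gcd_pos_of_pos_left _ (Nat.pos_of_ne_zero hd0)
  set k₁ : ℕ := d / g with hk₁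
  have hdk : d = g * k₁ := (Nat.mul_div_cancel' (Nat.gcd_dvd_left d P₀)).symm
  -- the key divisibility: `d ∣ r P` with `P ∣ P₀`... we treat the two cases
  by_cases hcase : y < k₁
  · -- nothing to remove
    refine ⟨S₀, subset_rfl, by omega, fun r hr hry hdvd ↦ ?_⟩
    have hcop : Nat.Coprime k₁ (P₀ / g) := by
      rw [hk₁, hg]; exact Nat.coprime_div_gcd_div_gcd hg0
    have hP₀g : P₀ = g * (P₀ / g) := (Nat.mul_div_cancel' (Nat.gcd_dvd_right d P₀)).symm
    rw [hdk] at hdvd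
    have h1 : g * k₁ ∣ g * (r * (P₀ / g)) := by
      have : r * P₀ = g * (r * (P₀ / g)) := by rw [hP₀g]; ring_nf; rw [← hP₀g]
      rwa [this] at hdvd
    have h2 : k₁ ∣ r * (P₀ / g) := Nat.dvd_of_mul_dvd_mul_left hg0 h1
    have h3 : k₁ ∣ r := hcop.dvd_of_dvd_mul_right h2
    have : k₁ ≤ r := Nat.le_of_dvd hr h3
    omega
  · push Not at hcase
    -- `g ≥ d / y > y 4^{⌊K₁⌋}`
    have hk₁0 : 0 < k₁ := by
      rcases Nat.eq_zero_or_pos k₁ with h | h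
      · rw [h, mul_zero] at hdk; exact absurd hdk hd0
      · exact h
    have hgbig : (y : ℝ) * 4 ^ ⌊K₁⌋₊ < g := by
      have h1 : (d : ℝ) = g * k₁ := by exact_mod_cast hdk
      have h2 : (k₁ : ℝ) ≤ y := by exact_mod_cast hcase
      have hg0' : (0 : ℝ) < g := by exact_mod_cast hg0
      have hy0 : (0 : ℝ) < y := by exact_mod_cast hy
      by_contra hcon
      push Not at hcon
      have : (d : ℝ) ≤ (y : ℝ) ^ 2 * 4 ^ ⌊K₁⌋₊ := by
        rw [h1]
        calc (g : ℝ) * k₁ ≤ (y * 4 ^ ⌊K₁⌋₊) * y := mul_le_mul hcon h2 (Nat.cast_nonneg _) (by positivity)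
          _ = (y : ℝ) ^ 2 * 4 ^ ⌊K₁⌋₊ := by ring
      linarith
    have hgsq : Squarefree g := hP₀sq.squarefree_of_dvd (Nat.gcd_dvd_right d P₀)
    -- `g' =` the part of `g` made of primes `> K₁`
    set G : Finset ℕ := g.primeFactors.filter (fun p : ℕ ↦ K₁ < (p : ℝ)) with hG
    set g' : ℕ := ∏ p ∈ G, p with hg'
    have hGprime : ∀ p ∈ G, p.Prime := fun p hp ↦ Nat.prime_of_mem_primeFactors (mem_filter.1 hp).1
    have hg'dvd : g' ∣ g := by
      rw [hg', ← Nat.prod_primeFactors_of_squarefree hgsq]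
      exact prod_dvd_prod_of_subset _ _ _ (filter_subset _ _)
    have hg'sq : Squarefree g' := squarefree_prod_primes hGprime
    -- `g ≤ g' 4^{⌊K₁⌋}`
    have hgle : (g : ℝ) ≤ g' * 4 ^ ⌊K₁⌋₊ := by
      have hsplit : g = g' * ∏ p ∈ g.primeFactors.filter (fun p : ℕ ↦ ¬ K₁ < (p : ℝ)), p := by
        rw [hg', hG, prod_filter_mul_prod_filter_not, Nat.prod_primeFactors_of_squarefree hgsq]
      have hsmall : (∏ p ∈ g.primeFactors.filter (fun p : ℕ ↦ ¬ K₁ < (p : ℝ)), p) ≤ 4 ^ ⌊K₁⌋₊ := by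
        have hsq : Squarefree (∏ p ∈ g.primeFactors.filter (fun p : ℕ ↦ ¬ K₁ < (p : ℝ)), p) :=
          squarefree_prod_primes fun p hp ↦ Nat.prime_of_mem_primeFactors (mem_filter.1 hp).1
        refine le_four_pow_of_primeFactors_le hsq fun p hp ↦ ?_
        have hpd := Nat.dvd_of_mem_primeFactors hp
        have hpp := Nat.prime_of_mem_primeFactors hp
        rw [(Nat.prime_iff.1 hpp).dvd_finsetProd_iff] at hpd
        obtain ⟨q, hq, hpq⟩ := hpd
        have hqp : p = q := (Nat.prime_dvd_prime_iff_eq hpp (Nat.prime_of_mem_primeFactors (mem_filter.1 hq).1)).1 hpq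
        subst hqp
        have : ¬ K₁ < (p : ℝ) := (mem_filter.1 hq).2
        push Not at this
        exact Nat.le_floor this
      calc (g : ℝ) = g' * ((∏ p ∈ g.primeFactors.filter (fun p : ℕ ↦ ¬ K₁ < (p : ℝ)), p : ℕ) : ℝ) := by
            exact_mod_cast hsplit
        _ ≤ g' * 4 ^ ⌊K₁⌋₊ := by
            refine mul_le_mul_of_nonneg_left ?_ (Nat.cast_nonneg _)
            exact_mod_cast hsmall
    have hg'y : y < g' := by
      have h4 : (0 : ℝ) < 4 ^ ⌊K₁⌋₊ := by positivity
      have : (y : ℝ) < g' := by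
        by_contra hcon; push Not at hcon
        have : (g' : ℝ) * 4 ^ ⌊K₁⌋₊ ≤ y * 4 ^ ⌊K₁⌋₊ := mul_le_mul_of_nonneg_right hcon h4.le
        linarith
      exact_mod_cast this
    -- the least divisor `k > y` of `g'`
    set Dk : Finset ℕ := g'.divisors.filter (fun k ↦ y < k) with hDk
    have hg'0 : g' ≠ 0 := Squarefree.ne_zero hg'sq
    have hDkne : Dk.Nonempty := ⟨g', mem_filter.2 ⟨Nat.mem_divisors_self _ hg'0, hg'y⟩⟩
    set k : ℕ := Dk.min' hDkne with hkdef
    have hkmem : k ∈ Dk := min'_mem _ _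
    obtain ⟨hkdiv, hyk⟩ := mem_filter.1 hkmem
    have hkg' : k ∣ g' := Nat.dvd_of_mem_divisors hkdiv
    have hksq : Squarefree k := hg'sq.squarefree_of_dvd hkg'
    have hk0 : k ≠ 0 := Squarefree.ne_zero hksq
    -- the primes of `k` are primes of `g'`: `> K₁`, in `S₀`
    have hkprimes : ∀ p ∈ k.primeFactors, p ∈ S₀ ∧ p ∉ U := by
      intro p hp
      have hpp := Nat.prime_of_mem_primeFactors hp
      have hpk := Nat.dvd_of_mem_primeFactors hp
      have hpg' : p ∣ g' := hpk.trans hkg'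
      rw [hg', (Nat.prime_iff.1 hpp).dvd_finsetProd_iff] at hpg'
      obtain ⟨q, hq, hpq⟩ := hpg'
      have hqp : p = q := (Nat.prime_dvd_prime_iff_eq hpp (hGprime q hq)).1 hpq
      subst hqp
      obtain ⟨hpg, hpK⟩ := mem_filter.1 hq
      have hpU : p ∉ U := fun h ↦ by have := hUK p h; linarith
      have hpP₀ : p ∣ P₀ := (Nat.dvd_of_mem_primeFactors hpg).trans (Nat.gcd_dvd_right d P₀)
      rw [hP₀, (Nat.prime_iff.1 hpp).dvd_finsetProd_iff] at hpP₀
      obtain ⟨q', hq', hpq'⟩ := hpP₀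
      have : p = q' := (Nat.prime_dvd_prime_iff_eq hpp (hUS₀ q' hq')).1 hpq'
      subst this
      exact ⟨(mem_union.1 hq').resolve_left hpU, hpU⟩
    -- `k ≤ y B`
    have hkyB : (k : ℝ) ≤ y * B := by
      -- take a prime `p ∣ k`; `k / p` is a divisor of `g'` not exceeding `y` (minimality), so `k ≤ y p ≤ y B`
      have hk1 : 1 < k := lt_of_le_of_lt hy hyk
      obtain ⟨p, hp, hpk⟩ := Nat.exists_prime_and_dvd hk1.ne'
      have hpmem : p ∈ k.primeFactors := Nat.mem_primeFactors.2 ⟨hp, hpk, hk0⟩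
      have hkp : k / p ∣ g' := (Nat.div_dvd_of_dvd hpk).trans hkg'
      have hkpy : k / p ≤ y := by
        by_contra hcon; push Not at hcon
        have hmem : k / p ∈ Dk := mem_filter.2 ⟨Nat.mem_divisors.2 ⟨hkp, hg'0⟩, hcon⟩
        have hmin : k ≤ k / p := by rw [hkdef]; exact min'_le _ _ hmem
        have : k / p < k := Nat.div_lt_self (by omega) hp.one_lt
        omega
      have hpB : (p : ℝ) ≤ B := hS₀B p (hkprimes p hpmem).1
      have hkeq : k = k / p * p := (Nat.div_mul_cancel hpk).symm
      calc (k : ℝ) = (k / p : ℕ) * p := by exact_mod_cast hkeq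
        _ ≤ y * B := mul_le_mul (by exact_mod_cast hkpy) hpB (Nat.cast_nonneg _) (Nat.cast_nonneg _)
    -- `#primeFactors k ≤ R`
    have hkcard : k.primeFactors.card ≤ R := by
      have h1 : (w : ℝ) ^ k.primeFactors.card ≤ k := by
        have hk' : (k : ℝ) = ∏ p ∈ k.primeFactors, (p : ℝ) := by
          rw [← Nat.cast_prod, Nat.prod_primeFactors_of_squarefree hksq]
        rw [hk', ← prod_const]
        exact prod_le_prod (fun p _ ↦ by linarith) fun p hp ↦ hS₀w p (hkprimes p hp).1
      have h2 : (w : ℝ) ^ k.primeFactors.card < w ^ (R + 1) := lt_of_le_of_lt (h1.trans hkyB) hR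
      have := (pow_lt_pow_iff_right₀ hw).1 h2
      omega
    refine ⟨S₀ \ k.primeFactors, sdiff_subset, ?_, fun r hr hry hdvd ↦ ?_⟩
    · have := card_sdiff_add_card_inter S₀ k.primeFactors
      have : #(S₀ ∩ k.primeFactors) ≤ k.primeFactors.card := card_le_card inter_subset_right
      omega
    · -- `k ∣ g ∣ d ∣ r P`, `(k, P) = 1`, so `k ∣ r ≤ y < k`
      have hkd : k ∣ d := hkg'.trans (hg'dvd.trans (Nat.gcd_dvd_left d P₀))
      have hkrP : k ∣ r * ∏ p ∈ U ∪ (S₀ \ k.primeFactors), p := hkd.trans hdvd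
      have hcop : Nat.Coprime k (∏ p ∈ U ∪ (S₀ \ k.primeFactors), p) := by
        refine Nat.Coprime.prod_right fun q hq ↦ ?_
        have hqp : q.Prime := (mem_union.1 hq).elim (hU q) (fun h ↦ hS₀ q (mem_sdiff.1 h).1)
        rw [Nat.Coprime, Nat.gcd_comm, Nat.Coprime.gcd_eq_one]
        refine (Nat.Prime.coprime_iff_not_dvd hqp).2 fun hqk ↦ ?_
        have hqmem : q ∈ k.primeFactors := Nat.mem_primeFactors.2 ⟨hqp, hqk, hk0⟩
        rcases mem_union.1 hq with h | h
        · exact (hkprimes q hqmem).2 h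
        · exact (mem_sdiff.1 h).2 hqmem
      have hkr : k ∣ r := hcop.dvd_of_dvd_mul_right hkrP
      have : k ≤ r := Nat.le_of_dvd hr hkr
      omega


/-- Removing `R` primes, all `> w > 0`, from a set lowers its reciprocal sum by at most `R/w`. [folklore] -/
theorem sum_inv_ge_of_subset {S T : Finset ℕ} {w : ℝ} (hw : 0 < w) (hT : ∀ p ∈ T, w < p)
    (hST : S ⊆ T) {R : ℕ} (hR : #T ≤ #S + R) :
    ∑ p ∈ T, (p : ℝ)⁻¹ - R * w⁻¹ ≤ ∑ p ∈ S, (p : ℝ)⁻¹ ∧ ∑ p ∈ S, (p : ℝ)⁻¹ ≤ ∑ p ∈ T, (p : ℝ)⁻¹ := by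
  classical
  have hsplit : ∑ p ∈ T, (p : ℝ)⁻¹ = ∑ p ∈ T \ S, (p : ℝ)⁻¹ + ∑ p ∈ S, (p : ℝ)⁻¹ :=
    (sum_sdiff hST).symm
  have hdiff : ∑ p ∈ T \ S, (p : ℝ)⁻¹ ≤ R * w⁻¹ := by
    have h1 : ∀ p ∈ T \ S, (p : ℝ)⁻¹ ≤ w⁻¹ := fun p hp ↦ by
      have hp := hT p (mem_sdiff.1 hp).1
      exact inv_anti₀ hw hp.le
    calc ∑ p ∈ T \ S, (p : ℝ)⁻¹ ≤ ∑ p ∈ T \ S, w⁻¹ := sum_le_sum h1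
      _ = #(T \ S) * w⁻¹ := by rw [sum_const, nsmul_eq_mul]
      _ ≤ R * w⁻¹ := by
          refine mul_le_mul_of_nonneg_right ?_ (inv_nonneg.2 hw.le)
          have : #(T \ S) + #S = #T := card_sdiff_add_card_eq_card hST
          exact_mod_cast (show #(T \ S) ≤ R by omega)
  have hnn : 0 ≤ ∑ p ∈ T \ S, (p : ℝ)⁻¹ := sum_nonneg fun p _ ↦ inv_nonneg.2 (Nat.cast_nonneg p)
  constructor <;> linarith

/-- **The window** (as in the tree's proof of Maier's theorem, `Maier.matrix_rows`): let
`0 < c < b'`, `ℓ = log b' − log c < 7/10`, `L ≥ 1` with Mertens' theorem in the window at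
accuracy `ℓ/8` and `L^c` large in terms of `k, ℓ`; let `S` be obtained from the primes of
`(L^c, L^{b'}]` by removing at most `R` of them, `R/L^c ≤ ℓ/16`. Then `e_{k+1}(S) ≥ (ℓ/2)^{k+1}/(k+1)!`,
`W(S) ≥ 1/5`, `∑_{p∈S} 1/p ≤ 1`, `#S ≥ k + 1` and `#S ≤ L^{b'} + 1`.
[cite: Soundararajan2007Distribution, Lecture 3 Exercise 11] -/
theorem window_facts {L c b' ℓ : ℝ} {k R : ℕ} (hcb : c < b') (hL1 : 1 ≤ L)
    (hℓ0 : 0 < ℓ) (hℓ7 : ℓ < 7 / 10)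
    (hmert : |Literature.NumberTheory.LFunctions.Mertens.primeRecipSum (L ^ b') -
        Literature.NumberTheory.LFunctions.Mertens.primeRecipSum (L ^ c) - ℓ| ≤ ℓ / 8)
    (hLc : 2 * (k + 3) / ℓ ≤ L ^ c ∧ 16 / ℓ ≤ L ^ c ∧ 4 * k / ℓ ≤ L ^ c ∧ 1 ≤ L ^ c)
    (hR : (R : ℝ) / L ^ c ≤ ℓ / 16)
    {S : Finset ℕ} (hS : S ⊆ Nat.primesLE ⌊L ^ b'⌋₊ \ Nat.primesLE ⌊L ^ c⌋₊)
    (hSR : #(Nat.primesLE ⌊L ^ b'⌋₊ \ Nat.primesLE ⌊L ^ c⌋₊) ≤ #S + R) :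
    (ℓ / 2) ^ (k + 1) / (k + 1).factorial ≤ eSymm S (k + 1) ∧ 1 / 5 ≤ sieveDensity S ∧
      ∑ p ∈ S, (p : ℝ)⁻¹ ≤ 1 ∧ (k : ℝ) + 1 ≤ #S ∧ (#S : ℝ) ≤ L ^ b' + 1 ∧
      (∀ p ∈ S, p.Prime ∧ L ^ c < p ∧ (p : ℝ) ≤ L ^ b') := by
  obtain ⟨q2a, q2b, q2c, q2d⟩ := hLc
  have hL0 : 0 < L := by linarith
  set yv : ℝ := L ^ b' with hydef
  set w : ℝ := L ^ c with hwdef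
  have hw1 : 1 ≤ w := q2d
  have hw0 : 0 < w := by linarith
  have hwy : w ≤ yv := Real.rpow_le_rpow_of_exponent_le hL1 hcb.le
  have hy0 : 0 ≤ yv := by linarith
  set S₀ : Finset ℕ := Nat.primesLE ⌊yv⌋₊ \ Nat.primesLE ⌊w⌋₊ with hS₀def
  have hS₀prime : ∀ p ∈ S₀, p.Prime := fun p hp ↦ Nat.prime_of_mem_primesLE (mem_sdiff.1 hp).1
  have hS₀w : ∀ p ∈ S₀, w < p := by
    intro p hp
    obtain ⟨hp1, hp2⟩ := mem_sdiff.1 hp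
    have hpp := Nat.prime_of_mem_primesLE hp1
    have : ¬ p ≤ ⌊w⌋₊ := fun hle ↦ hp2 (Nat.mem_primesLE.2 ⟨hle, hpp⟩)
    exact (Nat.floor_lt hw0.le).1 (not_le.1 this)
  have hS₀y : ∀ p ∈ S₀, (p : ℝ) ≤ yv := fun p hp ↦
    (Nat.le_floor_iff hy0).1 (Nat.mem_primesLE.1 (mem_sdiff.1 hp).1).1
  have hSprime : ∀ p ∈ S, p.Prime := fun p hp ↦ hS₀prime p (hS hp)
  have hSw : ∀ p ∈ S, w < p := fun p hp ↦ hS₀w p (hS hp)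
  -- the reciprocal sums
  have hs₀ : ∑ p ∈ S₀, (p : ℝ)⁻¹ =
      Literature.NumberTheory.LFunctions.Mertens.primeRecipSum yv -
        Literature.NumberTheory.LFunctions.Mertens.primeRecipSum w := by
    unfold Literature.NumberTheory.LFunctions.Mertens.primeRecipSum
    rw [hS₀def, sum_sdiff_eq_sub]
    intro p hp
    rw [Nat.mem_primesLE] at hp ⊢
    exact ⟨hp.1.trans (Nat.floor_mono hwy), hp.2⟩
  have hs₀bounds : ℓ - ℓ / 8 ≤ ∑ p ∈ S₀, (p : ℝ)⁻¹ ∧ ∑ p ∈ S₀, (p : ℝ)⁻¹ ≤ ℓ + ℓ / 8 := by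
    rw [hs₀]; rw [abs_le] at hmert; constructor <;> linarith
  set sS : ℝ := ∑ p ∈ S, (p : ℝ)⁻¹ with hsSdef
  have hsub := sum_inv_ge_of_subset hw0 hS₀w hS hSR
  have hRw : (R : ℝ) * w⁻¹ ≤ ℓ / 16 := by rw [← div_eq_mul_inv]; exact hR
  have hsS : ℓ - ℓ / 8 - ℓ / 16 ≤ sS ∧ sS ≤ ℓ + ℓ / 8 := by
    constructor <;> linarith [hs₀bounds.1, hs₀bounds.2, hsub.1, hsub.2]
  have hkw : (k : ℝ) * w⁻¹ ≤ ℓ / 4 := by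
    rw [← div_eq_mul_inv, div_le_iff₀ hw0]
    have := (div_le_iff₀ hℓ0).1 q2c
    linarith
  have hW := one_sub_sum_le_sieveDensity S
  refine ⟨?_, ?_, ?_, ?_, ?_, fun p hp ↦ ⟨hSprime p hp, hSw p hp, hS₀y p (hS hp)⟩⟩
  · -- `e_{k+1}(S) ≥ η`
    have hm : ∀ p ∈ S, (p : ℝ)⁻¹ ≤ w⁻¹ := fun p hp ↦ by
      rw [inv_le_inv₀ (lt_trans hw0 (hSw p hp)) hw0]; exact (hSw p hp).le
    have h1 := pow_div_factorial_le_eSymm S (inv_nonneg.2 hw0.le) hm (k + 1)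
    refine le_trans ?_ h1
    rw [eSymm_one, ← hsSdef]
    push_cast
    simp only [add_sub_cancel_right]
    refine div_le_div_of_nonneg_right (pow_le_pow_left₀ (by positivity) ?_ _) (by positivity)
    refine le_trans ?_ (le_max_left _ _)
    linarith [hsS.1]
  · rw [← hsSdef] at hW; linarith [hsS.2]
  · linarith [hsS.2]
  · -- `#S ≥ k + 1`
    have h1 : sS ≤ #S * w⁻¹ := by
      rw [hsSdef]
      calc ∑ p ∈ S, (p : ℝ)⁻¹ ≤ ∑ p ∈ S, w⁻¹ := sum_le_sum fun p hp ↦ by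
            rw [inv_le_inv₀ (lt_trans hw0 (hSw p hp)) hw0]; exact (hSw p hp).le
        _ = #S * w⁻¹ := by rw [sum_const, nsmul_eq_mul]
    have h2 : ℓ / 2 ≤ sS := by linarith [hsS.1]
    have h3 : ℓ / 2 * w ≤ #S := by
      have := mul_le_mul_of_nonneg_right (h2.trans h1) hw0.le
      rwa [mul_assoc, inv_mul_cancel₀ hw0.ne', mul_one] at this
    have h4 : (2 * (k + 3) / ℓ) * (ℓ / 2) ≤ w * (ℓ / 2) := mul_le_mul_of_nonneg_right q2a (by positivity)
    have h5 : (2 * (k + 3) / ℓ) * (ℓ / 2) = k + 3 := by field_simp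
    linarith only [h3, h4, h5]
  · -- `#S ≤ L^{b'} + 1`
    have : #S ≤ ⌊yv⌋₊ + 1 := by
      calc #S ≤ #(Nat.primesLE ⌊yv⌋₊) := card_le_card (hS.trans sdiff_subset)
        _ ≤ #(range (⌊yv⌋₊ + 1)) := card_le_card (filter_subset _ _)
        _ = ⌊yv⌋₊ + 1 := card_range _
    have h2 : (⌊yv⌋₊ : ℝ) ≤ yv := Nat.floor_le hy0
    calc (#S : ℝ) ≤ ((⌊yv⌋₊ + 1 : ℕ) : ℝ) := by exact_mod_cast this
      _ = ⌊yv⌋₊ + 1 := by push_cast; ring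
      _ ≤ yv + 1 := by linarith

/-! ## The good live columns, from below (sieve side) -/

/-- **The number of good live columns, from below**: with the constant `C` of
`shiftedSiftedCount_window_ge_of_even`, under its hypotheses (even `k`) and with
`P = ∏_{p ∈ U ∪ S} p`, every prime of `a` outside `T` exceeding `w' > 0`, `a ≠ 0`:
`#{r ∈ liveSet a y P : K ∤ r} ≥ y V(T∪U) W(S) (1 + e_{k+1}(S)) − Err_sieve − ω(|a|) y/w' − y/K`.
[cite: FriedlanderGranville1992, §5 (5.1), (5.5)–(5.7)] -/
theorem card_good_live_ge {C : ℝ}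
    (hC : ∀ (T U S : Finset ℕ) (z w : ℝ) (y k : ℕ) (D : ℝ),
      (∀ p ∈ T, p.Prime) → (∀ p ∈ U, p.Prime) → (∀ p ∈ S, p.Prime) →
      (∀ p ∈ T, (p : ℝ) < z) → (∀ p ∈ U, (p : ℝ) < z) → (∀ p ∈ S, z ≤ (p : ℝ)) →
      (∀ p ∈ T, p ∉ U) → 1 ≤ w → (∀ p ∈ S, w < p) → ((y : ℝ) + 1 ≤ w ^ (k + 1)) →
      2 ≤ z → z ≤ D → Even k →
        y * sieveDensity (T ∪ U) * sieveDensity S * (1 + eSymm S (k + 1)) -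
            (C * Real.exp (-(Real.log D / Real.log z)) * y * sieveDensity (T ∪ U) *
                ∏ p ∈ S, (1 + (p : ℝ)⁻¹) + (k + 1) * (#S + 1) ^ k * D) ≤
          shiftedSiftedCount y T (U ∪ S))
    {T U S : Finset ℕ} {z w w' D : ℝ} {y k K : ℕ} {a : ℤ}
    (hT : ∀ p ∈ T, p.Prime) (hU : ∀ p ∈ U, p.Prime) (hS : ∀ p ∈ S, p.Prime)
    (hTz : ∀ p ∈ T, (p : ℝ) < z) (hUz : ∀ p ∈ U, (p : ℝ) < z) (hSz : ∀ p ∈ S, z ≤ (p : ℝ))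
    (hTU : ∀ p ∈ T, p ∉ U) (hw : 1 ≤ w) (hSw : ∀ p ∈ S, w < p) (hyw : (y : ℝ) + 1 ≤ w ^ (k + 1))
    (hz : 2 ≤ z) (hzD : z ≤ D) (hk : Even k)
    (hw' : 0 < w') (hout : ∀ p : ℕ, p.Prime → p ∣ a.natAbs → p ∉ T → w' < p) (ha : a ≠ 0) :
    y * sieveDensity (T ∪ U) * sieveDensity S * (1 + eSymm S (k + 1)) -
        (C * Real.exp (-(Real.log D / Real.log z)) * y * sieveDensity (T ∪ U) *
            ∏ p ∈ S, (1 + (p : ℝ)⁻¹) + (k + 1) * (#S + 1) ^ k * D) -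
        (a.natAbs.primeFactors.card : ℝ) * (y / w') - y / K ≤
      #((liveSet a y (∏ p ∈ U ∪ S, p)).filter fun r ↦ ¬ K ∣ r) := by
  have h1 := hC T U S z w y k D hT hU hS hTz hUz hSz hTU hw hSw hyw hz hzD hk
  have hUS : ∀ p ∈ U ∪ S, p.Prime := fun p hp ↦ (mem_union.1 hp).elim (hU p) (hS p)
  have h2 := shiftedSiftedCount_le_card_liveSet (y := y) (U := U) (S := S) (T := T) hw' hUS hout ha
  have h3 := card_liveSet_filter_ge a y (∏ p ∈ U ∪ S, p) K
  linarith

/-! ## The prime number theorem for the good live columns -/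

/-- **The prime number theorem in the good live columns**: if `(a, P) = 1`, every column modulus
`rP`, `r ≤ y`, has `log(rP) ≤ T₀`, the conclusion of `PageUniformPNT.chebyshevPsiMod_uniform_conductor`
holds at the scale `X_A` with exceptional conductor `d` for the moduli `q` with `log q ≤ T₀`, and
`d ∤ rP` whenever `K ∤ r`, then the hypothesis `hψ` of `card_mul_le_sum_columns` /
`sum_columns_le` holds for all `x ≥ X ≥ X_A`. [cite: FriedlanderGranville1992, §4–§5 (good moduli and (5.3))] -/
theorem pnt_good_columns {a : ℤ} {P y K X d : ℕ} {ε X_A T₀ : ℝ} (hP : 1 ≤ P)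
    (haP : IsCoprime a (P : ℤ))
    (hA : ∀ q : ℕ, 1 ≤ q → Real.log q ≤ T₀ → ¬ d ∣ q → ∀ u : (ZMod q)ˣ, ∀ x : ℝ, X_A ≤ x →
      |ParityWave0.chebyshevPsiMod q u x - x / q.totient| ≤ ε * (x / q.totient))
    (hlog : ∀ r : ℕ, 1 ≤ r → r ≤ y → Real.log ((r * P : ℕ) : ℝ) ≤ T₀)
    (hgood : ∀ r : ℕ, 1 ≤ r → ¬ K ∣ r → ¬ d ∣ r * P) (hX : X_A ≤ (X : ℝ)) :
    ∀ r ∈ (liveSet a y P).filter (fun r ↦ ¬ K ∣ r), ∀ x : ℝ, (X : ℝ) ≤ x →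
      |ParityWave0.chebyshevPsiMod (r * P) ((colResidue a r P : ℕ) : ZMod (r * P)) x -
          x / ((r * P).totient : ℝ)| ≤ ε * (x / ((r * P).totient : ℝ)) := by
  intro r hr x hx
  rw [mem_filter, liveSet, mem_filter, mem_Icc] at hr
  obtain ⟨⟨⟨hr1, hry⟩, hcop, hcopP⟩, hK⟩ := hr
  have hq1 : 1 ≤ r * P := Nat.mul_pos hr1 hP
  have hj : (colResidue a r P).Coprime (r * P) := (coprime_colResidue_iff hr1 hP haP).2 ⟨hcop, hcopP⟩
  have h := hA (r * P) hq1 (hlog r hr1 hry) (hgood r hr1 hK) (ZMod.unitOfCoprime _ hj) x (hX.trans hx)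
  rwa [ZMod.coe_unitOfCoprime] at h

/-! ## Elementary asymptotics in `L = log Q` -/

/-- For `0 < θ` and any real `C`: eventually `C log L ≤ L^θ`. [folklore] -/
theorem eventually_mul_log_le_rpow {θ : ℝ} (hθ : 0 < θ) (C : ℝ) :
    ∀ᶠ L : ℝ in atTop, C * Real.log L ≤ L ^ θ := by
  have h := (isLittleO_log_rpow_atTop hθ).bound (show (0 : ℝ) < 1 / (|C| + 1) by positivity)
  filter_upwards [h, eventually_ge_atTop (1 : ℝ)] with L hL hL1
  rw [Real.norm_eq_abs, Real.norm_eq_abs, abs_of_nonneg (Real.log_nonneg hL1),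
    abs_of_nonneg (Real.rpow_nonneg (by linarith) θ)] at hL
  have h0 : 0 ≤ Real.log L := Real.log_nonneg hL1
  have hpow : 0 ≤ L ^ θ := Real.rpow_nonneg (by linarith) θ
  have h1 : C * Real.log L ≤ (|C| + 1) * Real.log L := by nlinarith [le_abs_self C, abs_nonneg C]
  have h2 : (|C| + 1) * Real.log L ≤ (|C| + 1) * (1 / (|C| + 1) * L ^ θ) :=
    mul_le_mul_of_nonneg_left hL (by positivity)
  have h3 : (|C| + 1) * (1 / (|C| + 1) * L ^ θ) = L ^ θ := by field_simp
  linarith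

/-- For `0 < θ` and any `j`: eventually `(log L)^j ≤ L^θ`. [folklore] -/
theorem eventually_log_pow_le_rpow {θ : ℝ} (hθ : 0 < θ) (j : ℕ) :
    ∀ᶠ L : ℝ in atTop, Real.log L ^ j ≤ L ^ θ := by
  rcases Nat.eq_zero_or_pos j with hj | hj
  · filter_upwards [eventually_ge_atTop (1 : ℝ)] with L hL
    rw [hj, pow_zero]; exact Real.one_le_rpow hL hθ.le
  · have hθj : 0 < θ / j := div_pos hθ (by exact_mod_cast hj)
    filter_upwards [eventually_mul_log_le_rpow hθj 1, eventually_ge_atTop (1 : ℝ)] with L hL hL1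
    rw [one_mul] at hL
    calc Real.log L ^ j ≤ (L ^ (θ / j)) ^ j := pow_le_pow_left₀ (Real.log_nonneg hL1) hL j
      _ = L ^ θ := by
          rw [← Real.rpow_natCast, ← Real.rpow_mul (by linarith)]
          congr 1; field_simp

/-- For `θ₁ < θ₂`, `C ≥ 0`, `κ > 0` and any `j`: eventually `C (log L)^j L^{θ₁} ≤ κ L^{θ₂}`. [folklore] -/
theorem eventually_log_pow_mul_rpow_le {θ₁ θ₂ C κ : ℝ} (hθ : θ₁ < θ₂) (hC : 0 ≤ C) (hκ : 0 < κ)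
    (j : ℕ) : ∀ᶠ L : ℝ in atTop, C * Real.log L ^ j * L ^ θ₁ ≤ κ * L ^ θ₂ := by
  have hgap : 0 < (θ₂ - θ₁) / 2 := by linarith
  filter_upwards [eventually_log_pow_le_rpow hgap j,
    Maier.eventually_const_mul_rpow_le (C := C) (θ₁ := θ₁ + (θ₂ - θ₁) / 2) (θ₂ := θ₂) (by linarith) hκ,
    eventually_ge_atTop (1 : ℝ)] with L h1 h2 hL1
  have hL0 : 0 < L := by linarith
  calc C * Real.log L ^ j * L ^ θ₁ ≤ C * L ^ ((θ₂ - θ₁) / 2) * L ^ θ₁ := by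
        have := Real.rpow_nonneg hL0.le θ₁
        have h1' := mul_le_mul_of_nonneg_left h1 hC
        nlinarith
    _ = C * L ^ (θ₁ + (θ₂ - θ₁) / 2) := by rw [Real.rpow_add hL0]; ring
    _ ≤ κ * L ^ θ₂ := h2

/-- For `j : ℕ` and `α > 0`: eventually `L^j ≤ exp(α L)`. [folklore] -/
theorem eventually_pow_le_exp_mul {α : ℝ} (hα : 0 < α) (j : ℕ) :
    ∀ᶠ L : ℝ in atTop, L ^ j ≤ Real.exp (α * L) := by
  have h := (tendsto_pow_mul_exp_neg_atTop_nhds_zero j).comp (tendsto_id.const_mul_atTop hα)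
  have h1 : ∀ᶠ L : ℝ in atTop, (α * L) ^ j * Real.exp (-(α * L)) ≤ α ^ j := by
    have := h.eventually (eventually_le_nhds (show (0:ℝ) < α ^ j by positivity))
    filter_upwards [this] with L hL
    simpa using hL
  filter_upwards [h1, eventually_gt_atTop (0 : ℝ)] with L hL hL0
  rw [mul_pow, Real.exp_neg] at hL
  have hexp : 0 < Real.exp (α * L) := Real.exp_pos _
  have hαj : 0 < α ^ j := by positivity
  have : α ^ j * L ^ j ≤ α ^ j * Real.exp (α * L) := by
    have h2 := mul_le_mul_of_nonneg_right hL hexp.le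
    rw [mul_assoc, inv_mul_cancel₀ hexp.ne', mul_one] at h2
    linarith
  exact le_of_mul_le_mul_left this hαj

/-- **Sub-exponential growth**: for `α < 1`, `b < 1`, `C ≥ 0`, any real `β`, `κ > 0` and any `j`,
eventually `C L^j exp(α L + β L^b) ≤ κ (exp L − 1)`. [folklore] -/
theorem eventually_subexp_le {α b C β κ : ℝ} (hα : α < 1) (hb : b < 1) (hC : 0 ≤ C)
    (hκ : 0 < κ) (j : ℕ) :
    ∀ᶠ L : ℝ in atTop, C * L ^ j * Real.exp (α * L + β * L ^ b) ≤ κ * (Real.exp L - 1) := by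
  set g : ℝ := (1 - α) / 4 with hg
  have hg0 : 0 < g := by rw [hg]; linarith
  have h1 : ∀ᶠ L : ℝ in atTop, β * L ^ b ≤ g * L := by
    have := Maier.eventually_const_mul_rpow_le (C := β) (θ₁ := b) (θ₂ := 1) hb hg0
    filter_upwards [this, eventually_gt_atTop (0 : ℝ)] with L hL hL0
    rwa [Real.rpow_one] at hL
  have h2 := eventually_pow_le_exp_mul hg0 j
  have h3 : ∀ᶠ L : ℝ in atTop, C * Real.exp ((α + 2 * g) * L) ≤ κ / 2 * Real.exp L := by
    -- `C ≤ (κ/2) exp((1 - α - 2g) L)` eventually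
    have hpos : 0 < 1 - α - 2 * g := by rw [hg]; linarith
    have := (Real.tendsto_exp_atTop.comp (tendsto_id.const_mul_atTop hpos)).eventually_ge_atTop (2 * C / κ)
    filter_upwards [this] with L hL
    simp only [Function.comp, id] at hL
    have e : Real.exp L = Real.exp ((α + 2 * g) * L) * Real.exp ((1 - α - 2 * g) * L) := by
      rw [← Real.exp_add]; ring_nf
    rw [e]
    have hE : 0 < Real.exp ((α + 2 * g) * L) := Real.exp_pos _
    have : C ≤ κ / 2 * Real.exp ((1 - α - 2 * g) * L) := by
      rw [div_le_iff₀ hκ] at hL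
      linarith
    nlinarith
  have h4 : ∀ᶠ L : ℝ in atTop, (2 : ℝ) ≤ Real.exp L := Real.tendsto_exp_atTop.eventually_ge_atTop 2
  filter_upwards [h1, h2, h3, h4, eventually_gt_atTop (0 : ℝ)] with L hL1 hL2 hL3 hL4 hL0
  have e1 : Real.exp (α * L + β * L ^ b) ≤ Real.exp ((α + g) * L) := Real.exp_le_exp.2 (by linarith)
  have e2 : L ^ j * Real.exp ((α + g) * L) ≤ Real.exp ((α + 2 * g) * L) := by
    calc L ^ j * Real.exp ((α + g) * L) ≤ Real.exp (g * L) * Real.exp ((α + g) * L) :=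
          mul_le_mul_of_nonneg_right hL2 (Real.exp_pos _).le
      _ = Real.exp ((α + 2 * g) * L) := by rw [← Real.exp_add]; ring_nf
  have e3 : C * L ^ j * Real.exp (α * L + β * L ^ b) ≤ C * Real.exp ((α + 2 * g) * L) := by
    have := mul_le_mul_of_nonneg_left e1 (by positivity : 0 ≤ C * L ^ j)
    have := mul_le_mul_of_nonneg_left e2 hC
    nlinarith
  have e4 : κ / 2 * Real.exp L ≤ κ * (Real.exp L - 1) := by nlinarith [hL4, hκ]
  linarith

/-- **The saving `exp(−L/log L)` beats `4^{L^b}` and powers of `L`**: for `0 ≤ b < 1`, `C, c ≥ 0`,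
`κ > 0`: eventually `C (L + c)² log L · exp(L − L/log L + (log 4) L^b) ≤ κ (exp L − 1)`. [folklore] -/
theorem eventually_loglog_saving_le {b C c κ : ℝ} (hb0 : 0 ≤ b) (hb : b < 1) (hC : 0 ≤ C) (hc : 0 ≤ c)
    (hκ : 0 < κ) :
    ∀ᶠ L : ℝ in atTop, C * (L + c) ^ 2 * Real.log L * Real.exp (L - L / Real.log L + Real.log 4 * L ^ b) ≤
      κ * (Real.exp L - 1) := by
  have hlog4 : 0 < Real.log 4 := Real.log_pos (by norm_num)
  set θ₀ : ℝ := (1 + b) / 2 with hθ₀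
  have hθ₀0 : 0 < θ₀ := by rw [hθ₀]; linarith
  have hθ₀1 : θ₀ < 1 := by rw [hθ₀]; linarith
  have hbθ₀ : b < θ₀ := by rw [hθ₀]; linarith
  -- (a) `2 L^{θ₀} log L ≤ L`
  have ha : ∀ᶠ L : ℝ in atTop, 2 * L ^ θ₀ * Real.log L ≤ L := by
    filter_upwards [eventually_mul_log_le_rpow (show 0 < 1 - θ₀ by linarith) 2,
      eventually_gt_atTop (0 : ℝ)] with L hL hL0
    have e : L = L ^ θ₀ * L ^ (1 - θ₀) := by
      rw [← Real.rpow_add hL0]; norm_num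
    have hpos : 0 ≤ L ^ θ₀ := Real.rpow_nonneg hL0.le _
    calc 2 * L ^ θ₀ * Real.log L = L ^ θ₀ * (2 * Real.log L) := by ring
      _ ≤ L ^ θ₀ * L ^ (1 - θ₀) := mul_le_mul_of_nonneg_left hL hpos
      _ = L := e.symm
  -- (b) `log4 L^b ≤ L^{θ₀}/2`
  have hb' : ∀ᶠ L : ℝ in atTop, Real.log 4 * L ^ b ≤ 1 / 2 * L ^ θ₀ :=
    Maier.eventually_const_mul_rpow_le hbθ₀ (by norm_num)
  -- (c) `4 (C+1) L³ ≤ (κ/2) exp(L^{θ₀})`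
  have hc' : ∀ᶠ L : ℝ in atTop, 4 * (C + 1) * L ^ 3 ≤ κ / 2 * Real.exp (L ^ θ₀) := by
    filter_upwards [eventually_mul_log_le_rpow hθ₀0 4,
      eventually_ge_atTop (Real.exp (Real.log (8 * (C + 1) / κ))), eventually_ge_atTop (1 : ℝ)] with L h1 h2 hL1
    have hL0 : 0 < L := by linarith
    have h3 : Real.log (8 * (C + 1) / κ) ≤ Real.log L := by
      have := Real.log_le_log (Real.exp_pos _) h2
      rwa [Real.log_exp] at this
    have h4 : 3 * Real.log L + Real.log (8 * (C + 1) / κ) ≤ L ^ θ₀ := by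
      have h0 : 0 ≤ Real.log L := Real.log_nonneg hL1
      linarith
    have h5 : Real.exp (3 * Real.log L + Real.log (8 * (C + 1) / κ)) ≤ Real.exp (L ^ θ₀) :=
      Real.exp_le_exp.2 h4
    rw [Real.exp_add, Real.exp_log (by positivity), ← Real.log_rpow hL0, Real.exp_log (by positivity)] at h5
    have e : L ^ (3 : ℝ) = L ^ 3 := by norm_cast
    rw [e] at h5
    have : 4 * (C + 1) * L ^ 3 = κ / 2 * (L ^ 3 * (8 * (C + 1) / κ)) := by field_simp; norm_num
    rw [this]
    exact mul_le_mul_of_nonneg_left h5 (by positivity)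
  have hd : ∀ᶠ L : ℝ in atTop, (2 : ℝ) ≤ Real.exp L := Real.tendsto_exp_atTop.eventually_ge_atTop 2
  filter_upwards [ha, hb', hc', hd, eventually_ge_atTop (max c (Real.exp 1))] with L hL1 hL2 hL3 hL4 hL5
  have hLc : c ≤ L := (le_max_left _ _).trans hL5
  have hLe : Real.exp 1 ≤ L := (le_max_right _ _).trans hL5
  have hL0 : 0 < L := (Real.exp_pos 1).trans_le hLe
  have hlogL : 1 ≤ Real.log L := by
    have := Real.log_le_log (Real.exp_pos 1) hLe; rwa [Real.log_exp] at this
  -- `(L+c)² log L ≤ 4 L³`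
  have e1 : (L + c) ^ 2 * Real.log L ≤ 4 * L ^ 3 := by
    have f1 : (L + c) ^ 2 ≤ 4 * L ^ 2 := by nlinarith
    have f2 : Real.log L ≤ L := (Real.log_le_sub_one_of_pos hL0).trans (by linarith)
    calc (L + c) ^ 2 * Real.log L ≤ 4 * L ^ 2 * L := mul_le_mul f1 f2 (by linarith) (by positivity)
      _ = 4 * L ^ 3 := by ring
  -- the exponent: `L − L/log L + log4 L^b ≤ L − L^{θ₀}/2`... in fact `≤ L − (3/2) L^{θ₀}`
  have e2 : L - L / Real.log L + Real.log 4 * L ^ b ≤ L - L ^ θ₀ := by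
    have f1 : 2 * L ^ θ₀ ≤ L / Real.log L := by
      rw [le_div_iff₀ (by linarith)]; linarith
    have f2 : 0 ≤ L ^ θ₀ := Real.rpow_nonneg hL0.le _
    linarith
  have e3 : Real.exp (L - L / Real.log L + Real.log 4 * L ^ b) ≤ Real.exp (L - L ^ θ₀) := Real.exp_le_exp.2 e2
  calc C * (L + c) ^ 2 * Real.log L * Real.exp (L - L / Real.log L + Real.log 4 * L ^ b)
      ≤ (C * (4 * L ^ 3)) * Real.exp (L - L ^ θ₀) := by
        have f : C * (L + c) ^ 2 * Real.log L ≤ C * (4 * L ^ 3) := by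
          have := mul_le_mul_of_nonneg_left e1 hC; linarith
        exact mul_le_mul f e3 (Real.exp_pos _).le (by positivity)
    _ ≤ (4 * (C + 1) * L ^ 3) * Real.exp (L - L ^ θ₀) := by
        refine mul_le_mul_of_nonneg_right ?_ (Real.exp_pos _).le
        nlinarith [pow_nonneg hL0.le 3]
    _ ≤ κ / 2 * Real.exp (L ^ θ₀) * Real.exp (L - L ^ θ₀) := mul_le_mul_of_nonneg_right hL3 (Real.exp_pos _).le
    _ = κ / 2 * Real.exp L := by rw [mul_assoc, ← Real.exp_add]; ring_nf
    _ ≤ κ * (Real.exp L - 1) := by nlinarith [hL4, hκ]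


/-! ## Small real-variable lemmas for the wrappers -/

/-- `e^{1/m} − 1 ≤ 2/m` for `m ≥ 1`. [folklore] -/
theorem exp_inv_sub_one_le {m : ℕ} (hm : 1 ≤ m) : Real.exp ((m : ℝ)⁻¹) - 1 ≤ 2 * (m : ℝ)⁻¹ := by
  have hm1 : (1 : ℝ) ≤ m := by exact_mod_cast hm
  have h0 : 0 ≤ (m : ℝ)⁻¹ := by positivity
  have h1 : |(m : ℝ)⁻¹| ≤ 1 := by rw [abs_of_nonneg h0]; exact inv_le_one_of_one_le₀ hm1
  have := Real.abs_exp_sub_one_le h1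
  rw [abs_of_nonneg h0] at this
  exact (le_abs_self _).trans this

/-- The primes `≤ x` have product `≤ 4^x` (real form of `primorial_le_four_pow`). [folklore] -/
theorem prod_primes_le_four_rpow {S : Finset ℕ} {x : ℝ} (hx : 0 ≤ x) (hS : ∀ p ∈ S, p.Prime)
    (hSx : ∀ p ∈ S, (p : ℝ) ≤ x) : ((∏ p ∈ S, p : ℕ) : ℝ) ≤ (4 : ℝ) ^ x := by
  have hsub : S ⊆ Nat.primesLE ⌊x⌋₊ := fun p hp ↦
    Nat.mem_primesLE.2 ⟨Nat.le_floor (hSx p hp), hS p hp⟩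
  have h1 : (∏ p ∈ S, p) ≤ 4 ^ ⌊x⌋₊ := by
    calc (∏ p ∈ S, p) ≤ ∏ p ∈ Nat.primesLE ⌊x⌋₊, p :=
          prod_le_prod_of_subset_of_one_le' hsub fun p hp _ ↦ (Nat.prime_of_mem_primesLE hp).one_le
      _ = primorial ⌊x⌋₊ := (primorial_eq_prod_primesLE _).symm
      _ ≤ 4 ^ ⌊x⌋₊ := primorial_le_four_pow _
  calc ((∏ p ∈ S, p : ℕ) : ℝ) ≤ ((4 ^ ⌊x⌋₊ : ℕ) : ℝ) := by exact_mod_cast h1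
    _ = (4 : ℝ) ^ ((⌊x⌋₊ : ℕ) : ℝ) := by push_cast; rw [Real.rpow_natCast]
    _ ≤ (4 : ℝ) ^ x := Real.rpow_le_rpow_of_exponent_le (by norm_num) (Nat.floor_le hx)

/-- `4^x = exp(x log 4)`. [folklore] -/
theorem four_rpow_eq_exp (x : ℝ) : (4 : ℝ) ^ x = Real.exp (Real.log 4 * x) := by
  rw [Real.rpow_def_of_pos (by norm_num), mul_comm]



/-! ## The conditions on `L = log Q` for the proof of (1.5)/(1.6)

Each condition is an elementary "eventually in `L`" statement, isolated as a lemma with explicit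
parameters (small contexts elaborate fast). -/

/-- The key constant inequality for the window-sieve error: with `s⋆ = max(1, log(20000 e C_B/η))`
and `γ ≤ θ₁/(4 s⋆)`: `C_B e^{−θ₁/(3γ)} e ≤ η/20000`. [folklore] -/
theorem keyB_le {C_B η θ₁ γ sstar : ℝ} (hC : 0 < C_B) (hη : 0 < η) (hθ : 0 < θ₁) (hγ : 0 < γ)
    (hs : sstar = max 1 (Real.log (20000 * Real.exp 1 * C_B / η))) (hγs : γ ≤ θ₁ / (4 * sstar)) :
    C_B * Real.exp (-(θ₁ / (3 * γ))) * Real.exp 1 ≤ η / 20000 := by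
  have hs1 : 1 ≤ sstar := by rw [hs]; exact le_max_left _ _
  have hs0 : 0 < sstar := by linarith
  have h1 : sstar ≤ θ₁ / (3 * γ) := by
    rw [le_div_iff₀ (by positivity)]
    have := (le_div_iff₀ (by positivity)).1 hγs
    nlinarith
  have h2 : Real.exp (-(θ₁ / (3 * γ))) ≤ Real.exp (-sstar) := Real.exp_le_exp.2 (by linarith)
  have h3 : Real.exp (-sstar) ≤ η / (20000 * Real.exp 1 * C_B) := by
    have h4 : Real.log (20000 * Real.exp 1 * C_B / η) ≤ sstar := by rw [hs]; exact le_max_right _ _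
    have h5 := Real.exp_le_exp.2 h4
    rw [Real.exp_log (by positivity)] at h5
    rw [Real.exp_neg, inv_le_comm₀ (Real.exp_pos _) (by positivity), inv_div]
    exact h5
  calc C_B * Real.exp (-(θ₁ / (3 * γ))) * Real.exp 1
      ≤ C_B * (η / (20000 * Real.exp 1 * C_B)) * Real.exp 1 := by gcongr; exact h2.trans h3
    _ = η / 20000 := by field_simp

/-- Elementary sizes, part 1. [folklore] -/
theorem facts_sizes₁ {C₀ γ c θ₁ : ℝ} (hC₀ : 0 < C₀) (hγ : 0 < γ) (hγc : 2 * γ < c) (hγθ : 2 * γ < θ₁)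
    (hγ1 : 2 * γ < 1) :
    ∀ᶠ L : ℝ in atTop, 2 ≤ C₀ * Real.log L ∧ C₀ * Real.log L ≤ L ^ (2 * γ) ∧
      L ^ (2 * γ) + 2 ≤ L ^ (3 * γ) ∧ L ^ (2 * γ) + 1 ≤ L ^ c ∧ L ^ (2 * γ) + 1 ≤ L ^ θ₁ ∧
      L ^ (2 * γ) + 1 ≤ Real.exp (L / 2) := by
  have f1 : ∀ᶠ L : ℝ in atTop, 2 ≤ C₀ * Real.log L :=
    (Real.tendsto_log_atTop.const_mul_atTop hC₀).eventually_ge_atTop 2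
  have f2 : ∀ᶠ L : ℝ in atTop, C₀ * Real.log L ≤ L ^ (2 * γ) := eventually_mul_log_le_rpow (by positivity) C₀
  have f3 : ∀ᶠ L : ℝ in atTop, L ^ (2 * γ) + 2 ≤ L ^ (3 * γ) := by
    filter_upwards [Maier.eventually_const_mul_rpow_le (C := 2) (show 2 * γ < 3 * γ by linarith) one_pos,
      (tendsto_rpow_atTop (by positivity : 0 < 2 * γ)).eventually_ge_atTop 2] with L h1 h2
    linarith
  have aux : ∀ θ : ℝ, 2 * γ < θ → ∀ᶠ L : ℝ in atTop, L ^ (2 * γ) + 1 ≤ L ^ θ := by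
    intro θ hθ
    filter_upwards [Maier.eventually_const_mul_rpow_le (C := 2) hθ one_pos,
      (tendsto_rpow_atTop (by positivity : 0 < 2 * γ)).eventually_ge_atTop 1] with L h1 h2
    linarith
  have f6 : ∀ᶠ L : ℝ in atTop, L ^ (2 * γ) + 1 ≤ Real.exp (L / 2) := by
    filter_upwards [aux 1 hγ1, eventually_pow_le_exp_mul (show (0:ℝ) < 1 / 2 by norm_num) 1] with L h1 h2
    rw [Real.rpow_one] at h1
    rw [pow_one] at h2
    have : Real.exp (1 / 2 * L) = Real.exp (L / 2) := by ring_nf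
    linarith
  filter_upwards [f1, f2, f3, aux c hγc, aux θ₁ hγθ, f6] with L a1 a2 a3 a4 a5 a6
  exact ⟨a1, a2, a3, a4, a5, a6⟩

/-- Elementary sizes, part 2. [folklore] -/
theorem facts_sizes₂ {N A c b' : ℝ} {m : ℕ} (hN : 0 < N) (hmN : N ≤ m) (hA : 0 < A) (hcb : c ≤ b')
    (XA₀ x₀ : ℝ) :
    ∀ᶠ L : ℝ in atTop, 4 ≤ L ^ N ∧ A / 4 * Real.log L ≤ L ^ (A / 2) ∧
      (XA₀ ≤ Real.exp L / L ^ 2 ∧ 2 ≤ Real.exp L / L ^ 2) ∧ Real.exp L / L ^ 2 + 2 ≤ Real.exp L ∧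
      x₀ ≤ Real.exp L ∧ 4 ≤ L ∧ L ^ c ≤ L ^ b' ∧ 3 * L ^ N ≤ Real.exp (L / 4) := by
  have f7 : ∀ᶠ L : ℝ in atTop, 4 ≤ L ^ N := (tendsto_rpow_atTop hN).eventually_ge_atTop 4
  have f8 : ∀ᶠ L : ℝ in atTop, A / 4 * Real.log L ≤ L ^ (A / 2) := eventually_mul_log_le_rpow (by positivity) _
  have ht : Tendsto (fun L : ℝ ↦ Real.exp L / L ^ 2) atTop atTop := Real.tendsto_exp_div_pow_atTop 2
  have f9 : ∀ᶠ L : ℝ in atTop, XA₀ ≤ Real.exp L / L ^ 2 ∧ 2 ≤ Real.exp L / L ^ 2 :=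
    (ht.eventually_ge_atTop XA₀).and (ht.eventually_ge_atTop 2)
  have f10 : ∀ᶠ L : ℝ in atTop, Real.exp L / L ^ 2 + 2 ≤ Real.exp L := by
    filter_upwards [Real.tendsto_exp_atTop.eventually_ge_atTop (8 : ℝ), eventually_ge_atTop (2 : ℝ)] with L h1 h2
    have hL2 : (4 : ℝ) ≤ L ^ 2 := by nlinarith
    have : Real.exp L / L ^ 2 ≤ Real.exp L / 4 :=
      div_le_div_of_nonneg_left (Real.exp_pos L).le (by norm_num) hL2
    linarith
  have f11 : ∀ᶠ L : ℝ in atTop, x₀ ≤ Real.exp L := Real.tendsto_exp_atTop.eventually_ge_atTop x₀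
  have f12 : ∀ᶠ L : ℝ in atTop, (4 : ℝ) ≤ L := eventually_ge_atTop 4
  have f13 : ∀ᶠ L : ℝ in atTop, L ^ c ≤ L ^ b' := by
    filter_upwards [eventually_ge_atTop (1 : ℝ)] with L hL
    exact Real.rpow_le_rpow_of_exponent_le hL hcb
  have f14 : ∀ᶠ L : ℝ in atTop, 3 * L ^ N ≤ Real.exp (L / 4) := by
    have h8 : (0:ℝ) < 1 / 8 := by norm_num
    filter_upwards [eventually_pow_le_exp_mul h8 m,
      (Real.tendsto_exp_atTop.comp (tendsto_id.const_mul_atTop h8)).eventually_ge_atTop 3,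
      eventually_ge_atTop (1 : ℝ)] with L h1 h2 hL1
    simp only [Function.comp, id] at h2
    have h3 : L ^ N ≤ L ^ (m : ℝ) := Real.rpow_le_rpow_of_exponent_le hL1 hmN
    rw [Real.rpow_natCast] at h3
    have h4 : Real.exp (L / 4) = Real.exp (1 / 8 * L) * Real.exp (1 / 8 * L) := by
      rw [← Real.exp_add]; ring_nf
    rw [h4]
    have h5 : 0 < Real.exp (1 / 8 * L) := Real.exp_pos _
    calc 3 * L ^ N ≤ 3 * L ^ m := by linarith
      _ ≤ Real.exp (1 / 8 * L) * Real.exp (1 / 8 * L) :=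
          mul_le_mul h2 h1 (pow_nonneg (by linarith) m) h5.le
  filter_upwards [f7, f8, f9, f10, f11, f12, f13, f14] with L a7 a8 a9 a10 a11 a12 a13 a14
  exact ⟨a7, a8, a9, a10, a11, a12, a13, a14⟩

/-- The Siegel/Page split condition: `(L^{A/2} + 1) 4^{(A/4) log L} < (L − 2 log L)^A`. [folklore] -/
theorem facts_split {A : ℝ} (hA : 0 < A) :
    ∀ᶠ L : ℝ in atTop, (L ^ (A / 2) + 1) * (4 : ℝ) ^ (A / 4 * Real.log L) < (L - 2 * Real.log L) ^ A := by
  have hl4 : Real.log 4 < 7 / 5 := by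
    have : Real.log 4 = 2 * Real.log 2 := by
      rw [show (4 : ℝ) = 2 ^ 2 by norm_num, Real.log_pow]; norm_num
    rw [this]; have := Real.log_two_lt_d9; linarith
  have hexp : A / 2 + A / 4 * Real.log 4 < A := by nlinarith
  filter_upwards [Maier.eventually_const_mul_rpow_le (C := 2 * (2 : ℝ) ^ A + 1) hexp one_pos,
    eventually_mul_log_le_rpow one_pos 4, eventually_ge_atTop (1 : ℝ)] with L h1 h2 hL1
  have hL0 : 0 < L := by linarith
  rw [Real.rpow_one] at h2
  have e1 : (4 : ℝ) ^ (A / 4 * Real.log L) = L ^ (A / 4 * Real.log 4) := by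
    rw [Real.rpow_def_of_pos (by norm_num), Real.rpow_def_of_pos hL0]; ring_nf
  have h1A : 1 ≤ L ^ (A / 2) := Real.one_le_rpow hL1 (by positivity)
  have e2 : (L ^ (A / 2) + 1) * (4 : ℝ) ^ (A / 4 * Real.log L) ≤ 2 * L ^ (A / 2 + A / 4 * Real.log 4) := by
    rw [e1, Real.rpow_add hL0]
    have := Real.rpow_nonneg hL0.le (A / 4 * Real.log 4)
    nlinarith
  have e3 : L / 2 ≤ L - 2 * Real.log L := by linarith
  have e4 : (L / 2) ^ A ≤ (L - 2 * Real.log L) ^ A := Real.rpow_le_rpow (by positivity) e3 hA.le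
  have e5 : (L / 2) ^ A = L ^ A / 2 ^ A := by rw [Real.div_rpow hL0.le (by norm_num)]
  have h2A : (0 : ℝ) < 2 ^ A := by positivity
  have hpos : 0 < L ^ (A / 2 + A / 4 * Real.log 4) := Real.rpow_pos_of_pos hL0 _
  have e7 : 2 * L ^ (A / 2 + A / 4 * Real.log 4) < L ^ A / 2 ^ A := by
    rw [lt_div_iff₀ h2A]; nlinarith
  linarith

/-- The range of Page's theorem: `N log L + log 4 (L^{b'} + 1) ≤ (L − 2 log L)^{1/5}`. [folklore] -/
theorem facts_range {N b' : ℝ} (hN : 0 < N) (hb : b' < 1 / 5) :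
    ∀ᶠ L : ℝ in atTop, N * Real.log L + Real.log 4 * (L ^ b' + 1) ≤ (L - 2 * Real.log L) ^ (1 / 5 : ℝ) := by
  have hlog4 : 0 < Real.log 4 := Real.log_pos (by norm_num)
  filter_upwards [eventually_log_pow_mul_rpow_le (θ₁ := 0) (θ₂ := 1 / 5) (C := N) (κ := 1 / 8) (by norm_num)
      hN.le (by norm_num) 1, Maier.eventually_const_mul_rpow_le (C := Real.log 4) hb (by norm_num : (0:ℝ) < 1 / 8),
    (tendsto_rpow_atTop (by norm_num : (0:ℝ) < 1 / 5)).eventually_ge_atTop (8 * Real.log 4),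
    eventually_mul_log_le_rpow one_pos 4, eventually_ge_atTop (1 : ℝ)] with L h1 h2 h3 h4 hL1
  have hL0 : 0 < L := by linarith
  rw [pow_one, Real.rpow_zero, mul_one] at h1
  rw [Real.rpow_one] at h4
  have e3 : L / 2 ≤ L - 2 * Real.log L := by linarith
  have e4 : (L / 2) ^ (1 / 5 : ℝ) ≤ (L - 2 * Real.log L) ^ (1 / 5 : ℝ) :=
    Real.rpow_le_rpow (by positivity) e3 (by norm_num)
  have e5 : (1 / 2 : ℝ) * L ^ (1 / 5 : ℝ) ≤ (L / 2) ^ (1 / 5 : ℝ) := by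
    rw [Real.div_rpow hL0.le (by norm_num)]
    have h5 : (2 : ℝ) ^ (1 / 5 : ℝ) ≤ 2 := by
      calc (2 : ℝ) ^ (1 / 5 : ℝ) ≤ (2 : ℝ) ^ (1 : ℝ) :=
            Real.rpow_le_rpow_of_exponent_le (by norm_num) (by norm_num)
        _ = 2 := Real.rpow_one 2
    have h6 : 0 < (2 : ℝ) ^ (1 / 5 : ℝ) := by positivity
    rw [le_div_iff₀ h6]
    have := Real.rpow_nonneg hL0.le (1 / 5 : ℝ)
    nlinarith
  nlinarith

/-- The window error `(k+1)(L^{b'}+2)^k L^{θ₁}` against `L^N`. [folklore] -/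
theorem facts_windowErr {b' θ₁ N V η : ℝ} {k : ℕ} (hb : 0 < b') (hθ : 0 < θ₁) (hN : b' * k + θ₁ < N)
    (hV : 0 < V) (hη : 0 < η) :
    ∀ᶠ L : ℝ in atTop, (k + 1) * (L ^ b' + 2) ^ k * L ^ θ₁ * (V * Real.log L) * (20000 / η) ≤ L ^ N - 2 := by
  have hC : 0 ≤ (k + 1) * (2 : ℝ) ^ k * V * (20000 / η) := by positivity
  have hN0 : 0 < N := by nlinarith [(Nat.cast_nonneg k : (0:ℝ) ≤ k)]
  filter_upwards [eventually_log_pow_mul_rpow_le hN hC (by norm_num : (0:ℝ) < 1 / 2) 1,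
    (tendsto_rpow_atTop hb).eventually_ge_atTop 2, (tendsto_rpow_atTop hN0).eventually_ge_atTop 4,
    eventually_ge_atTop (1 : ℝ)] with L h1 h2 h3 hL1
  have hL0 : 0 < L := by linarith
  rw [pow_one] at h1
  have hl : 0 ≤ Real.log L := Real.log_nonneg hL1
  have e1 : (L ^ b' + 2) ^ k ≤ (2 * L ^ b') ^ k := pow_le_pow_left₀ (by positivity) (by linarith) k
  have e2 : (2 * L ^ b') ^ k = 2 ^ k * L ^ (b' * k) := by
    rw [mul_pow, ← Real.rpow_natCast (L ^ b') k, ← Real.rpow_mul hL0.le]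
  have hθpos : 0 ≤ L ^ θ₁ := Real.rpow_nonneg hL0.le θ₁
  have e3 : (k + 1) * (L ^ b' + 2) ^ k * L ^ θ₁ * (V * Real.log L) * (20000 / η) ≤
      (k + 1) * (2 ^ k * L ^ (b' * k)) * L ^ θ₁ * (V * Real.log L) * (20000 / η) := by
    have : (L ^ b' + 2) ^ k ≤ 2 ^ k * L ^ (b' * k) := e1.trans e2.le
    gcongr
  have e4 : (k + 1) * (2 ^ k * L ^ (b' * k)) * L ^ θ₁ * (V * Real.log L) * (20000 / η) =
      (k + 1) * 2 ^ k * V * (20000 / η) * Real.log L * L ^ (b' * k + θ₁) := by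
    rw [Real.rpow_add hL0]; ring
  linarith

/-- `ω(a) y / w'`: `20000 V log L · L^γ ≤ η L^{2γ}`. [folklore] -/
theorem facts_omega {γ V η : ℝ} (hγ : 0 < γ) (hV : 0 < V) (hη : 0 < η) :
    ∀ᶠ L : ℝ in atTop, 20000 * V * Real.log L * L ^ γ ≤ η * L ^ (2 * γ) := by
  have := eventually_log_pow_mul_rpow_le (θ₁ := γ) (θ₂ := 2 * γ) (C := 20000 * V) (κ := η) (by linarith)
    (by positivity) hη 1
  filter_upwards [this] with L h; rwa [pow_one] at h

/-- The columns: `2(e^L/L² + 1) ≤ (η/300)(e^L − 1)`. [folklore] -/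
theorem facts_X {η : ℝ} (hη : 0 < η) (hη1 : η ≤ 1) :
    ∀ᶠ L : ℝ in atTop, 2 * (Real.exp L / L ^ 2 + 1) ≤ η / 300 * (Real.exp L - 1) := by
  filter_upwards [eventually_ge_atTop (1800 / η + 1), Real.tendsto_exp_atTop.eventually_ge_atTop (1800 / η + 1),
    eventually_ge_atTop (1:ℝ)] with L h2 h3 hL1
  have hL2 : 1800 / η ≤ L ^ 2 := by nlinarith
  have e1 : Real.exp L / L ^ 2 ≤ Real.exp L / (1800 / η) :=
    div_le_div_of_nonneg_left (Real.exp_pos L).le (by positivity) hL2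
  have e2 : Real.exp L / (1800 / η) = η / 1800 * Real.exp L := by field_simp
  have e4 : η / 450 * (1800 / η + 1) ≤ η / 450 * Real.exp L := mul_le_mul_of_nonneg_left h3 (by positivity)
  have e5 : η / 450 * (1800 / η + 1) = 4 + η / 450 := by field_simp; ring
  have e1' : Real.exp L / L ^ 2 ≤ η / 1800 * Real.exp L := e1.trans e2.le
  linarith

/-- The columns: `2 e^{5L/8} (2L) 4^{L^{b'}+1} ≤ (η/300)(e^L − 1)`. [folklore] -/
theorem facts_sqrtX {b' η : ℝ} (hb1 : b' < 1) (hη : 0 < η) :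
    ∀ᶠ L : ℝ in atTop, 2 * Real.exp (5 * L / 8) * (2 * L) * (4 : ℝ) ^ (L ^ b' + 1) ≤ η / 300 * (Real.exp L - 1) := by
  have := eventually_subexp_le (α := 5 / 8) (b := b') (C := 16) (β := Real.log 4) (κ := η / 300) (by norm_num) hb1
    (by norm_num) (by positivity) 1
  filter_upwards [this] with L h
  rw [pow_one] at h
  have e : 2 * Real.exp (5 * L / 8) * (2 * L) * (4 : ℝ) ^ (L ^ b' + 1) =
      16 * L * Real.exp (5 / 8 * L + Real.log 4 * L ^ b') := by
    rw [four_rpow_eq_exp, mul_add, mul_one, Real.exp_add, Real.exp_add, Real.exp_log (by norm_num)]; ring_nf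
  rw [e]; exact h

/-- The rows: `(L + log 3 + N log L)(L + log 2)^{N−1} ≤ (1 + η/100)(L^N − 2)` and `log 3 + N log L ≤ L`.
[folklore] -/
theorem facts_rows {N η : ℝ} (hN : 1 ≤ N) (hη : 0 < η) (hη1 : η ≤ 1) :
    ∀ᶠ L : ℝ in atTop, (L + Real.log 3 + N * Real.log L) * (L + Real.log 2) ^ (N - 1) ≤ (1 + η / 100) * (L ^ N - 2) ∧
      Real.log 3 + N * Real.log L ≤ L := by
  have hN0 : 0 < N := by linarith
  have hlog3 : 0 ≤ Real.log 3 := Real.log_nonneg (by norm_num)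
  have hlog2 : 0 ≤ Real.log 2 := Real.log_nonneg (by norm_num)
  have hκ : (1:ℝ) < 1 + η / 400 := by linarith
  filter_upwards [Maier.eventually_add_rpow_le (a := Real.log 2) (A := N - 1) hlog2 hκ,
    eventually_log_pow_mul_rpow_le (θ₁ := 0) (θ₂ := 1) (C := N) (κ := η / 800) zero_lt_one hN0.le (by positivity) 1,
    eventually_ge_atTop (800 * Real.log 3 / η), (tendsto_rpow_atTop hN0).eventually_ge_atTop (1200 / η),
    eventually_mul_log_le_rpow one_pos (2 * N), eventually_ge_atTop (4:ℝ)] with L h1 h2 h3 h4 h5 hL4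
  have hL1 : (1:ℝ) ≤ L := by linarith
  have hL0 : 0 < L := by linarith
  rw [pow_one, Real.rpow_zero, mul_one, Real.rpow_one] at h2
  rw [Real.rpow_one] at h5
  have hlogL : 0 ≤ Real.log L := Real.log_nonneg hL1
  have hlog3' : Real.log 3 ≤ 2 := (Real.log_le_sub_one_of_pos (by norm_num)).trans (by norm_num)
  refine ⟨?_, by linarith⟩
  have e1 : Real.log 3 ≤ η / 800 * L := by
    rw [div_le_iff₀ hη] at h3; linarith
  have e2 : L + Real.log 3 + N * Real.log L ≤ (1 + η / 400) * L := by linarith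
  have e3 : 0 ≤ (L + Real.log 2) ^ (N - 1) := Real.rpow_nonneg (by linarith) _
  have e4 : (L + Real.log 3 + N * Real.log L) * (L + Real.log 2) ^ (N - 1) ≤
      (1 + η / 400) * L * ((1 + η / 400) * L ^ (N - 1)) := mul_le_mul e2 h1 e3 (by positivity)
  have e5 : L * L ^ (N - 1) = L ^ N := by
    rw [← Real.rpow_one_add' hL0.le (by linarith)]; ring_nf
  have e6 : (1 + η / 400) * L * ((1 + η / 400) * L ^ (N - 1)) = (1 + η / 400) ^ 2 * L ^ N := by
    rw [← e5]; ring
  have e7 : (1 + η / 400) ^ 2 ≤ 1 + η / 150 := by nlinarith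
  have hLN : 0 ≤ L ^ N := Real.rpow_nonneg hL0.le N
  have e8 : (1 + η / 150) * L ^ N ≤ (1 + η / 100) * (L ^ N - 2) := by
    rw [div_le_iff₀ hη] at h4; nlinarith
  calc (L + Real.log 3 + N * Real.log L) * (L + Real.log 2) ^ (N - 1)
      ≤ (1 + η / 400) ^ 2 * L ^ N := e4.trans e6.le
    _ ≤ (1 + η / 150) * L ^ N := mul_le_mul_of_nonneg_right e7 hLN
    _ ≤ (1 + η / 100) * (L ^ N - 2) := e8

/-- The row sieve: `C_F exp(−(L/2)/(3γ log L)) ≤ η/400`. [folklore] -/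
theorem facts_rowFL {C_F γ η : ℝ} (hC : 0 < C_F) (hγ : 0 < γ) (hη : 0 < η) :
    ∀ᶠ L : ℝ in atTop, C_F * Real.exp (-(L / 2 / (3 * γ * Real.log L))) ≤ η / 400 := by
  filter_upwards [eventually_mul_log_le_rpow one_pos (6 * γ * |Real.log (400 * C_F / η)| + 1),
    eventually_ge_atTop (Real.exp 1)] with L h1 h2
  rw [Real.rpow_one] at h1
  have hL0 : 0 < L := (Real.exp_pos 1).trans_le h2
  have hlogL : 1 ≤ Real.log L := by
    have := Real.log_le_log (Real.exp_pos 1) h2; rwa [Real.log_exp] at this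
  have hden : 0 < 3 * γ * Real.log L := by positivity
  have e1 : Real.log (400 * C_F / η) ≤ L / 2 / (3 * γ * Real.log L) := by
    rw [le_div_iff₀ hden]
    have : Real.log (400 * C_F / η) * (3 * γ * Real.log L) ≤ |Real.log (400 * C_F / η)| * (3 * γ * Real.log L) :=
      mul_le_mul_of_nonneg_right (le_abs_self _) hden.le
    nlinarith [abs_nonneg (Real.log (400 * C_F / η))]
  have e2 : Real.exp (-(L / 2 / (3 * γ * Real.log L))) ≤ Real.exp (-Real.log (400 * C_F / η)) :=
    Real.exp_le_exp.2 (by linarith)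
  rw [Real.exp_neg (Real.log _), Real.exp_log (by positivity)] at e2
  calc C_F * Real.exp (-(L / 2 / (3 * γ * Real.log L))) ≤ C_F * (400 * C_F / η)⁻¹ :=
        mul_le_mul_of_nonneg_left e2 hC.le
    _ = η / 400 := by field_simp

/-- The row sieve: `400 V log L e^{L/2} 4^{L^{b'}+1} ≤ η (e^L − 1)`. [folklore] -/
theorem facts_Drow {b' V η : ℝ} (hb1 : b' < 1) (hV : 0 < V) (hη : 0 < η) :
    ∀ᶠ L : ℝ in atTop, 400 * V * Real.log L * Real.exp (L / 2) * (4 : ℝ) ^ (L ^ b' + 1) ≤ η * (Real.exp L - 1) := by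
  have := eventually_subexp_le (α := 1 / 2) (b := b') (C := 1600 * V) (β := Real.log 4) (κ := η) (by norm_num) hb1
    (by positivity) hη 1
  filter_upwards [this, eventually_ge_atTop (1 : ℝ)] with L h hL1
  rw [pow_one] at h
  have hL0 : 0 < L := by linarith
  have hlogL : Real.log L ≤ L := (Real.log_le_sub_one_of_pos hL0).trans (by linarith)
  have hlog0 : 0 ≤ Real.log L := Real.log_nonneg hL1
  have e : 400 * V * Real.log L * Real.exp (L / 2) * (4 : ℝ) ^ (L ^ b' + 1) =
      1600 * V * Real.log L * Real.exp (1 / 2 * L + Real.log 4 * L ^ b') := by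
    rw [four_rpow_eq_exp, mul_add, mul_one, Real.exp_add, Real.exp_add, Real.exp_log (by norm_num)]; ring_nf
  rw [e]
  have hE := Real.exp_pos (1 / 2 * L + Real.log 4 * L ^ b')
  calc 1600 * V * Real.log L * Real.exp (1 / 2 * L + Real.log 4 * L ^ b')
      ≤ 1600 * V * L * Real.exp (1 / 2 * L + Real.log 4 * L ^ b') := by gcongr
    _ ≤ η * (Real.exp L - 1) := h

/-- The row weights: `e⁵ (L+1) 4^{L^{b'}+1} (V log L) 400 ≤ η (e^L − 1)`. [folklore] -/
theorem facts_weights {b' V η : ℝ} (hb1 : b' < 1) (hV : 0 < V) (hη : 0 < η) :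
    ∀ᶠ L : ℝ in atTop, Real.exp 5 * (L + 1) * (4 : ℝ) ^ (L ^ b' + 1) * (V * Real.log L) * 400 ≤ η * (Real.exp L - 1) := by
  have := eventually_subexp_le (α := 0) (b := b') (C := 3200 * Real.exp 5 * V) (β := Real.log 4) (κ := η)
    (by norm_num) hb1 (by positivity) hη 2
  filter_upwards [this, eventually_ge_atTop (1 : ℝ)] with L h hL1
  have hL0 : 0 < L := by linarith
  have hlogL : Real.log L ≤ L := (Real.log_le_sub_one_of_pos hL0).trans (by linarith)
  have hlog0 : 0 ≤ Real.log L := Real.log_nonneg hL1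
  have e : (4 : ℝ) ^ (L ^ b' + 1) = 4 * Real.exp (0 * L + Real.log 4 * L ^ b') := by
    rw [four_rpow_eq_exp, mul_add, mul_one, Real.exp_add, Real.exp_log (by norm_num), zero_mul, zero_add]; ring
  rw [e]
  have hE := Real.exp_pos (0 * L + Real.log 4 * L ^ b')
  have e2 : (L + 1) * Real.log L ≤ L ^ 2 * 2 := by nlinarith
  calc Real.exp 5 * (L + 1) * (4 * Real.exp (0 * L + Real.log 4 * L ^ b')) * (V * Real.log L) * 400
      = 1600 * Real.exp 5 * V * ((L + 1) * Real.log L) * Real.exp (0 * L + Real.log 4 * L ^ b') := by ring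
    _ ≤ 1600 * Real.exp 5 * V * (L ^ 2 * 2) * Real.exp (0 * L + Real.log 4 * L ^ b') := by gcongr
    _ = 3200 * Real.exp 5 * V * L ^ 2 * Real.exp (0 * L + Real.log 4 * L ^ b') := by ring
    _ ≤ η * (Real.exp L - 1) := h

/-- `hs5`, main part: `2L (V log L) 300 ≤ η (L^N − 2)` (`N > 1`). [folklore] -/
theorem facts_s5a {N V η : ℝ} (hN : 1 < N) (hV : 0 < V) (hη : 0 < η) :
    ∀ᶠ L : ℝ in atTop, 2 * L * (V * Real.log L) * 300 ≤ η * (L ^ N - 2) := by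
  have := eventually_log_pow_mul_rpow_le (θ₁ := 1) (θ₂ := N) (C := 600 * V) (κ := η / 2) hN
    (by positivity) (by positivity) 1
  filter_upwards [this, (tendsto_rpow_atTop (by linarith : 0 < N)).eventually_ge_atTop 4] with L h h4
  rw [pow_one, Real.rpow_one] at h
  nlinarith

/-- `hs5`, the `+1`: `2L 4^{L^{b'}+1} (V log L) 300 ≤ η (L^N − 2)(e^L − 1)`. [folklore] -/
theorem facts_s5b {N b' V η : ℝ} (hN : 0 < N) (hb1 : b' < 1) (hV : 0 < V) (hη : 0 < η) :
    ∀ᶠ L : ℝ in atTop, 2 * L * (4 : ℝ) ^ (L ^ b' + 1) * (V * Real.log L) * 300 ≤ η * ((L ^ N - 2) * (Real.exp L - 1)) := by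
  have := eventually_subexp_le (α := 0) (b := b') (C := 2400 * V) (β := Real.log 4) (κ := η) (by norm_num) hb1
    (by positivity) hη 2
  filter_upwards [this, (tendsto_rpow_atTop hN).eventually_ge_atTop 3, eventually_ge_atTop (1 : ℝ),
    Real.tendsto_exp_atTop.eventually_ge_atTop (1:ℝ)] with L h h3 hL1 hE1
  have hL0 : 0 < L := by linarith
  have hlogL : Real.log L ≤ L := (Real.log_le_sub_one_of_pos hL0).trans (by linarith)
  have hlog0 : 0 ≤ Real.log L := Real.log_nonneg hL1
  have e : (4 : ℝ) ^ (L ^ b' + 1) = 4 * Real.exp (0 * L + Real.log 4 * L ^ b') := by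
    rw [four_rpow_eq_exp, mul_add, mul_one, Real.exp_add, Real.exp_log (by norm_num), zero_mul, zero_add]; ring
  rw [e]
  have hE := Real.exp_pos (0 * L + Real.log 4 * L ^ b')
  have e1 : 2 * L * (4 * Real.exp (0 * L + Real.log 4 * L ^ b')) * (V * Real.log L) * 300 ≤
      2400 * V * L ^ 2 * Real.exp (0 * L + Real.log 4 * L ^ b') := by
    have : L * Real.log L ≤ L ^ 2 := by nlinarith
    calc 2 * L * (4 * Real.exp (0 * L + Real.log 4 * L ^ b')) * (V * Real.log L) * 300
        = 2400 * V * (L * Real.log L) * Real.exp (0 * L + Real.log 4 * L ^ b') := by ring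
      _ ≤ 2400 * V * L ^ 2 * Real.exp (0 * L + Real.log 4 * L ^ b') := by gcongr
  have e2 : η * (Real.exp L - 1) ≤ η * ((L ^ N - 2) * (Real.exp L - 1)) := by
    apply mul_le_mul_of_nonneg_left _ hη.le
    nlinarith
  linarith

/-- `hs5`, the violators: `2L e^{L − L/log L} 4^{L^{b'}+1} (V log L) 300 ≤ η (e^L − 1)`. [folklore] -/
theorem facts_s5c {b' V η : ℝ} (hb0 : 0 ≤ b') (hb1 : b' < 1) (hV : 0 < V) (hη : 0 < η) :
    ∀ᶠ L : ℝ in atTop, 2 * L * Real.exp (L - L / Real.log L) * (4 : ℝ) ^ (L ^ b' + 1) * (V * Real.log L) * 300 ≤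
      η * (Real.exp L - 1) := by
  have := eventually_loglog_saving_le (b := b') (C := 2400 * V) (c := 0) (κ := η) hb0 hb1 (by positivity) le_rfl hη
  filter_upwards [this, eventually_ge_atTop (1 : ℝ)] with L h hL1
  have hL0 : 0 < L := by linarith
  have hlog0 : 0 ≤ Real.log L := Real.log_nonneg hL1
  have e : 2 * L * Real.exp (L - L / Real.log L) * (4 : ℝ) ^ (L ^ b' + 1) * (V * Real.log L) * 300 =
      2400 * V * L * Real.log L * Real.exp (L - L / Real.log L + Real.log 4 * L ^ b') := by
    rw [four_rpow_eq_exp, mul_add, mul_one, Real.exp_add (Real.log 4 * L ^ b'), Real.exp_log (by norm_num),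
      Real.exp_add]
    ring
  rw [e]
  rw [add_zero] at h
  have hE := Real.exp_pos (L - L / Real.log L + Real.log 4 * L ^ b')
  calc 2400 * V * L * Real.log L * Real.exp (L - L / Real.log L + Real.log 4 * L ^ b')
      ≤ 2400 * V * L ^ 2 * Real.log L * Real.exp (L - L / Real.log L + Real.log 4 * L ^ b') := by
        have : L ≤ L ^ 2 := by nlinarith
        gcongr
    _ ≤ η * (Real.exp L - 1) := h


/-! ## Small lemmas for the wrappers -/

/-- A lower bound for the density of a set of primes `≤ n` when `log(n+2) ≤ B`. [folklore] -/
theorem sieveDensity_ge_of_log_le {R : Finset ℕ} (hR : ∀ p ∈ R, p.Prime) {n : ℕ} (hRn : ∀ p ∈ R, p ≤ n)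
    {B : ℝ} (hB : Real.log ((n : ℝ) + 2) ≤ B) : (Real.exp 5 * B)⁻¹ ≤ sieveDensity R := by
  have h1 := sieveDensity_ge hR (N := n + 2) (by omega) (fun p hp ↦ (hRn p hp).trans (by omega))
  have hlog : 0 < Real.log ((n : ℝ) + 2) := Real.log_pos (by have := (Nat.cast_nonneg n : (0:ℝ) ≤ n); linarith)
  have hB0 : 0 < B := hlog.trans_le hB
  calc (Real.exp 5 * B)⁻¹ = Real.exp (-5) / B := by rw [Real.exp_neg, mul_inv, div_eq_mul_inv]
    _ ≤ Real.exp (-5) / Real.log ((n : ℝ) + 2) := div_le_div_of_nonneg_left (Real.exp_pos _).le hlog hB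
    _ ≤ sieveDensity R := by push_cast at h1; exact h1

/-- `a` is coprime to a product of primes not dividing `|a|`. [folklore] -/
theorem isCoprime_prod_of_not_dvd {a : ℤ} {R : Finset ℕ} (hR : ∀ p ∈ R, p.Prime)
    (hRa : ∀ p ∈ R, ¬ p ∣ a.natAbs) : IsCoprime a ((∏ p ∈ R, p : ℕ) : ℤ) := by
  rw [Int.isCoprime_iff_gcd_eq_one, Int.gcd, Int.natAbs_natCast]
  exact Nat.Coprime.prod_right fun p hp ↦ (Nat.coprime_comm.1 ((Nat.Prime.coprime_iff_not_dvd (hR p hp)).2 (hRa p hp)))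

/-- The prime factors of a modulus `q ≡ a (mod P)` coprime to `a` avoid the primes of `P`
and the primes of `a`. [folklore] -/
theorem primeFactors_avoid {q : ℕ} {a : ℤ} {R : Finset ℕ} (hq : (q : ℤ) ≡ a [ZMOD ((∏ p ∈ R, p : ℕ) : ℤ)])
    (hgcd : Int.gcd (q : ℤ) a = 1) :
    ∀ p ∈ q.primeFactors, ¬ p ∣ a.natAbs ∧ p ∉ R := by
  intro p hp
  have hpp := Nat.prime_of_mem_primeFactors hp
  have hpq := Nat.dvd_of_mem_primeFactors hp
  have hpa : ¬ p ∣ a.natAbs := by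
    intro h
    have h1 : p ∣ Int.gcd (q : ℤ) a := by
      rw [Int.gcd, Int.natAbs_natCast]; exact Nat.dvd_gcd hpq h
    rw [hgcd] at h1
    exact hpp.one_lt.ne' (Nat.dvd_one.1 h1)
  refine ⟨hpa, fun hpR ↦ hpa ?_⟩
  have h1 : (p : ℤ) ∣ ((∏ r ∈ R, r : ℕ) : ℤ) := by exact_mod_cast dvd_prod_of_mem _ hpR
  have h2 : ((∏ r ∈ R, r : ℕ) : ℤ) ∣ (q : ℤ) - a := (Int.ModEq.dvd hq.symm)
  have h3 : (p : ℤ) ∣ (q : ℤ) - a := h1.trans h2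
  have h4 : (p : ℤ) ∣ (q : ℤ) := by exact_mod_cast hpq
  have h5 : (p : ℤ) ∣ a := by
    have := dvd_sub h4 h3; rwa [sub_sub_cancel] at this
  exact Int.natCast_dvd.1 h5 |> fun h ↦ by rwa [← Int.natCast_dvd_natCast, Int.natCast_natAbs, dvd_abs]

/-- Facts about `y = ⌊L^N⌋ − 1` when `L^N ≥ 4`. [folklore] -/
theorem yv_facts {x : ℝ} (hx : 4 ≤ x) :
    1 ≤ ⌊x⌋₊ - 1 ∧ ((⌊x⌋₊ - 1 : ℕ) : ℝ) + 1 ≤ x ∧ x - 2 ≤ ((⌊x⌋₊ - 1 : ℕ) : ℝ) ∧ ((⌊x⌋₊ - 1 : ℕ) : ℝ) ≤ x := by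
  have hx0 : 0 ≤ x := by linarith
  have h4 : 4 ≤ ⌊x⌋₊ := Nat.le_floor (by exact_mod_cast hx)
  have hfl : (⌊x⌋₊ : ℝ) ≤ x := Nat.floor_le hx0
  have hlt : x < ⌊x⌋₊ + 1 := Nat.lt_floor_add_one x
  have hcast : ((⌊x⌋₊ - 1 : ℕ) : ℝ) = ⌊x⌋₊ - 1 := by
    rw [Nat.cast_sub (by omega)]; simp
  refine ⟨by omega, ?_, ?_, ?_⟩ <;> rw [hcast] <;> linarith

/-- Facts about `Q₁ = ⌊Q⌋`, `Q₂ = ⌊2Q⌋` for `Q ≥ 4`. [folklore] -/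
theorem Qfloor_facts {Q : ℝ} (hQ : 4 ≤ Q) :
    ⌊Q⌋₊ ≤ ⌊2 * Q⌋₊ ∧ (⌊Q⌋₊ : ℝ) ≤ Q ∧ Q < ⌊Q⌋₊ + 1 ∧ (⌊2 * Q⌋₊ : ℝ) ≤ 2 * Q ∧ 2 * Q < ⌊2 * Q⌋₊ + 1 ∧
      2 ≤ ⌊2 * Q⌋₊ := by
  have hQ0 : 0 ≤ Q := by linarith
  refine ⟨Nat.floor_mono (by linarith), Nat.floor_le hQ0, Nat.lt_floor_add_one Q, Nat.floor_le (by linarith),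
    Nat.lt_floor_add_one _, Nat.le_floor ?_⟩
  push_cast; linarith

/-- Facts about `Xmax = 3 L^N e^L`. [folklore] -/
theorem Xmax_facts {L N : ℝ} (hL : 1 ≤ L) (hN : 0 < N) (h3 : 3 * L ^ N ≤ Real.exp (L / 4))
    (hlog : Real.log 3 + N * Real.log L ≤ L) :
    Real.log (3 * L ^ N * Real.exp L) = L + Real.log 3 + N * Real.log L ∧ 2 ≤ 3 * L ^ N * Real.exp L ∧
      Real.sqrt (3 * L ^ N * Real.exp L) ≤ Real.exp (5 * L / 8) ∧ Real.log (3 * L ^ N * Real.exp L) ≤ 2 * L := by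
  have hL0 : 0 < L := by linarith
  have hLN : 1 ≤ L ^ N := Real.one_le_rpow hL hN.le
  have hLN0 : 0 < L ^ N := by linarith
  have he : 1 ≤ Real.exp L := Real.one_le_exp (by linarith)
  have h1 : Real.log (3 * L ^ N * Real.exp L) = L + Real.log 3 + N * Real.log L := by
    rw [Real.log_mul (by positivity) (Real.exp_pos L).ne', Real.log_mul (by norm_num) hLN0.ne', Real.log_exp,
      Real.log_rpow hL0]; ring
  refine ⟨h1, by nlinarith, ?_, by rw [h1]; linarith⟩
  have h2 : 3 * L ^ N * Real.exp L ≤ Real.exp (5 * L / 8) ^ 2 := by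
    rw [← Real.exp_nat_mul]
    have : (2:ℕ) * (5 * L / 8) = L / 4 + L := by ring
    rw [this, Real.exp_add]
    exact mul_le_mul_of_nonneg_right h3 (Real.exp_pos L).le
  calc Real.sqrt (3 * L ^ N * Real.exp L) ≤ Real.sqrt (Real.exp (5 * L / 8) ^ 2) := Real.sqrt_le_sqrt h2
    _ = Real.exp (5 * L / 8) := Real.sqrt_sq (Real.exp_pos _).le

/-- The split hypothesis of `exceptional_split` from Siegel's bound `d ≥ (log X_A)^A`. [folklore] -/
theorem split_hyp {L A : ℝ} {d : ℕ} (hL : 1 ≤ L) (hA : 0 < A)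
    (hF : (L ^ (A / 2) + 1) * (4 : ℝ) ^ (A / 4 * Real.log L) < (L - 2 * Real.log L) ^ A)
    (hd : d = 0 ∨ Real.log (Real.exp L / L ^ 2) ^ A ≤ d) :
    d = 0 ∨ (⌈L ^ (A / 2)⌉₊ : ℝ) * 4 ^ ⌊A / 4 * Real.log L⌋₊ < d := by
  rcases hd with h | h
  · exact Or.inl h
  right
  have hL0 : 0 < L := by linarith
  have hlog : Real.log (Real.exp L / L ^ 2) = L - 2 * Real.log L := by
    rw [Real.log_div (Real.exp_pos L).ne' (by positivity), Real.log_exp, Real.log_pow]; ring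
  rw [hlog] at h
  have hK₁ : 0 ≤ A / 4 * Real.log L := by have := Real.log_nonneg hL; positivity
  have e1 : (⌈L ^ (A / 2)⌉₊ : ℝ) ≤ L ^ (A / 2) + 1 := (Nat.ceil_lt_add_one (Real.rpow_nonneg hL0.le _)).le
  have e2 : ((4 : ℝ) ^ ⌊A / 4 * Real.log L⌋₊ : ℝ) ≤ (4 : ℝ) ^ (A / 4 * Real.log L) := by
    rw [← Real.rpow_natCast]
    exact Real.rpow_le_rpow_of_exponent_le (by norm_num) (Nat.floor_le hK₁)
  have e3 : (0 : ℝ) ≤ 4 ^ ⌊A / 4 * Real.log L⌋₊ := by positivity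
  have e4 : 0 ≤ L ^ (A / 2) + 1 := by have := Real.rpow_nonneg hL0.le (A / 2); linarith
  calc (⌈L ^ (A / 2)⌉₊ : ℝ) * 4 ^ ⌊A / 4 * Real.log L⌋₊ ≤ (L ^ (A / 2) + 1) * (4 : ℝ) ^ (A / 4 * Real.log L) :=
        mul_le_mul e1 e2 e3 e4
    _ < (L - 2 * Real.log L) ^ A := hF
    _ ≤ d := h

/-- The range of the column moduli in Page's theorem. [folklore] -/
theorem pnt_range {L N b' : ℝ} {P y : ℕ} (hL : 1 ≤ L) (hP : 1 ≤ P) (hPle : (P : ℝ) ≤ (4 : ℝ) ^ (L ^ b' + 1))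
    (hy : (y : ℝ) ≤ L ^ N)
    (hF : N * Real.log L + Real.log 4 * (L ^ b' + 1) ≤ (L - 2 * Real.log L) ^ (1 / 5 : ℝ)) :
    ∀ r : ℕ, 1 ≤ r → r ≤ y → Real.log ((r * P : ℕ) : ℝ) ≤ Real.log (Real.exp L / L ^ 2) ^ (1 / 5 : ℝ) := by
  intro r hr hry
  have hL0 : 0 < L := by linarith
  have hlog : Real.log (Real.exp L / L ^ 2) = L - 2 * Real.log L := by
    rw [Real.log_div (Real.exp_pos L).ne' (by positivity), Real.log_exp, Real.log_pow]; ring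
  rw [hlog]
  have hr0 : (0 : ℝ) < r := by exact_mod_cast hr
  have hP0 : (0 : ℝ) < P := by exact_mod_cast hP
  have hrL : (r : ℝ) ≤ L ^ N := le_trans (by exact_mod_cast hry) hy
  have e1 : Real.log r ≤ N * Real.log L := by
    calc Real.log r ≤ Real.log (L ^ N) := Real.log_le_log hr0 hrL
      _ = N * Real.log L := Real.log_rpow hL0 N
  have e2 : Real.log P ≤ Real.log 4 * (L ^ b' + 1) := by
    calc Real.log P ≤ Real.log ((4 : ℝ) ^ (L ^ b' + 1)) := Real.log_le_log hP0 hPle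
      _ = (L ^ b' + 1) * Real.log 4 := Real.log_rpow (by norm_num) _
      _ = Real.log 4 * (L ^ b' + 1) := by ring
  push_cast
  rw [Real.log_mul hr0.ne' hP0.ne']
  linarith

/-- The bookkeeping of `hs1`. [folklore] -/
theorem hs1_of {C_B Ex Ex0 y yR V V₁ W Pi1 Sk T3 T4 η : ℝ} (hCB : 0 ≤ C_B) (hEx0 : 0 ≤ Ex) (hEx : Ex ≤ Ex0)
    (hkey : C_B * Ex0 * Real.exp 1 ≤ η / 20000) (hPi10 : 0 ≤ Pi1) (hPi1 : Pi1 ≤ Real.exp 1) (hy : 0 ≤ y) (hyR : yR ≤ y)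
    (hV₁ : 0 ≤ V₁) (hV : V₁ ≤ V) (hW : 1 / 5 ≤ W) (hη : 0 ≤ η)
    (hT2 : Sk ≤ η / 20000 * (yR * V₁)) (hT3 : T3 ≤ η / 20000 * (y * V₁)) (hT4 : T4 ≤ η / 20000 * (y * V₁)) :
    C_B * Ex * y * V * Pi1 + Sk + T3 + T4 ≤ η / 100 * (y * V * W) := by
  have hV0 : 0 ≤ V := hV₁.trans hV
  have e1 : C_B * Ex * y * V * Pi1 ≤ C_B * Ex0 * Real.exp 1 * (y * V) := by
    have : C_B * Ex * y * V * Pi1 = (C_B * (Ex * Pi1)) * (y * V) := by ring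
    rw [this]
    refine mul_le_mul_of_nonneg_right ?_ (by positivity)
    rw [mul_assoc]
    exact mul_le_mul_of_nonneg_left (mul_le_mul hEx hPi1 hPi10 (hEx0.trans hEx)) hCB
  have e2 : C_B * Ex0 * Real.exp 1 * (y * V) ≤ η / 20000 * (y * V) := mul_le_mul_of_nonneg_right hkey (by positivity)
  have e3 : η / 20000 * (yR * V₁) ≤ η / 20000 * (y * V) :=
    mul_le_mul_of_nonneg_left (mul_le_mul hyR hV hV₁ hy) (by positivity)
  have e4 : η / 20000 * (y * V₁) ≤ η / 20000 * (y * V) :=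
    mul_le_mul_of_nonneg_left (mul_le_mul_of_nonneg_left hV hy) (by positivity)
  have e5 : η / 5000 * (y * V) ≤ η / 100 * (y * V * W) := by
    have : η / 100 * (y * V * (1 / 5)) ≤ η / 100 * (y * V * W) :=
      mul_le_mul_of_nonneg_left (mul_le_mul_of_nonneg_left hW (by positivity)) (by positivity)
    have h0 : 0 ≤ η * (y * V) := mul_nonneg hη (mul_nonneg hy hV0)
    linarith
  linarith

/-- The bookkeeping of `hs2`. [folklore] -/
theorem hs2_of {ε η Q Q₁ Q₂ X L S₁ lX φP F : ℝ} (hε : ε = η / 20000) (hη0 : 0 ≤ η) (hL0 : 0 ≤ L) (hQ16 : 16 ≤ Q)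
    (hQ₁ : Q₁ ≤ Q) (hQ₂ : Q₂ ≤ 2 * Q) (hΔ : Q - 1 ≤ Q₂ - Q₁) (hX : X ≤ Q / L ^ 2 + 1) (hX0 : 0 ≤ X)
    (hF9 : 2 * (Q / L ^ 2 + 1) ≤ η / 300 * (Q - 1)) (hS₁ : Real.sqrt S₁ ≤ Real.exp (5 * L / 8))
    (hlX0 : 0 ≤ lX) (hlX : lX ≤ 2 * L) (hφ0 : 0 ≤ φP) (hφ : φP ≤ F)
    (hF10 : 2 * Real.exp (5 * L / 8) * (2 * L) * F ≤ η / 300 * (Q - 1)) (hη1 : η ≤ 1) :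
    ε * (3 * Q₁ + Q₂) + (1 + ε) * X + 2 * Real.sqrt S₁ * lX * φP ≤ η / 100 * (Q₂ - Q₁) := by
  have e1 : ε * (3 * Q₁ + Q₂) ≤ η / 4000 * Q := by
    rw [hε]; nlinarith
  have e2 : (1 + ε) * X ≤ 2 * (Q / L ^ 2 + 1) := by
    rw [hε]; nlinarith
  have e3 : 2 * Real.sqrt S₁ * lX * φP ≤ 2 * Real.exp (5 * L / 8) * (2 * L) * F := by
    have := Real.sqrt_nonneg S₁
    gcongr
  nlinarith

/-- The bookkeeping of `hs4`. [folklore] -/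
theorem hs4_of {C_F M Ex Drow em Wi η V_T V₁ : ℝ} (hM : 0 ≤ M) (hVT : V₁ ≤ V_T) (hV₁ : 0 ≤ V₁) (hη : 0 ≤ η)
    (h1 : C_F * Ex ≤ η / 400) (h2 : Drow ≤ η / 400 * (M * V_T)) (h3 : em ≤ η / 400 * V₁)
    (h4 : Wi ≤ η / 400 * (M * V_T)) :
    C_F * M * V_T * Ex + Drow + M * em + (Wi - 1) ≤ η / 100 * (M * V_T) := by
  have hVT0 : 0 ≤ V_T := hV₁.trans hVT
  have e1 : C_F * M * V_T * Ex = (C_F * Ex) * (M * V_T) := by ring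
  have e2 : (C_F * Ex) * (M * V_T) ≤ η / 400 * (M * V_T) := mul_le_mul_of_nonneg_right h1 (by positivity)
  have e3 : M * em ≤ M * (η / 400 * V_T) := mul_le_mul_of_nonneg_left (h3.trans (by gcongr)) hM
  nlinarith

/-- The bookkeeping of `hs5`. [folklore] -/
theorem hs5_of {lX L M y yR V_T V₁ Bv η : ℝ} (hlX : lX ≤ 2 * L) (hM : 0 ≤ M) (hy : 0 ≤ y)
    (hyR : yR ≤ y) (hVT : V₁ ≤ V_T) (hV₁ : 0 ≤ V₁) (hBv : 0 ≤ Bv) (hη : 0 ≤ η)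
    (h1 : 2 * L ≤ η / 300 * (yR * V₁)) (h2 : 2 * L ≤ η / 300 * (yR * V₁ * M)) (h3 : 2 * L * Bv ≤ η / 300 * (V₁ * M)) :
    lX * (M + 1 + y * Bv) ≤ η / 100 * (y * V_T * M) := by
  have hyV : yR * V₁ ≤ y * V_T := mul_le_mul hyR hVT hV₁ hy
  have e1 : lX * M ≤ η / 300 * (y * V_T) * M := by
    refine mul_le_mul_of_nonneg_right (hlX.trans (h1.trans ?_)) hM
    exact mul_le_mul_of_nonneg_left hyV (by positivity)
  have e2 : lX * 1 ≤ η / 300 * (y * V_T * M) := by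
    rw [mul_one]
    refine hlX.trans (h2.trans ?_)
    exact mul_le_mul_of_nonneg_left (mul_le_mul_of_nonneg_right hyV hM) (by positivity)
  have e3 : lX * (y * Bv) ≤ η / 300 * (y * V_T * M) := by
    have : lX * (y * Bv) = y * (lX * Bv) := by ring
    rw [this]
    have f1 : lX * Bv ≤ 2 * L * Bv := mul_le_mul_of_nonneg_right hlX hBv
    have f2 : η / 300 * (V₁ * M) ≤ η / 300 * (V_T * M) :=
      mul_le_mul_of_nonneg_left (mul_le_mul_of_nonneg_right hVT hM) (by positivity)
    have f3 : y * (lX * Bv) ≤ y * (η / 300 * (V_T * M)) := mul_le_mul_of_nonneg_left (by linarith) hy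
    linarith
  nlinarith


/-- The three small terms of `hs1` (window error, primes of `a`, bad columns), computed from the
conditions `f7`, `f8` and the size of `K`. [folklore] -/
theorem hs1_terms {L b' θ₁ N η V₁c γ A cS om y : ℝ} {k K : ℕ} (hL0 : 0 < L) (hη0 : 0 < η) (hV₁c0 : 0 < V₁c)
    (hlogL : 0 < Real.log L) (hA0 : 0 < A) (hcS0 : 0 ≤ cS) (hScardR : cS ≤ L ^ b' + 1)
    (f7 : (k + 1) * (L ^ b' + 2) ^ k * L ^ θ₁ * (V₁c * Real.log L) * (20000 / η) ≤ L ^ N - 2)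
    (homR : om ≤ L ^ γ) (f8 : 20000 * V₁c * Real.log L * L ^ γ ≤ η * L ^ (2 * γ)) (hy0 : 0 ≤ y)
    (hA : 80000 * V₁c ≤ η * A) (hK : K = 0 ∨ A / 4 * Real.log L ≤ (K : ℝ)) :
    (k + 1) * (cS + 1) ^ k * L ^ θ₁ ≤ η / 20000 * ((L ^ N - 2) * (V₁c * Real.log L)⁻¹) ∧
      om * (y / L ^ (2 * γ)) ≤ η / 20000 * (y * (V₁c * Real.log L)⁻¹) ∧
      y / (K : ℝ) ≤ η / 20000 * (y * (V₁c * Real.log L)⁻¹) := by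
  obtain ⟨Wl, hWl⟩ : ∃ Wl : ℝ, Wl = V₁c * Real.log L := ⟨_, rfl⟩
  have hWl0 : 0 < Wl := by rw [hWl]; positivity
  rw [show V₁c * Real.log L = Wl from hWl.symm] at f7 ⊢
  refine ⟨?_, ?_, ?_⟩
  · obtain ⟨Pk, hPk⟩ : ∃ Pk : ℝ, Pk = (L ^ b' + 2) ^ k := ⟨_, rfl⟩
    have e1 : (cS + 1) ^ k ≤ Pk := by
      rw [hPk]; exact pow_le_pow_left₀ (by positivity) (by linarith only [hScardR]) k
    have hθpos : 0 ≤ L ^ θ₁ := Real.rpow_nonneg hL0.le θ₁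
    have hk1 : (0 : ℝ) ≤ k + 1 := by positivity
    have e2 : (k + 1) * (cS + 1) ^ k * L ^ θ₁ ≤ (k + 1) * Pk * L ^ θ₁ :=
      mul_le_mul_of_nonneg_right (mul_le_mul_of_nonneg_left e1 hk1) hθpos
    rw [← hPk] at f7
    have e3 : (k + 1) * Pk * L ^ θ₁ ≤ η / 20000 * ((L ^ N - 2) * Wl⁻¹) := by
      rw [← div_eq_mul_inv, mul_div_assoc', le_div_iff₀ hWl0, div_mul_eq_mul_div,
        le_div_iff₀ (by norm_num : (0:ℝ) < 20000)]
      have := mul_le_mul_of_nonneg_left f7 hη0.le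
      have e : η * ((k + 1) * Pk * L ^ θ₁ * Wl * (20000 / η)) = (k + 1) * Pk * L ^ θ₁ * Wl * 20000 := by
        field_simp
      rw [e] at this
      linarith only [this]
    exact e2.trans e3
  · have hc20 : 0 < 20000 * Wl := by positivity
    have hLγ : 0 < L ^ (2 * γ) := Real.rpow_pos_of_pos hL0 _
    have e2 : L ^ γ ≤ η / 20000 * Wl⁻¹ * L ^ (2 * γ) := by
      have : η / 20000 * Wl⁻¹ * L ^ (2 * γ) = η * L ^ (2 * γ) / (20000 * Wl) := by field_simp
      rw [this, le_div_iff₀ hc20, hWl]; linarith only [f8]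
    calc om * (y / L ^ (2 * γ)) ≤ (η / 20000 * Wl⁻¹ * L ^ (2 * γ)) * (y / L ^ (2 * γ)) :=
          mul_le_mul_of_nonneg_right (homR.trans e2) (by positivity)
      _ = η / 20000 * (y * Wl⁻¹) := by field_simp
  · have hRHS : 0 ≤ η / 20000 * (y * Wl⁻¹) := by positivity
    have hK₁0 : 0 < A / 4 * Real.log L := by positivity
    have hcoef : 1 ≤ η / 20000 * Wl⁻¹ * (A / 4 * Real.log L) := by
      have : η / 20000 * Wl⁻¹ * (A / 4 * Real.log L) = η * A / (80000 * V₁c) := by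
        rw [hWl]; field_simp; norm_num
      rw [this, le_div_iff₀ (by positivity)]; linarith only [hA]
    rcases hK with hK0 | hKr
    · rw [hK0, Nat.cast_zero, div_zero]; exact hRHS
    · have hKr0 : 0 < (K : ℝ) := hK₁0.trans_le hKr
      calc y / (K : ℝ) ≤ y / (A / 4 * Real.log L) := div_le_div_of_nonneg_left hy0 hK₁0 hKr
        _ ≤ y / (A / 4 * Real.log L) * (η / 20000 * Wl⁻¹ * (A / 4 * Real.log L)) :=
            le_mul_of_one_le_right (by positivity) hcoef
        _ = η / 20000 * (y * Wl⁻¹) := by field_simp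


/-! ## Further conditions on `L`, for the proof of (1.6) -/

/-- Removed window primes: `L^γ + R + 1 ≤ (ℓ/16) L^c`. [folklore] -/
theorem facts_removed {γ c ℓ : ℝ} (hγc : γ < c) (hc : 0 < c) (hℓ : 0 < ℓ) (R : ℕ) :
    ∀ᶠ L : ℝ in atTop, L ^ γ + R + 1 ≤ ℓ / 16 * L ^ c := by
  filter_upwards [Maier.eventually_const_mul_rpow_le (C := 1) hγc (by positivity : 0 < ℓ / 32),
    (tendsto_rpow_atTop hc).eventually_ge_atTop (32 * (R + 1) / ℓ)] with L h1 h2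
  have h3 : (R : ℝ) + 1 ≤ ℓ / 32 * L ^ c := by
    have := (div_le_iff₀ hℓ).1 h2; nlinarith
  linarith

/-- The column length `y ≍ (L + log 2)^N` of (1.6). [folklore] -/
theorem facts_y {N c b' : ℝ} {k R m : ℕ} (hN : 0 < N) (hmN : N ≤ m) (hck : N < c * (k + 1))
    (hR : N + 1 + b' < c * (R + 1)) :
    ∀ᶠ L : ℝ in atTop, (L + Real.log 2) ^ N + 2 ≤ L ^ (N + 1) ∧ (L + Real.log 2) ^ N + 3 ≤ L ^ (c * (k + 1)) ∧
      L ^ (N + 1) * L ^ b' < (L ^ c) ^ (R + 1) ∧ 3 * ((L + Real.log 2) ^ N + 2) ≤ Real.exp (L / 4) := by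
  have hlog2 : 0 ≤ Real.log 2 := Real.log_nonneg (by norm_num)
  have h8 : (0:ℝ) < 1 / 8 := by norm_num
  filter_upwards [Maier.eventually_add_rpow_le (a := Real.log 2) (A := N) hlog2 one_lt_two,
    Maier.eventually_const_mul_rpow_le (C := 5) hck one_pos, (tendsto_rpow_atTop hN).eventually_ge_atTop 1,
    eventually_ge_atTop (5 : ℝ), eventually_pow_le_exp_mul h8 m,
    (Real.tendsto_exp_atTop.comp (tendsto_id.const_mul_atTop h8)).eventually_ge_atTop 12] with L h1 h2 h3 hL5 h5 h6
  simp only [Function.comp, id] at h6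
  have hL1 : (1 : ℝ) ≤ L := by linarith
  have hL0 : 0 < L := by linarith
  have e1 : L ^ (N + 1) = L ^ N * L := Real.rpow_add_one hL0.ne' N
  refine ⟨?_, by linarith, ?_, ?_⟩
  · rw [e1]; nlinarith
  · rw [← Real.rpow_add hL0, ← Real.rpow_natCast, ← Real.rpow_mul hL0.le]
    push_cast
    exact Real.rpow_lt_rpow_of_exponent_lt (by linarith) hR
  · have h7 : L ^ N ≤ L ^ (m : ℝ) := Real.rpow_le_rpow_of_exponent_le hL1 hmN
    rw [Real.rpow_natCast] at h7
    have h9 : Real.exp (L / 4) = Real.exp (1 / 8 * L) * Real.exp (1 / 8 * L) := by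
      rw [← Real.exp_add]; ring_nf
    rw [h9]
    have := Real.exp_pos (1 / 8 * L)
    calc 3 * ((L + Real.log 2) ^ N + 2) ≤ 12 * L ^ m := by nlinarith
      _ ≤ Real.exp (1 / 8 * L) * Real.exp (1 / 8 * L) := mul_le_mul h6 h5 (by positivity) this.le

/-- The Siegel/Page size condition for (1.6): `L^{2(N+1)} 4^{C₀ log L} < (L − 2 log L)^A` with
`A = 2N + 2C₀ + 4`. [folklore] -/
theorem facts_split₂ {N C₀ A : ℝ} (hN : 0 < N) (hC₀ : 0 < C₀) (hA : A = 2 * N + 2 * C₀ + 4) :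
    ∀ᶠ L : ℝ in atTop, L ^ (2 * (N + 1)) * (4 : ℝ) ^ (C₀ * Real.log L) < (L - 2 * Real.log L) ^ A := by
  have hl4 : Real.log 4 < 7 / 5 := by
    have : Real.log 4 = 2 * Real.log 2 := by
      rw [show (4 : ℝ) = 2 ^ 2 by norm_num, Real.log_pow]; norm_num
    rw [this]; have := Real.log_two_lt_d9; linarith
  have hl40 : 0 < Real.log 4 := Real.log_pos (by norm_num)
  have hA0 : 0 < A := by rw [hA]; positivity
  have hexp : 2 * (N + 1) + C₀ * Real.log 4 < A := by rw [hA]; nlinarith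
  filter_upwards [Maier.eventually_const_mul_rpow_le (C := (2 : ℝ) ^ A + 1) hexp one_pos,
    eventually_mul_log_le_rpow one_pos 4, eventually_ge_atTop (1 : ℝ)] with L h1 h2 hL1
  have hL0 : 0 < L := by linarith
  rw [Real.rpow_one] at h2
  have e1 : (4 : ℝ) ^ (C₀ * Real.log L) = L ^ (C₀ * Real.log 4) := by
    rw [Real.rpow_def_of_pos (by norm_num), Real.rpow_def_of_pos hL0]; ring_nf
  have e2 : L ^ (2 * (N + 1)) * (4 : ℝ) ^ (C₀ * Real.log L) = L ^ (2 * (N + 1) + C₀ * Real.log 4) := by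
    rw [e1, Real.rpow_add hL0]
  have e3 : L / 2 ≤ L - 2 * Real.log L := by linarith
  have e4 : (L / 2) ^ A ≤ (L - 2 * Real.log L) ^ A := Real.rpow_le_rpow (by positivity) e3 hA0.le
  have e5 : (L / 2) ^ A = L ^ A / 2 ^ A := by rw [Real.div_rpow hL0.le (by norm_num)]
  have h2A : (0 : ℝ) < 2 ^ A := by positivity
  have hpos : 0 < L ^ (2 * (N + 1) + C₀ * Real.log 4) := Real.rpow_pos_of_pos hL0 _
  have e7 : L ^ (2 * (N + 1) + C₀ * Real.log 4) < L ^ A / 2 ^ A := by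
    rw [lt_div_iff₀ h2A]; nlinarith
  rw [e2]; linarith

/-- The rows of (1.6), `ht1`. [folklore] -/
theorem facts_t1 {N η : ℝ} (hN : 0 < N) (hη : 0 < η) (hη1 : η ≤ 1) :
    ∀ᶠ L : ℝ in atTop, (1 - η / 100) * ((L + Real.log 2) ^ N + 2) * (L + Real.log 2 + N * Real.log (L + Real.log 2)) ≤
      (1 - η / 20000) * L ^ N * (L - 2 * Real.log L) := by
  have hlog2 : 0 ≤ Real.log 2 := Real.log_nonneg (by norm_num)
  have hlog2' : Real.log 2 < 7 / 10 := by have := Real.log_two_lt_d9; linarith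
  have hκ : (1:ℝ) < 1 + η / 1000 := by linarith
  filter_upwards [Maier.eventually_add_rpow_le (a := Real.log 2) (A := N) hlog2 hκ,
    (tendsto_rpow_atTop hN).eventually_ge_atTop (2000 / η),
    eventually_mul_log_le_rpow one_pos (2000 * (N + 1) / η), eventually_ge_atTop (2000 * (N + 1) / η),
    eventually_ge_atTop (1 : ℝ)] with L h1 h2 h3 h4 hL1
  have hL0 : 0 < L := by linarith
  rw [Real.rpow_one] at h3
  have hlogL : 0 ≤ Real.log L := Real.log_nonneg hL1
  have hLN : 0 ≤ L ^ N := Real.rpow_nonneg hL0.le N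
  -- `(L + log 2)^N + 2 ≤ (1 + η/500) L^N`
  have e1 : (L + Real.log 2) ^ N + 2 ≤ (1 + η / 500) * L ^ N := by
    rw [div_le_iff₀ hη] at h2; nlinarith
  -- `L + log 2 + N log(L + log 2) ≤ (1 + η/1000) L`
  have e2 : L + Real.log 2 + N * Real.log (L + Real.log 2) ≤ (1 + η / 1000) * L := by
    have f1 : Real.log (L + Real.log 2) ≤ Real.log L + 1 := by
      calc Real.log (L + Real.log 2) ≤ Real.log (2 * L) := Real.log_le_log (by linarith) (by linarith)
        _ = Real.log 2 + Real.log L := Real.log_mul two_ne_zero hL0.ne'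
        _ ≤ Real.log L + 1 := by linarith
    have f2 : N * Real.log (L + Real.log 2) ≤ N * (Real.log L + 1) := mul_le_mul_of_nonneg_left f1 hN.le
    have f3 : (2000 * (N + 1) / η) * Real.log L ≤ L := h3
    rw [div_mul_eq_mul_div, div_le_iff₀ hη] at f3
    rw [div_le_iff₀ hη] at h4
    nlinarith
  -- `L − 2 log L ≥ (1 − η/1000) L`
  have e3 : (1 - η / 1000) * L ≤ L - 2 * Real.log L := by
    have f3 : (2000 * (N + 1) / η) * Real.log L ≤ L := h3
    rw [div_mul_eq_mul_div, div_le_iff₀ hη] at f3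
    nlinarith
  have e4 : (1 - η / 100) * ((L + Real.log 2) ^ N + 2) * (L + Real.log 2 + N * Real.log (L + Real.log 2)) ≤
      (1 - η / 100) * ((1 + η / 500) * L ^ N) * ((1 + η / 1000) * L) := by
    have hpos1 : 0 ≤ (1 - η / 100) := by linarith
    have hpos2 : 0 ≤ (L + Real.log 2) ^ N + 2 := by have := Real.rpow_nonneg (by linarith : 0 ≤ L + Real.log 2) N; linarith
    have hpos3 : 0 ≤ L + Real.log 2 + N * Real.log (L + Real.log 2) := by
      have : 0 ≤ Real.log (L + Real.log 2) := Real.log_nonneg (by linarith); positivity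
    exact mul_le_mul (mul_le_mul_of_nonneg_left e1 hpos1) e2 hpos3 (by positivity)
  have e5 : (1 - η / 20000) * L ^ N * ((1 - η / 1000) * L) ≤ (1 - η / 20000) * L ^ N * (L - 2 * Real.log L) :=
    mul_le_mul_of_nonneg_left e3 (by nlinarith)
  have e6 : (1 - η / 100) * (1 + η / 500) * (1 + η / 1000) ≤ (1 - η / 20000) * (1 - η / 1000) := by
    nlinarith [mul_pos hη hη, mul_pos (mul_pos hη hη) hη]
  have e7 : (1 - η / 100) * ((1 + η / 500) * L ^ N) * ((1 + η / 1000) * L) ≤ (1 - η / 20000) * L ^ N * ((1 - η / 1000) * L) := by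
    have : 0 ≤ L ^ N * L := by positivity
    nlinarith
  linarith

/-- The rows of (1.6), `ht2`. [folklore] -/
theorem facts_t2 {N η : ℝ} (hN : 1 < N) (hη : 0 < η) (hη1 : η ≤ 1) :
    ∀ᶠ L : ℝ in atTop, 100 * (L + Real.log 2 + N * Real.log (L + Real.log 2)) ≤ η * ((1 - η / 20) * ((1 - η / 20000) * L ^ N)) := by
  have hlog2 : 0 ≤ Real.log 2 := Real.log_nonneg (by norm_num)
  have hN0 : 0 < N := by linarith
  filter_upwards [Maier.eventually_const_mul_rpow_le (C := 200) hN (by positivity : 0 < η / 2),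
    eventually_mul_log_le_rpow one_pos (2 * (N + 1)), eventually_ge_atTop (2 * N + 2), eventually_ge_atTop (1 : ℝ)]
    with L h1 h2 hLN2 hL1
  have hL0 : 0 < L := by linarith
  rw [Real.rpow_one] at h1 h2
  have hlogL : 0 ≤ Real.log L := Real.log_nonneg hL1
  have hLN : 0 ≤ L ^ N := Real.rpow_nonneg hL0.le N
  have f1 : Real.log (L + Real.log 2) ≤ Real.log L + 1 := by
    have hlog2' : Real.log 2 < 7 / 10 := by have := Real.log_two_lt_d9; linarith
    calc Real.log (L + Real.log 2) ≤ Real.log (2 * L) := Real.log_le_log (by linarith) (by linarith)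
      _ = Real.log 2 + Real.log L := Real.log_mul two_ne_zero hL0.ne'
      _ ≤ Real.log L + 1 := by linarith
  have f2 : N * Real.log (L + Real.log 2) ≤ N * (Real.log L + 1) := mul_le_mul_of_nonneg_left f1 hN0.le
  have hlog2' : Real.log 2 < 7 / 10 := by have := Real.log_two_lt_d9; linarith
  have e1 : L + Real.log 2 + N * Real.log (L + Real.log 2) ≤ 2 * L := by linarith
  have e2 : η / 2 * L ^ N ≤ η * ((1 - η / 20) * ((1 - η / 20000) * L ^ N)) := by
    have hc : (1:ℝ) / 2 ≤ (1 - η / 20) * (1 - η / 20000) := by nlinarith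
    have := mul_le_mul_of_nonneg_left hc (by positivity : 0 ≤ η * L ^ N)
    calc η / 2 * L ^ N = η * L ^ N * (1 / 2) := by ring
      _ ≤ η * L ^ N * ((1 - η / 20) * (1 - η / 20000)) := this
      _ = η * ((1 - η / 20) * ((1 - η / 20000) * L ^ N)) := by ring
  linarith

/-- The columns of (1.6): `300 L (V log L) 4^{L^{b'}+1} ≤ η (e^L − 1)`. [folklore] -/
theorem facts_colA {b' V η : ℝ} (hb1 : b' < 1) (hV : 0 < V) (hη : 0 < η) :
    ∀ᶠ L : ℝ in atTop, 300 * L * (V * Real.log L) * (4 : ℝ) ^ (L ^ b' + 1) ≤ η * (Real.exp L - 1) := by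
  have := eventually_subexp_le (α := 0) (b := b') (C := 1200 * V) (β := Real.log 4) (κ := η) (by norm_num) hb1
    (by positivity) hη 2
  filter_upwards [this, eventually_ge_atTop (1 : ℝ)] with L h hL1
  have hL0 : 0 < L := by linarith
  have hlogL : Real.log L ≤ L := (Real.log_le_sub_one_of_pos hL0).trans (by linarith)
  have hlog0 : 0 ≤ Real.log L := Real.log_nonneg hL1
  have e : (4 : ℝ) ^ (L ^ b' + 1) = 4 * Real.exp (0 * L + Real.log 4 * L ^ b') := by
    rw [four_rpow_eq_exp, mul_add, mul_one, Real.exp_add, Real.exp_log (by norm_num), zero_mul, zero_add]; ring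
  rw [e]
  have hE := Real.exp_pos (0 * L + Real.log 4 * L ^ b')
  calc 300 * L * (V * Real.log L) * (4 * Real.exp (0 * L + Real.log 4 * L ^ b'))
      = 1200 * V * (L * Real.log L) * Real.exp (0 * L + Real.log 4 * L ^ b') := by ring
    _ ≤ 1200 * V * L ^ 2 * Real.exp (0 * L + Real.log 4 * L ^ b') := by
        have : L * Real.log L ≤ L ^ 2 := by nlinarith
        gcongr
    _ ≤ η * (Real.exp L - 1) := h

/-- The columns of (1.6): `600 L (V log L)(e^L/L² + 1) ≤ η (e^L − 1)`. [folklore] -/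
theorem facts_colB {V η : ℝ} (hV : 0 < V) (hη : 0 < η) :
    ∀ᶠ L : ℝ in atTop, 600 * L * (V * Real.log L) * (Real.exp L / L ^ 2 + 1) ≤ η * (Real.exp L - 1) := by
  have h1 := eventually_subexp_le (α := 0) (b := 0) (C := 600 * V) (β := 0) (κ := η / 4) (by norm_num) (by norm_num)
    (by positivity) (by positivity) 2
  filter_upwards [h1, eventually_mul_log_le_rpow one_pos (2400 * V / η),
    Real.tendsto_exp_atTop.eventually_ge_atTop (2 : ℝ), eventually_ge_atTop (1 : ℝ)] with L h h2 h3 hL1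
  have hL0 : 0 < L := by linarith
  rw [Real.rpow_one] at h2
  have hlogL : Real.log L ≤ L := (Real.log_le_sub_one_of_pos hL0).trans (by linarith)
  have hlog0 : 0 ≤ Real.log L := Real.log_nonneg hL1
  have e1 : 600 * L * (V * Real.log L) * (Real.exp L / L ^ 2) = 600 * V * (Real.log L / L) * Real.exp L := by
    field_simp
  have e2 : 600 * V * (Real.log L / L) ≤ η / 4 := by
    rw [mul_div_assoc', div_le_iff₀ hL0, div_mul_eq_mul_div, le_div_iff₀ (by norm_num : (0:ℝ) < 4)]
    rw [div_mul_eq_mul_div, div_le_iff₀ hη] at h2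
    nlinarith
  have e3 : 600 * V * (Real.log L / L) * Real.exp L ≤ η / 4 * Real.exp L :=
    mul_le_mul_of_nonneg_right e2 (Real.exp_pos L).le
  have e4 : 600 * L * (V * Real.log L) * 1 ≤ η / 4 * (Real.exp L - 1) := by
    have : Real.exp (0 * L + 0 * L ^ (0:ℝ)) = 1 := by simp
    rw [this] at h
    have hLL : L * Real.log L ≤ L ^ 2 := by nlinarith [hlogL, hL0]
    calc 600 * L * (V * Real.log L) * 1 = 600 * V * (L * Real.log L) := by ring
      _ ≤ 600 * V * L ^ 2 := mul_le_mul_of_nonneg_left hLL (by positivity)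
      _ = 600 * V * L ^ 2 * 1 := by ring
      _ ≤ η / 4 * (Real.exp L - 1) := h
  nlinarith

/-- The columns of (1.6): `600 (1 + 8 e^{5L/8}) L (V log L) 4^{L^{b'}+1} ≤ η (e^L − 1)`. [folklore] -/
theorem facts_colC {b' V η : ℝ} (hb1 : b' < 1) (hV : 0 < V) (hη : 0 < η) :
    ∀ᶠ L : ℝ in atTop, 600 * (1 + 8 * Real.exp (5 * L / 8)) * L * (V * Real.log L) * (4 : ℝ) ^ (L ^ b' + 1) ≤
      η * (Real.exp L - 1) := by
  have := eventually_subexp_le (α := 5 / 8) (b := b') (C := 21600 * V) (β := Real.log 4) (κ := η) (by norm_num) hb1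
    (by positivity) hη 2
  filter_upwards [this, eventually_ge_atTop (1 : ℝ)] with L h hL1
  have hL0 : 0 < L := by linarith
  have hlogL : Real.log L ≤ L := (Real.log_le_sub_one_of_pos hL0).trans (by linarith)
  have hlog0 : 0 ≤ Real.log L := Real.log_nonneg hL1
  have hE58 : 1 ≤ Real.exp (5 * L / 8) := Real.one_le_exp (by positivity)
  have e : (4 : ℝ) ^ (L ^ b' + 1) = 4 * Real.exp (Real.log 4 * L ^ b') := by
    rw [four_rpow_eq_exp, mul_add, mul_one, Real.exp_add, Real.exp_log (by norm_num)]; ring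
  rw [e]
  have e2 : Real.exp (5 * L / 8) * Real.exp (Real.log 4 * L ^ b') = Real.exp (5 / 8 * L + Real.log 4 * L ^ b') := by
    rw [← Real.exp_add]; ring_nf
  have hE := Real.exp_pos (Real.log 4 * L ^ b')
  calc 600 * (1 + 8 * Real.exp (5 * L / 8)) * L * (V * Real.log L) * (4 * Real.exp (Real.log 4 * L ^ b'))
      ≤ 600 * (9 * Real.exp (5 * L / 8)) * L * (V * L) * (4 * Real.exp (Real.log 4 * L ^ b')) := by
        gcongr
        · linarith
    _ = 21600 * V * L ^ 2 * (Real.exp (5 * L / 8) * Real.exp (Real.log 4 * L ^ b')) := by ring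
    _ = 21600 * V * L ^ 2 * Real.exp (5 / 8 * L + Real.log 4 * L ^ b') := by rw [e2]
    _ ≤ η * (Real.exp L - 1) := h

/-- The primes of `a` on the row side of (1.6): `800 L^γ (V log L) 4^{L^{b'}+1} ≤ η (e^L − 1)`. [folklore] -/
theorem facts_om₂ {γ b' V η : ℝ} (hb1 : b' < 1) (hV : 0 < V) (hη : 0 < η) :
    ∀ᶠ L : ℝ in atTop, 800 * L ^ γ * (V * Real.log L) * (4 : ℝ) ^ (L ^ b' + 1) ≤ η * (Real.exp L - 1) := by
  set j : ℕ := ⌈γ⌉₊ + 1 with hj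
  have := eventually_subexp_le (α := 0) (b := b') (C := 3200 * V) (β := Real.log 4) (κ := η) (by norm_num) hb1
    (by positivity) hη j
  filter_upwards [this, eventually_ge_atTop (1 : ℝ)] with L h hL1
  have hL0 : 0 < L := by linarith
  have hlogL : Real.log L ≤ L := (Real.log_le_sub_one_of_pos hL0).trans (by linarith)
  have hlog0 : 0 ≤ Real.log L := Real.log_nonneg hL1
  have e : (4 : ℝ) ^ (L ^ b' + 1) = 4 * Real.exp (0 * L + Real.log 4 * L ^ b') := by
    rw [four_rpow_eq_exp, mul_add, mul_one, Real.exp_add, Real.exp_log (by norm_num), zero_mul, zero_add]; ring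
  rw [e]
  have hE := Real.exp_pos (0 * L + Real.log 4 * L ^ b')
  have e1 : L ^ γ * Real.log L ≤ L ^ j := by
    have h1 : L ^ γ ≤ L ^ (⌈γ⌉₊ : ℝ) := Real.rpow_le_rpow_of_exponent_le hL1 (Nat.le_ceil γ)
    rw [Real.rpow_natCast] at h1
    have h2 : (L ^ j : ℝ) = L ^ ⌈γ⌉₊ * L := by rw [hj, pow_succ]
    rw [h2]
    exact mul_le_mul h1 hlogL hlog0 (by positivity)
  calc 800 * L ^ γ * (V * Real.log L) * (4 * Real.exp (0 * L + Real.log 4 * L ^ b'))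
      = 3200 * V * (L ^ γ * Real.log L) * Real.exp (0 * L + Real.log 4 * L ^ b') := by ring
    _ ≤ 3200 * V * L ^ j * Real.exp (0 * L + Real.log 4 * L ^ b') := by gcongr
    _ ≤ η * (Real.exp L - 1) := h

/-- The violators of (1.6): `400 e^{L − L/log L} (V log L) 4^{L^{b'}+1} ≤ η (e^L − 1)`. [folklore] -/
theorem facts_Bv₂ {b' V η : ℝ} (hb0 : 0 ≤ b') (hb1 : b' < 1) (hV : 0 < V) (hη : 0 < η) :
    ∀ᶠ L : ℝ in atTop, 400 * Real.exp (L - L / Real.log L) * (V * Real.log L) * (4 : ℝ) ^ (L ^ b' + 1) ≤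
      η * (Real.exp L - 1) := by
  have := eventually_loglog_saving_le (b := b') (C := 1600 * V) (c := 0) (κ := η) hb0 hb1 (by positivity) le_rfl hη
  filter_upwards [this, eventually_ge_atTop (1 : ℝ)] with L h hL1
  have hL0 : 0 < L := by linarith
  have hlog0 : 0 ≤ Real.log L := Real.log_nonneg hL1
  have e : 400 * Real.exp (L - L / Real.log L) * (V * Real.log L) * (4 : ℝ) ^ (L ^ b' + 1) =
      1600 * V * Real.log L * Real.exp (L - L / Real.log L + Real.log 4 * L ^ b') := by
    rw [four_rpow_eq_exp, mul_add, mul_one, Real.exp_add (Real.log 4 * L ^ b'), Real.exp_log (by norm_num),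
      Real.exp_add]
    ring
  rw [e]
  rw [add_zero] at h
  have hE := Real.exp_pos (L - L / Real.log L + Real.log 4 * L ^ b')
  have hlog2L : Real.log L ≤ L ^ 2 * Real.log L := le_mul_of_one_le_left hlog0 (by nlinarith)
  calc 1600 * V * Real.log L * Real.exp (L - L / Real.log L + Real.log 4 * L ^ b')
      ≤ 1600 * V * (L ^ 2 * Real.log L) * Real.exp (L - L / Real.log L + Real.log 4 * L ^ b') := by gcongr
    _ = 1600 * V * L ^ 2 * Real.log L * Real.exp (L - L / Real.log L + Real.log 4 * L ^ b') := by ring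
    _ ≤ η * (Real.exp L - 1) := h


/-! ## Small lemmas for the proof of (1.6) -/

/-- Facts about `Xmax = 3 Y e^L` when `3Y ≤ e^{L/4}`, `Y ≥ 1`. [folklore] -/
theorem Xmax_facts₂ {L Y : ℝ} (hL : 1 ≤ L) (hY : 1 ≤ Y) (h3 : 3 * Y ≤ Real.exp (L / 4)) :
    2 ≤ 3 * Y * Real.exp L ∧ Real.sqrt (3 * Y * Real.exp L) ≤ Real.exp (5 * L / 8) ∧
      Real.log (3 * Y * Real.exp L) ≤ 2 * L := by
  have he : 1 ≤ Real.exp L := Real.one_le_exp (by linarith)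
  refine ⟨by nlinarith, ?_, ?_⟩
  · have h2 : 3 * Y * Real.exp L ≤ Real.exp (5 * L / 8) ^ 2 := by
      rw [← Real.exp_nat_mul]
      have : (2:ℕ) * (5 * L / 8) = L / 4 + L := by ring
      rw [this, Real.exp_add]
      exact mul_le_mul_of_nonneg_right h3 (Real.exp_pos L).le
    calc Real.sqrt (3 * Y * Real.exp L) ≤ Real.sqrt (Real.exp (5 * L / 8) ^ 2) := Real.sqrt_le_sqrt h2
      _ = Real.exp (5 * L / 8) := Real.sqrt_sq (Real.exp_pos _).le
  · have h1 : 3 * Y * Real.exp L ≤ Real.exp (L / 4) * Real.exp L := mul_le_mul_of_nonneg_right h3 (Real.exp_pos L).le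
    rw [← Real.exp_add] at h1
    calc Real.log (3 * Y * Real.exp L) ≤ Real.log (Real.exp (L / 4 + L)) := Real.log_le_log (by positivity) h1
      _ = L / 4 + L := Real.log_exp _
      _ ≤ 2 * L := by linarith

/-- The prime number theorem for a row of (1.6): for `Q < q ≤ 2Q`,
`π(q log^N q)/q ≥ (1 − ε) L^N/(L + log 2 + N log(L + log 2))`, `L = log Q`. [folklore] -/
theorem Lam_le_of {N ε L Q x₀ : ℝ} {q : ℕ} (hN : 0 ≤ N) (hε1 : ε ≤ 1) (hL1 : 1 ≤ L) (hQ0 : 0 < Q)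
    (hLQ : Real.log Q = L) (hQq : Q < q) (hqQ : (q : ℝ) ≤ 2 * Q) (hx₀ : x₀ ≤ Q)
    (hπ : ∀ x : ℝ, x₀ ≤ x → (1 - ε) * (x / Real.log x) ≤ (Nat.primeCounting ⌊x⌋₊ : ℝ)) :
    (1 - ε) * L ^ N / (L + Real.log 2 + N * Real.log (L + Real.log 2)) ≤
      (Nat.primeCounting ⌊(q : ℝ) * Real.log q ^ N⌋₊ : ℝ) / q := by
  have hq0 : (0 : ℝ) < q := hQ0.trans hQq
  have hlogq : L ≤ Real.log q := by rw [← hLQ]; exact Real.log_le_log hQ0 hQq.le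
  have hlogq' : Real.log q ≤ L + Real.log 2 := by
    calc Real.log q ≤ Real.log (2 * Q) := Real.log_le_log hq0 hqQ
      _ = L + Real.log 2 := by rw [Real.log_mul two_ne_zero hQ0.ne', hLQ]; ring
  have hlq1 : 1 ≤ Real.log q := hL1.trans hlogq
  have hlq0 : 0 < Real.log q := by linarith
  have hpow1 : 1 ≤ Real.log q ^ N := Real.one_le_rpow hlq1 hN
  set x : ℝ := (q : ℝ) * Real.log q ^ N with hx
  have hxq : (q : ℝ) ≤ x := le_mul_of_one_le_right hq0.le hpow1
  have hx0 : 0 < x := hq0.trans_le hxq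
  have hxx₀ : x₀ ≤ x := by linarith
  have hlogx : Real.log x = Real.log q + N * Real.log (Real.log q) := by
    rw [hx, Real.log_mul hq0.ne' (by positivity), Real.log_rpow hlq0]
  set Dn : ℝ := L + Real.log 2 + N * Real.log (L + Real.log 2) with hDn
  have hloglog : Real.log (Real.log q) ≤ Real.log (L + Real.log 2) := Real.log_le_log hlq0 hlogq'
  have hloglog0 : 0 ≤ Real.log (Real.log q) := Real.log_nonneg hlq1
  have hlogxD : Real.log x ≤ Dn := by
    rw [hlogx, hDn]; nlinarith
  have hlogx0 : 0 < Real.log x := by rw [hlogx]; positivity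
  have hDn0 : 0 < Dn := hlogx0.trans_le hlogxD
  have h1 := hπ x hxx₀
  have hε' : 0 ≤ 1 - ε := by linarith
  -- `(1-ε) x / Dn ≤ (1-ε) x / log x ≤ π`
  have h2 : (1 - ε) * (x / Dn) ≤ (Nat.primeCounting ⌊x⌋₊ : ℝ) := by
    refine le_trans (mul_le_mul_of_nonneg_left ?_ hε') h1
    exact div_le_div_of_nonneg_left hx0.le hlogx0 hlogxD
  -- divide by `q`
  rw [div_le_div_iff₀ hDn0 hq0]
  have hq1 : (1 : ℝ) ≤ q := by
    have hQL : Real.exp L = Q := by rw [← hLQ, Real.exp_log hQ0]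
    have := Real.add_one_le_exp L
    linarith
  have f1 : L ^ N ≤ Real.log q ^ N := Real.rpow_le_rpow (by linarith) hlogq hN
  calc (1 - ε) * L ^ N * q ≤ (1 - ε) * Real.log q ^ N * q :=
        mul_le_mul_of_nonneg_right (mul_le_mul_of_nonneg_left f1 hε') hq0.le
    _ = (1 - ε) * (x / Dn) * Dn := by rw [hx]; field_simp
    _ ≤ (Nat.primeCounting ⌊x⌋₊ : ℝ) * Dn := mul_le_mul_of_nonneg_right h2 hDn0.le

/-- The split hypothesis of `exceptional_nobad` from Siegel's bound `d ≥ (log X_A)^A`. [folklore] -/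
theorem split_hyp₂ {L N C₀ A : ℝ} {d y : ℕ} (hL : 1 ≤ L) (hC₀ : 0 < C₀) (hy : (y : ℝ) ≤ L ^ (N + 1))
    (hF : L ^ (2 * (N + 1)) * (4 : ℝ) ^ (C₀ * Real.log L) < (L - 2 * Real.log L) ^ A)
    (hd : d = 0 ∨ Real.log (Real.exp L / L ^ 2) ^ A ≤ d) :
    d = 0 ∨ (y : ℝ) ^ 2 * 4 ^ ⌊C₀ * Real.log L⌋₊ < d := by
  rcases hd with h | h
  · exact Or.inl h
  right
  have hL0 : 0 < L := by linarith
  have hlog : Real.log (Real.exp L / L ^ 2) = L - 2 * Real.log L := by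
    rw [Real.log_div (Real.exp_pos L).ne' (by positivity), Real.log_exp, Real.log_pow]; ring
  rw [hlog] at h
  have hK₁ : 0 ≤ C₀ * Real.log L := by have := Real.log_nonneg hL; positivity
  have e1 : (y : ℝ) ^ 2 ≤ L ^ (2 * (N + 1)) := by
    have : (y : ℝ) ^ 2 ≤ (L ^ (N + 1)) ^ 2 := pow_le_pow_left₀ (Nat.cast_nonneg y) hy 2
    rwa [← Real.rpow_natCast (L ^ (N + 1)) 2, ← Real.rpow_mul hL0.le, mul_comm, Nat.cast_ofNat] at this
  have e2 : ((4 : ℝ) ^ ⌊C₀ * Real.log L⌋₊ : ℝ) ≤ (4 : ℝ) ^ (C₀ * Real.log L) := by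
    rw [← Real.rpow_natCast]
    exact Real.rpow_le_rpow_of_exponent_le (by norm_num) (Nat.floor_le hK₁)
  calc (y : ℝ) ^ 2 * 4 ^ ⌊C₀ * Real.log L⌋₊ ≤ L ^ (2 * (N + 1)) * (4 : ℝ) ^ (C₀ * Real.log L) :=
        mul_le_mul e1 e2 (by positivity) (Real.rpow_nonneg hL0.le _)
    _ < (L - 2 * Real.log L) ^ A := hF
    _ ≤ d := h

/-- The bookkeeping of `ht3`. [folklore] -/
theorem ht3_of {Bv om T1 C_F M V_T Ex Drow η : ℝ} (hMV : 0 ≤ M * V_T) (hBv : Bv ≤ η / 400 * (M * V_T))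
    (hom : om * T1 ≤ η / 400 * (M * V_T)) (hCF : C_F * Ex ≤ η / 400) (hD : Drow ≤ η / 400 * (M * V_T)) :
    Bv + om * T1 + C_F * M * V_T * Ex + Drow ≤ η / 100 * (M * V_T) := by
  have e1 : C_F * M * V_T * Ex = (C_F * Ex) * (M * V_T) := by ring
  have e2 : (C_F * Ex) * (M * V_T) ≤ η / 400 * (M * V_T) := mul_le_mul_of_nonneg_right hCF hMV
  linarith

/-- The bookkeeping of `ht5` (no bad columns: `K = 0`, `Wbad = 0`), per unit of `y`. [folklore] -/
theorem ht5_of {y A cG Xp e58 ρ β cB : ℝ} (hy : 0 ≤ y) (h2y : A ≤ 2 * y) (hcG0 : 0 ≤ cG)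
    (hcG : cG ≤ Xp + 1 + 8 * e58) (hRy : 1 ≤ ρ) (hRX : 2 * Xp ≤ ρ) (hRc : 2 * (1 + 8 * e58) ≤ ρ) :
    y + A * cG + β * 0 + y / ((0 : ℕ) : ℝ) * cB ≤ y * (3 * ρ) := by
  rw [Nat.cast_zero, div_zero, zero_mul, mul_zero, add_zero, add_zero]
  have e1 : A * cG ≤ 2 * y * cG := mul_le_mul_of_nonneg_right h2y hcG0
  have e2 : 2 * y * cG ≤ 2 * y * (Xp + 1 + 8 * e58) := mul_le_mul_of_nonneg_left hcG (by positivity)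
  have e3 : y * 1 ≤ y * ρ := mul_le_mul_of_nonneg_left hRy hy
  have e4 : y * (2 * Xp) ≤ y * ρ := mul_le_mul_of_nonneg_left hRX hy
  have e5 : y * (2 * (1 + 8 * e58)) ≤ y * ρ := mul_le_mul_of_nonneg_left hRc hy
  nlinarith

/-- The bookkeeping of `ht6` (and the bound `ErrB ≤ yVW` used in `ht5`). [folklore] -/
theorem ht6_of {C_B Ex Ex0 y yR V V₁ W Pi1 Sk em η : ℝ} (hCB : 0 ≤ C_B) (hEx0 : 0 ≤ Ex) (hEx : Ex ≤ Ex0)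
    (hkey : C_B * Ex0 * Real.exp 1 ≤ η / 20000) (hPi0 : 0 ≤ Pi1) (hPi : Pi1 ≤ Real.exp 1) (hy : 0 ≤ y) (hyR : yR ≤ y)
    (hV₁ : 0 ≤ V₁) (hV : V₁ ≤ V) (hW : 1 / 5 ≤ W) (hη : 0 ≤ η) (hη1 : η ≤ 1)
    (hT2 : Sk ≤ η / 20000 * (yR * V₁)) (hem : em ≤ η / 1000 * V₁) :
    C_B * Ex * y * V * Pi1 + Sk + y * em ≤ η / 100 * (y * V * W) ∧ C_B * Ex * y * V * Pi1 + Sk ≤ y * V * W := by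
  have hV0 : 0 ≤ V := hV₁.trans hV
  have e1 : C_B * Ex * y * V * Pi1 ≤ C_B * Ex0 * Real.exp 1 * (y * V) := by
    have : C_B * Ex * y * V * Pi1 = (C_B * (Ex * Pi1)) * (y * V) := by ring
    rw [this]
    refine mul_le_mul_of_nonneg_right ?_ (by positivity)
    rw [mul_assoc]
    exact mul_le_mul_of_nonneg_left (mul_le_mul hEx hPi hPi0 (hEx0.trans hEx)) hCB
  have e2 : C_B * Ex0 * Real.exp 1 * (y * V) ≤ η / 20000 * (y * V) := mul_le_mul_of_nonneg_right hkey (by positivity)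
  have e3 : η / 20000 * (yR * V₁) ≤ η / 20000 * (y * V) :=
    mul_le_mul_of_nonneg_left (mul_le_mul hyR hV hV₁ hy) (by positivity)
  have e4 : y * em ≤ y * (η / 1000 * V₁) := mul_le_mul_of_nonneg_left hem hy
  have e5 : y * (η / 1000 * V₁) ≤ η / 1000 * (y * V) := by
    have := mul_le_mul_of_nonneg_left hV hy
    nlinarith
  have h0 : 0 ≤ η * (y * V) := by positivity
  have hyV : 0 ≤ y * V := by positivity
  have e6 : η / 100 * (y * V * (1 / 5)) ≤ η / 100 * (y * V * W) :=
    mul_le_mul_of_nonneg_left (mul_le_mul_of_nonneg_left hW hyV) (by positivity)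
  have e7 : y * V * (1 / 5) ≤ y * V * W := mul_le_mul_of_nonneg_left hW hyV
  constructor
  · linarith
  · nlinarith

/-! ## The endgame: real arithmetic -/

/-- The final comparison for (1.5): if `G R₀ ≤ T` with `G ≥ G_low ≥ 0`, `R₀ ≥ R_low ≥ 0`,
`G_low R_low ≥ M A`, `T ≤ M B` and `B < A`, `M > 0`, we have a contradiction. [folklore] -/
theorem endgame {M A B G R₀ T Glow Rlow : ℝ} (hM : 0 < M) (h2 : G * R₀ ≤ T)
    (hG : Glow ≤ G) (hR : Rlow ≤ R₀) (hGlow : 0 ≤ Glow) (hRlow : 0 ≤ Rlow)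
    (hGR : M * A ≤ Glow * Rlow) (hT : T ≤ M * B) (hAB : B < A) : False := by
  have h1 : Glow * Rlow ≤ G * R₀ := mul_le_mul hG hR hRlow (hGlow.trans hG)
  have h2 : M * A ≤ M * B := by linarith
  have h3 : A ≤ B := le_of_mul_le_mul_left h2 hM
  linarith

/-- The final comparison for (1.6): if `T ≥ Rows ≥ M A` and `T ≤ Cols ≤ M B` with `B < A`,
`M > 0`, contradiction. [folklore] -/
theorem endgame' {M A B T Rows Cols : ℝ} (hM : 0 < M) (h1 : Rows ≤ T) (h2 : T ≤ Cols)
    (hR : M * A ≤ Rows) (hC : Cols ≤ M * B) (hAB : B < A) : False := by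
  have h3 : M * A ≤ M * B := by linarith
  have h4 : A ≤ B := le_of_mul_le_mul_left h3 hM
  linarith

/-- The numerical inequality closing the proof of (1.5): for `0 < η ≤ 1`,
`η/100 + (1 + η/20)(1 + η/100)³ < (1 + 99η/100)(1 − η/100)`. [folklore] -/
theorem consts15 {η : ℝ} (h0 : 0 < η) (h1 : η ≤ 1) :
    η / 100 + (1 + η / 20) * (1 + η / 100) ^ 3 < (1 + 99 * η / 100) * (1 - η / 100) := by
  nlinarith [mul_pos h0 h0, mul_nonneg (mul_pos h0 h0).le h0.le, mul_nonneg (mul_nonneg (mul_pos h0 h0).le h0.le) h0.le]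

/-! ## The deterministic core of the proof of (1.5) -/

set_option maxHeartbeats 1600000 in
/-- **The matrix argument for (1.5), at a given `Q` and `a`** (source §5, from (5.1) to the end of
the proof): all parameters are explicit and all analytic inputs enter as hypotheses in processed
form — the window sieve bound (`hCB`), the Fundamental Lemma for the rows (`hCF`), the prime
number theorem for the good live columns (`hψ`) and for `π(x)` (`hπ`), `e_{k+1}(S) ≥ η`, and the
five smallness conditions `hs1`–`hs5` comparing the error terms with the main term
`M = y V(T) (Q₂−Q₁)/P`. Conclusion: at least `B_v` coprime moduli `q ∈ D` satisfy (1.5) with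
`δ = η/20`. [cite: FriedlanderGranville1992, §5 (5.1)–(5.8)] -/
theorem core15_at
    {C_B : ℝ} (hCB : ∀ (T U S : Finset ℕ) (z w : ℝ) (y k : ℕ) (D : ℝ),
      (∀ p ∈ T, p.Prime) → (∀ p ∈ U, p.Prime) → (∀ p ∈ S, p.Prime) →
      (∀ p ∈ T, (p : ℝ) < z) → (∀ p ∈ U, (p : ℝ) < z) → (∀ p ∈ S, z ≤ (p : ℝ)) →
      (∀ p ∈ T, p ∉ U) → 1 ≤ w → (∀ p ∈ S, w < p) → ((y : ℝ) + 1 ≤ w ^ (k + 1)) →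
      2 ≤ z → z ≤ D → Even k →
        y * sieveDensity (T ∪ U) * sieveDensity S * (1 + eSymm S (k + 1)) -
            (C_B * Real.exp (-(Real.log D / Real.log z)) * y * sieveDensity (T ∪ U) *
                ∏ p ∈ S, (1 + (p : ℝ)⁻¹) + (k + 1) * (#S + 1) ^ k * D) ≤
          shiftedSiftedCount y T (U ∪ S))
    {C_F : ℝ} (hCF : ∀ (Ps : Finset ℕ) (z : ℝ), (∀ p ∈ Ps, p.Prime) → (∀ p ∈ Ps, (p : ℝ) < z) →
      ∀ (e : ℕ), 0 < e → (∀ p ∈ Ps, ¬ p ∣ e) → ∀ (X₁ y c : ℕ) (D : ℝ), 2 ≤ z → z ≤ D →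
        |(apSiftedCount X₁ y e c Ps : ℝ) - (y : ℝ) / e * sieveDensity Ps| ≤
          C_F * ((y : ℝ) / e) * sieveDensity Ps * Real.exp (-(Real.log D / Real.log z)) + D)
    {N η ε : ℝ} {k : ℕ} {a : ℤ} {Q₁ Q₂ y X K m₀ : ℕ} {T U S Ps : Finset ℕ}
    {z w w' D_B z_T D_row Xmax x₀ Bv : ℝ}
    -- basic
    (hN1 : 1 ≤ N) (hη0 : 0 < η) (hη1 : η ≤ 1) (hε0 : 0 ≤ ε) (hεη : ε ≤ η / 100)
    (hQ : Q₁ ≤ Q₂) (ha : a.natAbs ≤ Q₁) (ha0 : a ≠ 0)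
    -- the sets of primes
    (hT : ∀ p ∈ T, p.Prime ∧ p ∣ a.natAbs) (hU : ∀ p ∈ U, p.Prime) (hS : ∀ p ∈ S, p.Prime)
    (hUa : ∀ p ∈ U, ¬ p ∣ a.natAbs) (hSa : ∀ p ∈ S, ¬ p ∣ a.natAbs)
    (hTz : ∀ p ∈ T, (p : ℝ) < z) (hUz : ∀ p ∈ U, (p : ℝ) < z) (hSz : ∀ p ∈ S, z ≤ (p : ℝ))
    (hw : 1 ≤ w) (hSw : ∀ p ∈ S, w < p) (hyw : (y : ℝ) + 1 ≤ w ^ (k + 1))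
    (hz : 2 ≤ z) (hzD : z ≤ D_B) (hk : Even k) (heS : η ≤ eSymm S (k + 1))
    (hw' : 0 < w') (hout : ∀ p : ℕ, p.Prime → p ∣ a.natAbs → p ∉ T → w' < p)
    (hzT : 2 ≤ z_T) (hTzT : ∀ p ∈ T, (p : ℝ) < z_T) (hzTD : z_T ≤ D_row)
    -- the weights
    (hm₀ : 1 ≤ m₀) (hPs : ∀ p ∈ Ps, p.Prime) (hPsm : ∀ p ∈ Ps, m₀ < p)
    (hPsP : ∀ p ∈ Ps, ¬ p ∣ ∏ p ∈ U ∪ S, p)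
    (hfac : ∀ q ∈ (moduliSet Q₁ Q₂ (∏ p ∈ U ∪ S, p) a).filter (fun q : ℕ ↦ Int.gcd (q : ℤ) a = 1),
      q.primeFactors ⊆ Ps)
    -- the columns
    (hX2 : 2 ≤ X) (hXQ : (X : ℝ) ≤ (a : ℝ) + Q₂) (hXmax : (a : ℝ) + y * Q₂ ≤ Xmax) (hXmax2 : 2 ≤ Xmax)
    (hψ : ∀ r ∈ (liveSet a y (∏ p ∈ U ∪ S, p)).filter (fun r ↦ ¬ K ∣ r), ∀ x : ℝ, (X : ℝ) ≤ x →
      |ParityWave0.chebyshevPsiMod (r * ∏ p ∈ U ∪ S, p)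
          ((colResidue a r (∏ p ∈ U ∪ S, p) : ℕ) : ZMod (r * ∏ p ∈ U ∪ S, p)) x -
          x / ((r * ∏ p ∈ U ∪ S, p).totient : ℝ)| ≤ ε * (x / ((r * ∏ p ∈ U ∪ S, p).totient : ℝ)))
    -- the rows
    (hyq : ∀ q ∈ moduliSet Q₁ Q₂ (∏ p ∈ U ∪ S, p) a, (a : ℝ) + y * q ≤ q * Real.log q ^ N)
    (hπ : ∀ x : ℝ, x₀ ≤ x → (Nat.primeCounting ⌊x⌋₊ : ℝ) ≤ (1 + ε) * (x / Real.log x))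
    (hlogq : ∀ q ∈ moduliSet Q₁ Q₂ (∏ p ∈ U ∪ S, p) a, 1 ≤ Real.log q)
    (hx₀ : ∀ q ∈ moduliSet Q₁ Q₂ (∏ p ∈ U ∪ S, p) a, x₀ ≤ (q : ℝ) * Real.log q ^ N)
    -- smallness, against the main term `M = y V(T) (Q₂ - Q₁)/P`
    (hs1 : C_B * Real.exp (-(Real.log D_B / Real.log z)) * y * sieveDensity (T ∪ U) *
          ∏ p ∈ S, (1 + (p : ℝ)⁻¹) + (k + 1) * (#S + 1) ^ k * D_B +
        (a.natAbs.primeFactors.card : ℝ) * (y / w') + y / K ≤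
      η / 100 * (y * sieveDensity (T ∪ U) * sieveDensity S))
    (hs2 : ε * (3 * Q₁ + Q₂) + (1 + ε) * X +
        2 * Real.sqrt Xmax * Real.log Xmax * ((∏ p ∈ U ∪ S, p).totient : ℝ) ≤
      η / 100 * ((Q₂ : ℝ) - Q₁))
    (hs3 : Real.log Xmax * Real.log Q₂ ^ (N - 1) ≤ (1 + η / 100) * y)
    (hs4 : C_F * (((Q₂ : ℝ) - Q₁) / (∏ p ∈ U ∪ S, p : ℕ)) * sieveDensity T *
          Real.exp (-(Real.log D_row / Real.log z_T)) + D_row +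
        ((Q₂ : ℝ) - Q₁) / (∏ p ∈ U ∪ S, p : ℕ) * (Real.exp ((m₀ : ℝ)⁻¹) - 1) +
        ((sieveDensity Ps)⁻¹ - 1) ≤
      η / 100 * (((Q₂ : ℝ) - Q₁) / (∏ p ∈ U ∪ S, p : ℕ) * sieveDensity T))
    (hs5 : Real.log Xmax * (((Q₂ : ℝ) - Q₁) / (∏ p ∈ U ∪ S, p : ℕ) + 1 + y * Bv) ≤
      η / 100 * (y * sieveDensity T * (((Q₂ : ℝ) - Q₁) / (∏ p ∈ U ∪ S, p : ℕ)))) :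
    Bv ≤ #(((moduliSet Q₁ Q₂ (∏ p ∈ U ∪ S, p) a).filter fun q : ℕ ↦ Int.gcd (q : ℤ) a = 1).filter
      fun q : ℕ ↦ (1 + η / 20) * ((Nat.primeCounting ⌊(q : ℝ) * Real.log q ^ N⌋₊ : ℝ) / (Nat.totient q : ℝ)) <
        (primeCountingModInt q a ((q : ℝ) * Real.log q ^ N) : ℝ)) := by
  classical
  -- ### trivial case `Bv < 0`
  by_cases hBv : Bv < 0
  · exact le_trans hBv.le (Nat.cast_nonneg _)
  push Not at hBv
  by_contra hcon
  push Not at hcon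
  -- ### notation
  set P : ℕ := ∏ p ∈ U ∪ S, p with hPdef
  set D := moduliSet Q₁ Q₂ P a with hDdef
  set Dcop := D.filter (fun q : ℕ ↦ Int.gcd (q : ℤ) a = 1) with hDcopdef
  set VT := sieveDensity T with hVTdef
  set VU := sieveDensity U with hVUdef
  set V := sieveDensity (T ∪ U) with hVdef
  set W := sieveDensity S with hWdef
  set ΔQ : ℝ := (Q₂ : ℝ) - Q₁ with hΔQdef
  -- ### basic facts
  have hUS : ∀ p ∈ U ∪ S, p.Prime := fun p hp ↦ (mem_union.1 hp).elim (hU p) (hS p)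
  have hTU : ∀ p ∈ T ∪ U, p.Prime := fun p hp ↦ (mem_union.1 hp).elim (fun h ↦ (hT p h).1) (hU p)
  have hTp : ∀ p ∈ T, p.Prime := fun p hp ↦ (hT p hp).1
  have hP0 : 0 < P := prod_pos fun p hp ↦ (hUS p hp).pos
  have hP1 : 1 ≤ P := hP0
  have hP0R : (0 : ℝ) < P := by exact_mod_cast hP0
  have hφP0 : (0 : ℝ) < P.totient := by exact_mod_cast Nat.totient_pos.2 hP1
  have hΔQ0 : 0 ≤ ΔQ := by
    have : (Q₁ : ℝ) ≤ Q₂ := by exact_mod_cast hQ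
    rw [hΔQdef]; linarith
  have hΔQcast : (((Q₂ - Q₁ : ℕ)) : ℝ) = ΔQ := by rw [hΔQdef]; push_cast [Nat.cast_sub hQ]; ring
  have hy0 : (0 : ℝ) ≤ y := Nat.cast_nonneg y
  have hlogXmax : 0 < Real.log Xmax := Real.log_pos (by linarith)
  have hTnotU : ∀ p ∈ T, p ∉ U := fun p hpT hpU ↦ hUa p hpU (hT p hpT).2
  have hTP : ∀ p ∈ T, ¬ p ∣ P := by
    intro p hp hpP
    rw [hPdef, (Nat.prime_iff.1 (hTp p hp)).dvd_finsetProd_iff] at hpP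
    obtain ⟨q, hq, hpq⟩ := hpP
    have : p = q := (Nat.prime_dvd_prime_iff_eq (hTp p hp) (hUS q hq)).1 hpq
    subst this
    rcases mem_union.1 hq with h | h
    · exact hUa p h (hT p hp).2
    · exact hSa p h (hT p hp).2
  -- positivity of the densities
  have hdens_pos : ∀ R : Finset ℕ, (∀ p ∈ R, p.Prime) → 0 < sieveDensity R := by
    intro R hR
    unfold sieveDensity
    exact prod_pos fun p hp ↦ by
      have : (2 : ℝ) ≤ p := by exact_mod_cast (hR p hp).two_le
      have : (p : ℝ)⁻¹ ≤ 1 / 2 := by rw [inv_le_comm₀ (by linarith) (by norm_num)]; linarith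
      linarith
  have hVT0 : 0 < VT := hdens_pos T hTp
  have hVU0 : 0 < VU := hdens_pos U hU
  have hW0 : 0 < W := hdens_pos S hS
  have hV0 : 0 < V := hdens_pos (T ∪ U) hTU
  -- multiplicativity of the densities
  have hdisjTU : Disjoint T U := disjoint_left.2 fun p hpT hpU ↦ hTnotU p hpT hpU
  have hdisjUS : Disjoint U S := disjoint_left.2 fun p hpU hpS ↦ by
    have h1 := hUz p hpU; have h2 := hSz p hpS; linarith
  have hVTU : V = VT * VU := by
    rw [hVdef, hVTdef, hVUdef, sieveDensity, sieveDensity, sieveDensity, prod_union hdisjTU]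
  have hφP : (P.totient : ℝ) = P * (VU * W) := by
    have h1 := sieveDensity_eq_totient_div (U ∪ S) hUS
    have h2 : sieveDensity (U ∪ S) = VU * W := by
      rw [hVUdef, hWdef, sieveDensity, sieveDensity, sieveDensity, prod_union hdisjUS]
    rw [h2, ← hPdef, eq_div_iff hP0R.ne'] at h1
    linarith
  -- ### step 1: double counting
  have h1 := sum_rowCount_eq a y D
  -- ### step 2: the columns from below
  have hΔε : 0 ≤ ΔQ - ε * (3 * Q₁ + Q₂) := by
    have hX0 : (0 : ℝ) ≤ (1 + ε) * X := by positivity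
    have hsq : 0 ≤ 2 * Real.sqrt Xmax * Real.log Xmax * (P.totient : ℝ) := by positivity
    have : η / 100 * ΔQ ≤ ΔQ := by nlinarith
    rw [hΔQdef] at this ⊢
    linarith [hs2]
  have h2 := card_mul_le_sum_columns hP1 hQ ha hX2 hXQ hXmax hXmax2 hε0 hΔε hψ
  -- ### step 3: the rows from above
  have hδ0 : (0 : ℝ) ≤ η / 20 := by positivity
  have hδ0' : (0 : ℝ) ≤ 1 + η / 20 := by positivity
  have h3 := sum_rows_le (Q₁ := Q₁) (Q₂ := Q₂) (P := P) (y := y) (N := N) ha hδ0 hyq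
  have h4 := sum_primeCounting_div_le (Q₁ := Q₁) (Q₂ := Q₂) (P := P) (a := a) hN1 hε0 hπ hlogq hx₀
  have h5 := sum_div_totient_moduliSet_le (a := a) hP1 hQ hm₀ hPs hPsm hPsP hfac
  -- ### step 4: the coprime moduli
  have h6a := card_moduliSet_coprime_le_free (Q₁ := Q₁) (Q₂ := Q₂) (P := P) hT
  have h6b := card_moduliSet_free_eq hP1 hQ a T
  have h6c := hCF T z_T hTp hTzT P hP0 hTP Q₁ (Q₂ - Q₁) (modResidue a P) D_row hzT hzTD
  rw [← h6b, hΔQcast, ← hVTdef] at h6c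
  have hDcop : (#Dcop : ℝ) + ΔQ / P * (Real.exp ((m₀ : ℝ)⁻¹) - 1) + ((sieveDensity Ps)⁻¹ - 1) ≤
      ΔQ / P * VT * (1 + η / 100) := by
    have e1 : (#Dcop : ℝ) ≤ #((moduliSet Q₁ Q₂ P a).filter fun q ↦ ∀ p ∈ T, ¬ p ∣ q) := by
      exact_mod_cast h6a
    rw [abs_le] at h6c
    have e2 := h6c.2
    linarith [hs4]
  -- ### step 5: `#D ≤ ΔQ/P + 1`
  have h7 : (#D : ℝ) ≤ ΔQ / P + 1 := by
    have e1 : D ⊆ (Ioc Q₁ Q₂).filter fun q : ℕ ↦ q ≡ modResidue a P [MOD P] := by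
      intro q hq
      rw [hDdef, mem_moduliSet] at hq
      exact mem_filter.2 ⟨mem_Ioc.2 hq.1, (int_modEq_iff_modEq_modResidue hP0 q).1 hq.2⟩
    have e2 := card_Ioc_modEq_le hP0 (modResidue a P) hQ
    calc (#D : ℝ) ≤ #((Ioc Q₁ Q₂).filter fun q : ℕ ↦ q ≡ modResidue a P [MOD P]) := by
          exact_mod_cast card_le_card e1
      _ ≤ ΔQ / P + 1 := by rw [hΔQdef]; exact e2
  -- ### step 6: the good live columns from below
  have h8 := card_good_live_ge hCB hTp hU hS hTz hUz hSz hTnotU hw hSw hyw hz hzD hk hw' hout ha0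
    (K := K)
  -- ### step 7: `M > 0`
  set M : ℝ := y * VT * (ΔQ / P) with hMdef
  have hM : 0 < M := by
    have e1 : Real.log Xmax * 1 ≤ Real.log Xmax * (ΔQ / P + 1 + y * Bv) := by
      refine mul_le_mul_of_nonneg_left ?_ hlogXmax.le
      have : 0 ≤ ΔQ / P := by positivity
      have : 0 ≤ (y : ℝ) * Bv := by positivity
      linarith
    have e2 : 0 < η / 100 * (y * VT * (ΔQ / P)) := by linarith [hs5]
    have : 0 < y * VT * (ΔQ / P) := by
      by_contra hneg; push Not at hneg
      have : η / 100 * (y * VT * (ΔQ / P)) ≤ 0 := mul_nonpos_of_nonneg_of_nonpos (by positivity) hneg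
      linarith
    exact this
  -- ### step 8: the endgame
  set G : ℝ := (#((liveSet a y P).filter fun r ↦ ¬ K ∣ r) : ℝ) with hGdef
  set R₀ : ℝ := ((ΔQ - ε * (3 * Q₁ + Q₂) - (1 + ε) * X) / (P.totient : ℝ) -
    2 * Real.sqrt Xmax * Real.log Xmax) with hR₀def
  set Tt : ℝ := Real.log Xmax * ∑ r ∈ Icc 1 y, (#{q ∈ D | (entry a r q).Prime} : ℝ) with hTtdef
  set Glow : ℝ := y * V * W * (1 + 99 * η / 100) with hGlowdef
  set Rlow : ℝ := ΔQ * (1 - η / 100) / (P.totient : ℝ) with hRlowdef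
  have hstep2 : G * R₀ ≤ Tt := by rw [hGdef, hR₀def, hTtdef, hΔQdef]; exact h2
  have hGlow_le : Glow ≤ G := by
    have e1 : (y : ℝ) * V * W * (1 + η) ≤ y * V * W * (1 + eSymm S (k + 1)) :=
      mul_le_mul_of_nonneg_left (by linarith) (by positivity)
    rw [hGlowdef, hGdef]
    rw [hVdef, hWdef] at e1 ⊢
    linarith [h8, hs1]
  have hRlow_le : Rlow ≤ R₀ := by
    have key : (R₀ - Rlow) * (P.totient : ℝ) =
        (η / 100 * ΔQ - ε * (3 * Q₁ + Q₂) - (1 + ε) * X) -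
          2 * Real.sqrt Xmax * Real.log Xmax * (P.totient : ℝ) := by
      rw [hR₀def, hRlowdef]; field_simp; ring
    have e1 : 0 ≤ (R₀ - Rlow) * (P.totient : ℝ) := by rw [key]; rw [hΔQdef]; linarith [hs2]
    have e2 := (mul_nonneg_iff_of_pos_right hφP0).1 e1
    linarith
  have hGlow0 : 0 ≤ Glow := by rw [hGlowdef]; positivity
  have hRlow0 : 0 ≤ Rlow := by
    rw [hRlowdef]; exact div_nonneg (mul_nonneg hΔQ0 (by linarith)) hφP0.le
  have hGR : M * ((1 + 99 * η / 100) * (1 - η / 100)) ≤ Glow * Rlow := by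
    have e : Glow * Rlow = M * ((1 + 99 * η / 100) * (1 - η / 100)) := by
      rw [hGlowdef, hRlowdef, hMdef, hφP, hVTU]
      field_simp
    rw [e]
  have hTt : Tt ≤ M * (η / 100 + (1 + η / 20) * (1 + η / 100) ^ 3) := by
    -- the rows
    have e1 : Tt = Real.log Xmax * ∑ q ∈ D, (rowCount a y q : ℝ) := by rw [hTtdef, h1]
    set Sπ : ℝ := ∑ q ∈ Dcop, (Nat.primeCounting ⌊(q : ℝ) * Real.log q ^ N⌋₊ : ℝ) / (Nat.totient q : ℝ)
      with hSπ
    set Sφ : ℝ := ∑ q ∈ Dcop, (q : ℝ) / (Nat.totient q : ℝ) with hSφ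
    have e3 : ∑ q ∈ D, (rowCount a y q : ℝ) ≤ #D + y * Bv + (1 + η / 20) * Sπ := by
      have := h3
      rw [← hDcopdef] at this
      have e4 : (y : ℝ) * #(Dcop.filter fun q : ℕ ↦
          (1 + η / 20) * ((Nat.primeCounting ⌊(q : ℝ) * Real.log q ^ N⌋₊ : ℝ) / (Nat.totient q : ℝ)) <
            (primeCountingModInt q a ((q : ℝ) * Real.log q ^ N) : ℝ)) ≤ y * Bv :=
        mul_le_mul_of_nonneg_left hcon.le hy0
      rw [hSπ]
      linarith
    have e5 : Sπ ≤ (1 + ε) * Real.log Q₂ ^ (N - 1) * Sφ := by rw [hSπ, hSφ, hDcopdef]; exact h4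
    have e6 : Sφ ≤ ΔQ / P * VT * (1 + η / 100) := by
      rw [hSφ, hDcopdef]
      have := h5
      rw [← hΔQdef, ← hDcopdef] at this
      linarith [hDcop]
    have hLQ0 : 0 ≤ Real.log Q₂ ^ (N - 1) := by
      apply Real.rpow_nonneg
      rcases Nat.eq_zero_or_pos Q₂ with h | h
      · rw [h]; simp
      · exact Real.log_nonneg (by exact_mod_cast h)
    have e7 : Sπ ≤ (1 + ε) * Real.log Q₂ ^ (N - 1) * (ΔQ / P * VT * (1 + η / 100)) :=
      e5.trans (mul_le_mul_of_nonneg_left e6 (by positivity))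
    have e8 : Tt ≤ Real.log Xmax * (ΔQ / P + 1 + y * Bv) +
        (1 + η / 20) * (1 + ε) * (Real.log Xmax * Real.log Q₂ ^ (N - 1)) * (ΔQ / P * VT * (1 + η / 100)) := by
      rw [e1]
      have e7' : (1 + η / 20) * Sπ ≤ (1 + η / 20) * ((1 + ε) * Real.log Q₂ ^ (N - 1) * (ΔQ / P * VT * (1 + η / 100))) :=
        mul_le_mul_of_nonneg_left e7 hδ0'
      have e3' : ∑ q ∈ D, (rowCount a y q : ℝ) ≤
          (ΔQ / P + 1 + y * Bv) + (1 + η / 20) * ((1 + ε) * Real.log Q₂ ^ (N - 1) * (ΔQ / P * VT * (1 + η / 100))) := by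
        linarith
      have := mul_le_mul_of_nonneg_left e3' hlogXmax.le
      linarith
    have e9 : (1 + η / 20) * (1 + ε) * (Real.log Xmax * Real.log Q₂ ^ (N - 1)) * (ΔQ / P * VT * (1 + η / 100)) ≤
        (1 + η / 20) * (1 + ε) * ((1 + η / 100) * y) * (ΔQ / P * VT * (1 + η / 100)) := by
      refine mul_le_mul_of_nonneg_right (mul_le_mul_of_nonneg_left hs3 (by positivity)) (by positivity)
    have e10 : (1 + η / 20) * (1 + ε) * ((1 + η / 100) * y) * (ΔQ / P * VT * (1 + η / 100)) ≤
        (1 + η / 20) * (1 + η / 100) * ((1 + η / 100) * y) * (ΔQ / P * VT * (1 + η / 100)) := by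
      have : (1 + ε) ≤ 1 + η / 100 := by linarith
      refine mul_le_mul_of_nonneg_right (mul_le_mul_of_nonneg_right
        (mul_le_mul_of_nonneg_left this (by positivity)) (by positivity)) (by positivity)
    have e11 : (1 + η / 20) * (1 + η / 100) * ((1 + η / 100) * y) * (ΔQ / P * VT * (1 + η / 100)) =
        M * ((1 + η / 20) * (1 + η / 100) ^ 3) := by rw [hMdef]; ring
    have e12 : Real.log Xmax * (ΔQ / P + 1 + y * Bv) ≤ η / 100 * M := by rw [hMdef]; linarith [hs5]
    linarith [e8, e9, e10, e11, e12]
  exact endgame hM hstep2 hGlow_le hRlow_le hGlow0 hRlow0 hGR hTt (consts15 hη0 hη1)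


/-- The numerical inequality closing the proof of (1.6): for `0 < η ≤ 1`,
`(1 + η/100)(1 − η) + (1 + η/100) η/100 + η/100 < (1 − η/20)(1 − η/100)³`. [folklore] -/
theorem consts16 {η : ℝ} (h0 : 0 < η) (h1 : η ≤ 1) :
    (1 + η / 100) * (1 - η) + (1 + η / 100) * (η / 100) + η / 100 <
      (1 - η / 20) * (1 - η / 100) ^ 3 := by
  nlinarith [mul_pos h0 h0, mul_nonneg (mul_pos h0 h0).le h0.le, mul_nonneg (mul_nonneg (mul_pos h0 h0).le h0.le) h0.le]

/-! ## The deterministic core of the proof of (1.6) -/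

set_option maxHeartbeats 6000000 in
/-- **The matrix argument for (1.6), at a given `Q` and `a`** (source §5: "the modifications
required to prove (1.6) are minor" — odd `k`, the rows from below, the columns from above with
Brun–Titchmarsh for the bad ones): all analytic inputs enter as processed hypotheses (`hCB`: the
window sieve bound for odd `k`; `hCF`: the Fundamental Lemma for the rows; `hψ`, `hBT`: the prime
number theorem and the Brun–Titchmarsh bound for the live columns; `hLam`: the prime number theorem
for `π(q log^N q)`; `ht1`–`ht6`: smallness). Conclusion: at least `B_v` coprime moduli `q ∈ D`
satisfy (1.6) with `δ = η/20`. [cite: FriedlanderGranville1992, §1 (1.6) and §5] -/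
theorem core16_at
    {C_B : ℝ} (hCB : ∀ (T U S : Finset ℕ) (z w : ℝ) (y k : ℕ) (D : ℝ),
      (∀ p ∈ T, p.Prime) → (∀ p ∈ U, p.Prime) → (∀ p ∈ S, p.Prime) →
      (∀ p ∈ T, (p : ℝ) < z) → (∀ p ∈ U, (p : ℝ) < z) → (∀ p ∈ S, z ≤ (p : ℝ)) →
      (∀ p ∈ T, p ∉ U) → 1 ≤ w → (∀ p ∈ S, w < p) → ((y : ℝ) + 1 ≤ w ^ (k + 1)) →
      2 ≤ z → z ≤ D → Odd k →
        (shiftedSiftedCount y T (U ∪ S) : ℝ) ≤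
          y * sieveDensity (T ∪ U) * sieveDensity S * (1 - eSymm S (k + 1)) +
            (C_B * Real.exp (-(Real.log D / Real.log z)) * y * sieveDensity (T ∪ U) *
                ∏ p ∈ S, (1 + (p : ℝ)⁻¹) + (k + 1) * (#S + 1) ^ k * D))
    {C_F : ℝ} (hCF : ∀ (Ps : Finset ℕ) (z : ℝ), (∀ p ∈ Ps, p.Prime) → (∀ p ∈ Ps, (p : ℝ) < z) →
      ∀ (e : ℕ), 0 < e → (∀ p ∈ Ps, ¬ p ∣ e) → ∀ (X₁ y c : ℕ) (D : ℝ), 2 ≤ z → z ≤ D →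
        |(apSiftedCount X₁ y e c Ps : ℝ) - (y : ℝ) / e * sieveDensity Ps| ≤
          C_F * ((y : ℝ) / e) * sieveDensity Ps * Real.exp (-(Real.log D / Real.log z)) + D)
    {N η ε Lam KBT z_BT Wbad : ℝ} {k : ℕ} {a : ℤ} {Q₁ Q₂ y X K m₀ : ℕ} {T U S Ps' : Finset ℕ}
    {z w w' D_B z_T D_row Xmax Bv : ℝ}
    -- basic
    (hη0 : 0 < η) (hη1 : η ≤ 1) (hε0 : 0 ≤ ε) (hε1 : ε ≤ 1) (hCF0 : 0 ≤ C_F)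
    (hQ : Q₁ ≤ Q₂) (ha : a.natAbs ≤ Q₁) (ha0 : a ≠ 0) (hy1 : 1 ≤ y)
    -- the sets of primes
    (hT : ∀ p ∈ T, p.Prime ∧ p ∣ a.natAbs) (hU : ∀ p ∈ U, p.Prime) (hS : ∀ p ∈ S, p.Prime)
    (hUa : ∀ p ∈ U, ¬ p ∣ a.natAbs) (hSa : ∀ p ∈ S, ¬ p ∣ a.natAbs)
    (hTz : ∀ p ∈ T, (p : ℝ) < z) (hUz : ∀ p ∈ U, (p : ℝ) < z) (hSz : ∀ p ∈ S, z ≤ (p : ℝ))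
    (hw : 1 ≤ w) (hSw : ∀ p ∈ S, w < p) (hyw : (y : ℝ) + 1 ≤ w ^ (k + 1))
    (hz : 2 ≤ z) (hzD : z ≤ D_B) (hk : Odd k) (heS : η ≤ eSymm S (k + 1))
    (hw' : 0 < w') (hout : ∀ p : ℕ, p.Prime → p ∣ a.natAbs → p ∉ T → w' < p)
    (hzT : 2 ≤ z_T) (hTzT : ∀ p ∈ T, (p : ℝ) < z_T) (hzTD : z_T ≤ D_row)
    -- the weights of the columns
    (hm₀ : 1 ≤ m₀) (hPs : ∀ p ∈ Ps', p.Prime) (hPsm : ∀ p ∈ Ps', m₀ < p)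
    (hPsP : ∀ p ∈ Ps', ¬ p ∣ ∏ p ∈ U ∪ S, p)
    (hfac : ∀ r ∈ liveSet a y (∏ p ∈ U ∪ S, p), ∀ p ∈ r.primeFactors, ¬ p ∣ (∏ p ∈ U ∪ S, p) → p ∈ Ps')
    (hWbad : ∑ r ∈ (liveSet a y (∏ p ∈ U ∪ S, p)).filter (fun r ↦ K ∣ r), primeWeight Ps' r ≤ Wbad)
    -- the columns
    (hX2 : 2 ≤ X) (hXQ : (X : ℝ) ≤ (a : ℝ) + Q₂) (hXmax : (a : ℝ) + y * Q₂ ≤ Xmax) (hXmax2 : 2 ≤ Xmax)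
    (hKBT : 0 ≤ KBT) (hzBT : 1 < z_BT)
    (hψ : ∀ r ∈ (liveSet a y (∏ p ∈ U ∪ S, p)).filter (fun r ↦ ¬ K ∣ r), ∀ x : ℝ, (X : ℝ) ≤ x →
      |ParityWave0.chebyshevPsiMod (r * ∏ p ∈ U ∪ S, p)
          ((colResidue a r (∏ p ∈ U ∪ S, p) : ℕ) : ZMod (r * ∏ p ∈ U ∪ S, p)) x -
          x / ((r * ∏ p ∈ U ∪ S, p).totient : ℝ)| ≤ ε * (x / ((r * ∏ p ∈ U ∪ S, p).totient : ℝ)))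
    (hBT : ∀ r ∈ (liveSet a y (∏ p ∈ U ∪ S, p)).filter (fun r ↦ K ∣ r),
      (colCount (r * ∏ p ∈ U ∪ S, p) (colResidue a r (∏ p ∈ U ∪ S, p)) (colEnd a r Q₁) (colEnd a r Q₂) : ℝ) ≤
        KBT * (((colEnd a r Q₂ : ℕ) : ℝ) / (((r * ∏ p ∈ U ∪ S, p).totient : ℝ) * Real.log z_BT) +
          z_BT ^ (10 : ℕ)) + z_BT + 1)
    -- the rows
    (hyq : ∀ q ∈ moduliSet Q₁ Q₂ (∏ p ∈ U ∪ S, p) a, (q : ℝ) * Real.log q ^ N ≤ (a : ℝ) + y * q)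
    (hLam : ∀ q ∈ moduliSet Q₁ Q₂ (∏ p ∈ U ∪ S, p) a,
      Lam ≤ (Nat.primeCounting ⌊(q : ℝ) * Real.log q ^ N⌋₊ : ℝ) / q)
    -- smallness, against `M = y V(T) (Q₂ - Q₁)/(P log X)`
    (ht1 : (1 - η / 100) * y ≤ Lam * Real.log X)
    (ht2 : 100 ≤ η * ((1 - η / 20) * Lam))
    (ht3 : Bv + (a.natAbs.primeFactors.card : ℝ) * (((Q₂ : ℝ) - Q₁) / ((∏ p ∈ U ∪ S, p : ℕ) * w') + 1) +
        C_F * (((Q₂ : ℝ) - Q₁) / (∏ p ∈ U ∪ S, p : ℕ)) * sieveDensity T *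
          Real.exp (-(Real.log D_row / Real.log z_T)) + D_row ≤
      η / 100 * (((Q₂ : ℝ) - Q₁) / (∏ p ∈ U ∪ S, p : ℕ) * sieveDensity T))
    (ht4 : ε * (3 * Q₁ + Q₂) ≤ η / 100 * ((Q₂ : ℝ) - Q₁))
    (ht5 : (y : ℝ) + (y * sieveDensity (T ∪ U) * sieveDensity S +
          (C_B * Real.exp (-(Real.log D_B / Real.log z)) * y * sieveDensity (T ∪ U) *
            ∏ p ∈ S, (1 + (p : ℝ)⁻¹) + (k + 1) * (#S + 1) ^ k * D_B)) *
          ((X : ℝ) / (∏ p ∈ U ∪ S, p : ℕ) + 1 + 2 * Real.sqrt Xmax * Real.log Xmax / Real.log X) +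
        KBT * ((Q₁ : ℝ) + Q₂) / (((∏ p ∈ U ∪ S, p).totient : ℝ) * Real.log z_BT) * Wbad +
        y / K * (KBT * z_BT ^ (10 : ℕ) + z_BT + 1) ≤
      η / 100 * (y * sieveDensity T * (((Q₂ : ℝ) - Q₁) / (∏ p ∈ U ∪ S, p : ℕ)) / Real.log X))
    (ht6 : C_B * Real.exp (-(Real.log D_B / Real.log z)) * y * sieveDensity (T ∪ U) *
          ∏ p ∈ S, (1 + (p : ℝ)⁻¹) + (k + 1) * (#S + 1) ^ k * D_B +
        y * (Real.exp ((m₀ : ℝ)⁻¹) - 1) ≤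
      η / 100 * (y * sieveDensity (T ∪ U) * sieveDensity S)) :
    Bv ≤ #(((moduliSet Q₁ Q₂ (∏ p ∈ U ∪ S, p) a).filter fun q : ℕ ↦ Int.gcd (q : ℤ) a = 1).filter
      fun q : ℕ ↦ (primeCountingModInt q a ((q : ℝ) * Real.log q ^ N) : ℝ) <
        (1 - η / 20) * ((Nat.primeCounting ⌊(q : ℝ) * Real.log q ^ N⌋₊ : ℝ) / (Nat.totient q : ℝ))) := by
  classical
  by_cases hBv : Bv < 0
  · exact le_trans hBv.le (Nat.cast_nonneg _)
  push Not at hBv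
  by_contra hcon
  push Not at hcon
  -- ### notation
  set P : ℕ := ∏ p ∈ U ∪ S, p with hPdef
  set D := moduliSet Q₁ Q₂ P a with hDdef
  set Dcop := D.filter (fun q : ℕ ↦ Int.gcd (q : ℤ) a = 1) with hDcopdef
  set Lv := liveSet a y P with hLvdef
  set VT := sieveDensity T with hVTdef
  set VU := sieveDensity U with hVUdef
  set V := sieveDensity (T ∪ U) with hVdef
  set W := sieveDensity S with hWdef
  set ΔQ : ℝ := (Q₂ : ℝ) - Q₁ with hΔQdef
  set ErrB : ℝ := C_B * Real.exp (-(Real.log D_B / Real.log z)) * y * V * ∏ p ∈ S, (1 + (p : ℝ)⁻¹) +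
    (k + 1) * (#S + 1) ^ k * D_B with hErrBdef
  -- ### basic facts
  have hUS : ∀ p ∈ U ∪ S, p.Prime := fun p hp ↦ (mem_union.1 hp).elim (hU p) (hS p)
  have hTU : ∀ p ∈ T ∪ U, p.Prime := fun p hp ↦ (mem_union.1 hp).elim (fun h ↦ (hT p h).1) (hU p)
  have hTp : ∀ p ∈ T, p.Prime := fun p hp ↦ (hT p hp).1
  have hP0 : 0 < P := prod_pos fun p hp ↦ (hUS p hp).pos
  have hP1 : 1 ≤ P := hP0
  have hP0R : (0 : ℝ) < P := by exact_mod_cast hP0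
  have hφP0 : (0 : ℝ) < P.totient := by exact_mod_cast Nat.totient_pos.2 hP1
  have hΔQ0 : 0 ≤ ΔQ := by
    have : (Q₁ : ℝ) ≤ Q₂ := by exact_mod_cast hQ
    rw [hΔQdef]; linarith
  have hΔQcast : (((Q₂ - Q₁ : ℕ)) : ℝ) = ΔQ := by rw [hΔQdef]; push_cast [Nat.cast_sub hQ]; ring
  have hy0 : (0 : ℝ) ≤ y := Nat.cast_nonneg y
  have hX0 : (0 : ℝ) < X := by exact_mod_cast (by omega : 0 < X)
  have hlogX : 0 < Real.log X := Real.log_pos (by exact_mod_cast (by omega : 1 < X))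
  have hlogXmax : 0 < Real.log Xmax := Real.log_pos (by linarith)
  have hTnotU : ∀ p ∈ T, p ∉ U := fun p hpT hpU ↦ hUa p hpU (hT p hpT).2
  have hTP : ∀ p ∈ T, ¬ p ∣ P := by
    intro p hp hpP
    rw [hPdef, (Nat.prime_iff.1 (hTp p hp)).dvd_finsetProd_iff] at hpP
    obtain ⟨q, hq, hpq⟩ := hpP
    have : p = q := (Nat.prime_dvd_prime_iff_eq (hTp p hp) (hUS q hq)).1 hpq
    subst this
    rcases mem_union.1 hq with h | h
    · exact hUa p h (hT p hp).2
    · exact hSa p h (hT p hp).2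
  have hout' : ∀ p : ℕ, p.Prime → p ∣ a.natAbs → p ∉ T → w' < p ∧ ¬ p ∣ P := by
    intro p hp hpa hpT
    refine ⟨hout p hp hpa hpT, fun hpP ↦ ?_⟩
    rw [hPdef, (Nat.prime_iff.1 hp).dvd_finsetProd_iff] at hpP
    obtain ⟨q, hq, hpq⟩ := hpP
    have : p = q := (Nat.prime_dvd_prime_iff_eq hp (hUS q hq)).1 hpq
    subst this
    rcases mem_union.1 hq with h | h
    · exact hUa p h hpa
    · exact hSa p h hpa
  have hdens_pos : ∀ R : Finset ℕ, (∀ p ∈ R, p.Prime) → 0 < sieveDensity R := by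
    intro R hR
    unfold sieveDensity
    exact prod_pos fun p hp ↦ by
      have : (2 : ℝ) ≤ p := by exact_mod_cast (hR p hp).two_le
      have : (p : ℝ)⁻¹ ≤ 1 / 2 := by rw [inv_le_comm₀ (by linarith) (by norm_num)]; linarith
      linarith
  have hVT0 : 0 < VT := hdens_pos T hTp
  have hVU0 : 0 < VU := hdens_pos U hU
  have hW0 : 0 < W := hdens_pos S hS
  have hV0 : 0 < V := hdens_pos (T ∪ U) hTU
  have hdisjTU : Disjoint T U := disjoint_left.2 fun p hpT hpU ↦ hTnotU p hpT hpU
  have hdisjUS : Disjoint U S := disjoint_left.2 fun p hpU hpS ↦ by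
    have h1 := hUz p hpU; have h2 := hSz p hpS; linarith
  have hVTU : V = VT * VU := by
    rw [hVdef, hVTdef, hVUdef, sieveDensity, sieveDensity, sieveDensity, prod_union hdisjTU]
  have hφP : (P.totient : ℝ) = P * (VU * W) := by
    have h1 := sieveDensity_eq_totient_div (U ∪ S) hUS
    have h2 : sieveDensity (U ∪ S) = VU * W := by
      rw [hVUdef, hWdef, sieveDensity, sieveDensity, sieveDensity, prod_union hdisjUS]
    rw [h2, ← hPdef, eq_div_iff hP0R.ne'] at h1
    linarith
  -- ### step 1: double counting
  have h1 := sum_rowCount_eq a y D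
  -- ### step 2: the columns from above
  have h2 := sum_columns_le hP1 hQ ha hX2 hXQ hXmax hXmax2 hε0 hε1 hKBT hzBT hPs hPsP hfac hψ hBT
  -- ### step 3: the rows from below
  have hδ1 : η / 20 ≤ 1 := by linarith
  have hLampos : 100 ≤ η * ((1 - η / 20) * Lam) := ht2
  have hLam1' : 1 ≤ η / 100 * ((1 - η / 20) * Lam) := by linarith
  have hLam1 : 0 ≤ (1 - η / 20) * Lam - 1 := by
    have : η / 100 * ((1 - η / 20) * Lam) ≤ 1 * ((1 - η / 20) * Lam) := by
      refine mul_le_mul_of_nonneg_right (by linarith) ?_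
      by_contra hneg; push Not at hneg
      have : η / 100 * ((1 - η / 20) * Lam) < 0 := mul_neg_of_pos_of_neg (by positivity) hneg
      linarith
    linarith
  have h3 := card_mul_le_sum_rows (Q₁ := Q₁) (Q₂ := Q₂) (P := P) (y := y) (N := N) ha hδ1 hyq hLam hLam1
  -- ### step 4: the live columns from above, and their weights
  have h4a := card_liveSet_le (y := y) (U := U) (S := S) hT hUS
  have h4b := hCB T U S z w y k D_B hTp hU hS hTz hUz hSz hTnotU hw hSw hyw hz hzD hk
  have hLv : (#Lv : ℝ) ≤ y * V * W * (1 - eSymm S (k + 1)) + ErrB := by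
    have e : (#Lv : ℝ) ≤ shiftedSiftedCount y T (U ∪ S) := by rw [hLvdef, hPdef]; exact_mod_cast h4a
    rw [hErrBdef, hVdef, hWdef]; linarith
  have hLvsub : Lv ⊆ Icc 1 y := filter_subset _ _
  have h5 := sum_primeWeight_le_card_add (L := Lv) (y := y) hm₀ hPs hPsm hLvsub
  have h6 : (#(Lv.filter fun r ↦ K ∣ r) : ℝ) ≤ y / K := by
    have e1 := card_liveSet_filter_ge a y P K
    have e2 := Finset.card_filter_add_card_filter_not (s := Lv) (fun r ↦ K ∣ r)
    have e3 : (#(Lv.filter fun r ↦ K ∣ r) : ℝ) + #(Lv.filter fun r ↦ ¬ K ∣ r) = #Lv := by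
      exact_mod_cast e2
    rw [← hLvdef] at e1
    linarith
  -- ### step 5: the coprime moduli from below
  have h7a := card_moduliSet_free_le_coprime (T := T) hw' hP1 hQ ha0 hout'
  have h7b := card_moduliSet_free_eq hP1 hQ a T
  have h7c := hCF T z_T hTp hTzT P hP0 hTP Q₁ (Q₂ - Q₁) (modResidue a P) D_row hzT hzTD
  rw [← h7b, hΔQcast, ← hVTdef] at h7c
  rw [abs_le] at h7c
  rw [← hΔQdef] at h7a
  have hDcop : ΔQ / P * VT * (1 - η / 100) ≤ (#Dcop : ℝ) - Bv := by
    rw [hDcopdef, hDdef]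
    linarith [h7c.1, h7a, ht3]
  -- ### step 6: `M > 0`
  have hΔQP0 : 0 < ΔQ / P * VT := by
    have e1 : (2 : ℝ) ≤ η / 100 * (ΔQ / P * VT) := by
      have : 0 ≤ (a.natAbs.primeFactors.card : ℝ) * (ΔQ / (P * w') + 1) := by positivity
      have : 0 ≤ C_F * (ΔQ / P) * VT * Real.exp (-(Real.log D_row / Real.log z_T)) := by positivity
      linarith [ht3, hzT, hzTD]
    by_contra hneg; push Not at hneg
    have : η / 100 * (ΔQ / P * VT) ≤ 0 := mul_nonpos_of_nonneg_of_nonpos (by positivity) hneg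
    linarith
  have hΔQpos : 0 < ΔQ := by
    by_contra hneg; push Not at hneg
    have : ΔQ / P * VT ≤ 0 := mul_nonpos_of_nonpos_of_nonneg (div_nonpos_of_nonpos_of_nonneg hneg hP0R.le) hVT0.le
    linarith
  set M : ℝ := y * VT * (ΔQ / P) / Real.log X with hMdef
  have hy1R : (1 : ℝ) ≤ y := by exact_mod_cast hy1
  have hM : 0 < M := by rw [hMdef]; positivity
  -- ### step 7: the rows side of the endgame
  set A : ℝ := (1 - η / 20) * (1 - η / 100) ^ 3 with hAdef
  set Rows : ℝ := ((#Dcop : ℝ) - #(Dcop.filter fun q : ℕ ↦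
      (primeCountingModInt q a ((q : ℝ) * Real.log q ^ N) : ℝ) <
        (1 - η / 20) * ((Nat.primeCounting ⌊(q : ℝ) * Real.log q ^ N⌋₊ : ℝ) / (Nat.totient q : ℝ)))) *
      ((1 - η / 20) * Lam - 1) with hRowsdef
  have hRows_le : Rows ≤ ∑ q ∈ D, (rowCount a y q : ℝ) := by rw [hRowsdef, hDcopdef, hDdef]; exact h3
  have hMA : M * A ≤ Rows := by
    set N₁ : ℝ := ΔQ / P * VT * (1 - η / 100) with hN₁
    set N₂ : ℝ := (1 - η / 20) * Lam * (1 - η / 100) with hN₂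
    have hN₁0 : 0 ≤ N₁ := by rw [hN₁]; exact mul_nonneg hΔQP0.le (by linarith)
    have hLam0 : 0 ≤ (1 - η / 20) * Lam := by
      by_contra hneg; push Not at hneg
      have : η / 100 * ((1 - η / 20) * Lam) < 0 := mul_neg_of_pos_of_neg (by positivity) hneg
      linarith
    have hN₂0 : 0 ≤ N₂ := by rw [hN₂]; exact mul_nonneg hLam0 (by linarith)
    have e1 : N₁ ≤ (#Dcop : ℝ) - #(Dcop.filter fun q : ℕ ↦
        (primeCountingModInt q a ((q : ℝ) * Real.log q ^ N) : ℝ) <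
          (1 - η / 20) * ((Nat.primeCounting ⌊(q : ℝ) * Real.log q ^ N⌋₊ : ℝ) / (Nat.totient q : ℝ))) := by
      rw [hN₁]; linarith [hDcop, hcon]
    have e2 : N₂ ≤ (1 - η / 20) * Lam - 1 := by
      have f : (1 - η / 20) * Lam * (1 - η / 100) = (1 - η / 20) * Lam - η / 100 * ((1 - η / 20) * Lam) := by ring
      rw [hN₂, f]
      linarith only [hLam1']
    have e3 : N₁ * N₂ ≤ Rows := by
      rw [hRowsdef]; exact mul_le_mul e1 e2 hN₂0 (hN₁0.trans e1)
    -- `M A ≤ N₁ N₂`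
    have e4 : (1 - η / 100) * y / Real.log X ≤ Lam := by
      rw [div_le_iff₀ hlogX]; exact ht1
    set c₀ : ℝ := ΔQ / P * VT * (1 - η / 100) * ((1 - η / 20) * (1 - η / 100)) with hc₀
    have hc₀0 : 0 ≤ c₀ := by
      rw [hc₀]
      have : 0 ≤ 1 - η / 100 := by linarith
      have : 0 ≤ 1 - η / 20 := by linarith
      positivity
    have e5 : M * A = c₀ * ((1 - η / 100) * y / Real.log X) := by rw [hMdef, hAdef, hc₀]; ring
    have e5' : N₁ * N₂ = c₀ * Lam := by rw [hN₁, hN₂, hc₀]; ring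
    have e6 : c₀ * ((1 - η / 100) * y / Real.log X) ≤ c₀ * Lam := mul_le_mul_of_nonneg_left e4 hc₀0
    linarith
  -- ### step 8: the columns side of the endgame
  set B : ℝ := (1 + η / 100) * (1 - η) + (1 + η / 100) * (η / 100) + η / 100 with hBdef
  set cG : ℝ := (X : ℝ) / P + 1 + 2 * Real.sqrt Xmax * Real.log Xmax / Real.log X with hcG
  set κ : ℝ := (ΔQ + ε * (3 * Q₁ + Q₂)) / ((P.totient : ℝ) * Real.log X) with hκ
  set β : ℝ := KBT * ((Q₁ : ℝ) + Q₂) / ((P.totient : ℝ) * Real.log z_BT) with hβ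
  set cB : ℝ := KBT * z_BT ^ (10 : ℕ) + z_BT + 1 with hcB
  have hcG0 : 0 ≤ cG := by rw [hcG]; positivity
  have hκ0 : 0 ≤ κ := by
    rw [hκ]; exact div_nonneg (by nlinarith [(Nat.cast_nonneg Q₁ : (0:ℝ) ≤ Q₁), (Nat.cast_nonneg Q₂ : (0:ℝ) ≤ Q₂)]) (by positivity)
  have hβ0 : 0 ≤ β := by
    rw [hβ]
    have : 0 < Real.log z_BT := Real.log_pos hzBT
    positivity
  have hcB0 : 0 ≤ cB := by rw [hcB]; positivity
  set Cols : ℝ := (y : ℝ) + #Lv * cG + κ * ∑ r ∈ Lv, primeWeight Ps' r +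
    β * ∑ r ∈ Lv.filter (fun r ↦ K ∣ r), primeWeight Ps' r + #(Lv.filter fun r ↦ K ∣ r) * cB with hColsdef
  have hCols_ge : ∑ r ∈ Icc 1 y, (#{q ∈ D | (entry a r q).Prime} : ℝ) ≤ Cols := by
    rw [hColsdef, hcG, hκ, hβ, hcB, hLvdef, hDdef, hΔQdef]; exact h2
  have hw0 : ∀ r, 0 ≤ primeWeight Ps' r := fun r ↦ le_trans zero_le_one (one_le_primeWeight hPs r)
  have hMB : Cols ≤ M * B := by
    -- the weights over the live columns
    have e1 : ∑ r ∈ Lv, primeWeight Ps' r ≤ y * V * W * (1 - 99 * η / 100) := by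
      have f1 : (y : ℝ) * V * W * (1 - eSymm S (k + 1)) ≤ y * V * W * (1 - η) :=
        mul_le_mul_of_nonneg_left (by linarith) (by positivity)
      have f2 : ErrB + y * (Real.exp ((m₀ : ℝ)⁻¹) - 1) ≤ η / 100 * (y * V * W) := by
        rw [hErrBdef, hVdef, hWdef]; exact ht6
      linarith only [h5, hLv, f1, f2]
    have hφlog : 0 < (P.totient : ℝ) * Real.log X := mul_pos hφP0 hlogX
    have e2 : κ ≤ ΔQ * (1 + η / 100) / ((P.totient : ℝ) * Real.log X) := by
      rw [hκ]
      refine div_le_div_of_nonneg_right ?_ hφlog.le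
      linarith only [ht4]
    have hyVW : 0 ≤ (y : ℝ) * V * W * (1 - 99 * η / 100) := by
      have : 0 ≤ 1 - 99 * η / 100 := by linarith
      positivity
    have e3 : κ * ∑ r ∈ Lv, primeWeight Ps' r ≤
        ΔQ * (1 + η / 100) / ((P.totient : ℝ) * Real.log X) * (y * V * W * (1 - 99 * η / 100)) :=
      mul_le_mul e2 e1 (sum_nonneg fun r _ ↦ hw0 r) (hκ0.trans e2)
    have e4 : ΔQ * (1 + η / 100) / ((P.totient : ℝ) * Real.log X) * (y * V * W * (1 - 99 * η / 100)) =
        M * ((1 + η / 100) * (1 - 99 * η / 100)) := by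
      rw [hMdef, hφP, hVTU]
      field_simp
    -- the remaining terms
    have hyVW' : (#Lv : ℝ) ≤ y * V * W + ErrB := by
      have : (y : ℝ) * V * W * (1 - eSymm S (k + 1)) ≤ y * V * W * 1 :=
        mul_le_mul_of_nonneg_left (by linarith) (by positivity)
      linarith only [hLv, this]
    have e5 : (#Lv : ℝ) * cG ≤ (y * V * W + ErrB) * cG := mul_le_mul_of_nonneg_right hyVW' hcG0
    have e6 : β * ∑ r ∈ Lv.filter (fun r ↦ K ∣ r), primeWeight Ps' r ≤ β * Wbad :=
      mul_le_mul_of_nonneg_left (by rw [hLvdef, hPdef]; exact hWbad) hβ0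
    have e7 : (#(Lv.filter fun r ↦ K ∣ r) : ℝ) * cB ≤ y / K * cB := mul_le_mul_of_nonneg_right h6 hcB0
    have e8 : (y : ℝ) + (y * V * W + ErrB) * cG + β * Wbad + y / K * cB ≤ η / 100 * M := ht5
    have e9 : Cols ≤ η / 100 * M + M * ((1 + η / 100) * (1 - 99 * η / 100)) := by
      rw [hColsdef]; linarith only [e3, e4, e5, e6, e7, e8]
    have e10 : η / 100 * M + M * ((1 + η / 100) * (1 - 99 * η / 100)) = M * B := by rw [hBdef]; ring
    linarith only [e9, e10]
  exact endgame' hM hRows_le (by rw [h1]; exact hCols_ge) hMA hMB (by rw [hAdef, hBdef]; exact consts16 hη0 hη1)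

end Literature.Barriers.Parity.FriedlanderGranville
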